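import Mathlib
import Summits.KontsevichZagierPeriods.KontsevichZagierPeriods.Theses.InverseLandau
import Summits.KontsevichZagierPeriods.KontsevichZagierPeriods.Theorems.InverseLandauTateLiftingPolynomialArc
import Summits.KontsevichZagierPeriods.KontsevichZagierPeriods.Theorems.InverseLandauTateLiftingCornerShift
import Summits.KontsevichZagierPeriods.KontsevichZagierPeriods.Theorems.InverseLandauTateLiftingTateSubst
import Summits.KontsevichZagierPeriods.KontsevichZagierPeriods.Theorems.InverseLandauTateLiftingArcSpecialisation
import Summits.KontsevichZagierPeriods.KontsevichZagierPeriods.Theorems.InverseLandauTateLiftingGenLifting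
import Summits.KontsevichZagierPeriods.KontsevichZagierPeriods.Theorems.InverseLandauTateLiftingLogIntegral
import Summits.KontsevichZagierPeriods.KontsevichZagierPeriods.Theorems.InverseLandauTateLiftingBakerDecomposition
import Summits.KontsevichZagierPeriods.KontsevichZagierPeriods.Theorems.InverseLandauTateLiftingTorusFibre
import Summits.KontsevichZagierPeriods.KontsevichZagierPeriods.Theorems.InverseLandauTateLiftingZsmulRep
import Summits.KontsevichZagierPeriods.KontsevichZagierPeriods.Theorems.InverseLandauTateLiftingLogSectorAssembly
import Summits.KontsevichZagierPeriods.KontsevichZagierPeriods.Theorems.InverseLandauTateLiftingTateAnalyticContinuation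
import Summits.KontsevichZagierPeriods.KontsevichZagierPeriods.Theorems.InverseLandauTateLiftingTateToGen
import Summits.KontsevichZagierPeriods.KontsevichZagierPeriods.Theorems.InverseLandauTateLiftingRatPolyDense
import Summits.KontsevichZagierPeriods.KontsevichZagierPeriods.Theorems.InverseLandauTateLiftingAffineLogSector
import Summits.KontsevichZagierPeriods.KontsevichZagierPeriods.Theorems.InverseLandauTateLiftingDimOneCells
import Summits.KontsevichZagierPeriods.KontsevichZagierPeriods.Theorems.InverseLandauTateLiftingDimOneUnitChart
import Summits.KontsevichZagierPeriods.KontsevichZagierPeriods.Theorems.InverseLandauTateLiftingDimOneUnitKernel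
import Summits.KontsevichZagierPeriods.KontsevichZagierPeriods.Theorems.InverseLandauTateLiftingDimZeroLift
import Summits.KontsevichZagierPeriods.KontsevichZagierPeriods.Theorems.InverseLandauTateLiftingDimZeroSector
import Summits.KontsevichZagierPeriods.KontsevichZagierPeriods.Theorems.InverseLandauTateLiftingDimOneAlgCompactify
import Summits.KontsevichZagierPeriods.KontsevichZagierPeriods.Theorems.InverseLandauTateLiftingDimOneAlgUnitChart
import Summits.KontsevichZagierPeriods.KontsevichZagierPeriods.Theorems.InverseLandauTateLiftingDimZeroLiftAlg
import Summits.KontsevichZagierPeriods.KontsevichZagierPeriods.Theorems.InverseLandauTateLiftingCylinderTame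
import Summits.KontsevichZagierPeriods.KontsevichZagierPeriods.Theorems.InverseLandauTateLiftingCylinderStokes
import Summits.KontsevichZagierPeriods.KontsevichZagierPeriods.Theorems.InverseLandauTateLiftingCylinderBase
import Summits.KontsevichZagierPeriods.KontsevichZagierPeriods.Theorems.InverseLandauTateLiftingIntervalPolyPoint
import Summits.KontsevichZagierPeriods.KontsevichZagierPeriods.Theorems.InverseLandauTateLiftingPointMul
import Summits.KontsevichZagierPeriods.KontsevichZagierPeriods.Theorems.InverseLandauTateLiftingForms
import Summits.KontsevichZagierPeriods.KontsevichZagierPeriods.Theorems.InverseLandauTateLiftingAlgIndepSaturation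
import Summits.KontsevichZagierPeriods.KontsevichZagierPeriods.Theorems.InverseLandauTateLiftingProdSplit
import Summits.KontsevichZagierPeriods.KontsevichZagierPeriods.Theorems.InverseLandauTateLiftingQuarterPi
import Summits.KontsevichZagierPeriods.KontsevichZagierPeriods.Theorems.InverseLandauTateLiftingDimZeroRing
import Summits.KontsevichZagierPeriods.KontsevichZagierPeriods.Theorems.InverseLandauTateLiftingSqrtSubst
import Summits.KontsevichZagierPeriods.KontsevichZagierPeriods.Theorems.InverseLandauTateLiftingBetaThirdPi
import Summits.KontsevichZagierPeriods.KontsevichZagierPeriods.Theorems.InverseLandauTateLiftingBetaQuarterPi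
import Summits.KontsevichZagierPeriods.KontsevichZagierPeriods.Theorems.InverseLandauTateLiftingSqrtReduce
import Summits.KontsevichZagierPeriods.KontsevichZagierPeriods.Theorems.InverseLandauTateLiftingSqrtAffineReduce
import Summits.KontsevichZagierPeriods.KontsevichZagierPeriods.Theorems.InverseLandauTateLiftingSqrtAffineSector
import Summits.KontsevichZagierPeriods.KontsevichZagierPeriods.Theorems.InverseLandauTateLiftingPullback
import Summits.KontsevichZagierPeriods.KontsevichZagierPeriods.Theorems.InverseLandauTateLiftingRatChart
import Summits.KontsevichZagierPeriods.KontsevichZagierPeriods.Theorems.InverseLandauTateLiftingRatCompose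
import Summits.KontsevichZagierPeriods.KontsevichZagierPeriods.Theorems.InverseLandauTateLiftingConicChart
import Summits.KontsevichZagierPeriods.KontsevichZagierPeriods.Theorems.InverseLandauTateLiftingConicDegenerate
import Summits.KontsevichZagierPeriods.KontsevichZagierPeriods.Theorems.InverseLandauTateLiftingRootChart
import Summits.KontsevichZagierPeriods.KontsevichZagierPeriods.Theorems.InverseLandauTateLiftingBandArea
import Summits.KontsevichZagierPeriods.KontsevichZagierPeriods.Theorems.InverseLandauTateLiftingGenusZeroSector
import Summits.KontsevichZagierPeriods.KontsevichZagierPeriods.Theorems.InverseLandauTateLiftingRotationEngine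
import Summits.KontsevichZagierPeriods.KontsevichZagierPeriods.Theorems.InverseLandauTateLiftingRotationSplit
import Summits.KontsevichZagierPeriods.KontsevichZagierPeriods.Theorems.InverseLandauTateLiftingRevolutionBand
import Summits.KontsevichZagierPeriods.KontsevichZagierPeriods.Theorems.InverseLandauTateLiftingVolumeFormLift
import Summits.KontsevichZagierPeriods.KontsevichZagierPeriods.Theorems.InverseLandauTateLiftingIsotropyPlane
import Summits.KontsevichZagierPeriods.KontsevichZagierPeriods.Theorems.InverseLandauTateLiftingRadialBand
import Summits.KontsevichZagierPeriods.KontsevichZagierPeriods.Theorems.InverseLandauTateLiftingAffineChart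
import Summits.KontsevichZagierPeriods.KontsevichZagierPeriods.Theorems.InverseLandauTateLiftingSimplexChart
import Summits.KontsevichZagierPeriods.KontsevichZagierPeriods.Theorems.InverseLandauTateLiftingSimplexHull
import Summits.KontsevichZagierPeriods.KontsevichZagierPeriods.Theorems.InverseLandauTateLiftingGramInvariant
import Summits.KontsevichZagierPeriods.KontsevichZagierPeriods.Theorems.InverseLandauTateLiftingSphereArea
import Summits.KontsevichZagierPeriods.KontsevichZagierPeriods.Theorems.InverseLandauTateLiftingPolytopeSector
import Summits.KontsevichZagierPeriods.KontsevichZagierPeriods.Theorems.InverseLandauTateLiftingRotationBalls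
import Summits.KontsevichZagierPeriods.KontsevichZagierPeriods.Theorems.BetaCancellation.Negative.Torsion
import Summits.KontsevichZagierPeriods.KontsevichZagierPeriods.Theorems.InverseLandauTateLiftingEllipsoidKernel
import Summits.KontsevichZagierPeriods.KontsevichZagierPeriods.Theorems.InverseLandauTateLiftingPolytopeUnion
import Summits.KontsevichZagierPeriods.KontsevichZagierPeriods.Theorems.InverseLandauTateLiftingIsotropySpaceMeridian
import Summits.KontsevichZagierPeriods.KontsevichZagierPeriods.Theorems.InverseLandauTateLiftingConeEngine
import Summits.KontsevichZagierPeriods.KontsevichZagierPeriods.Theorems.InverseLandauTateLiftingCubeTriangulation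
import Summits.KontsevichZagierPeriods.KontsevichZagierPeriods.Theorems.InverseLandauTateLiftingSimplexValue
import Summits.KontsevichZagierPeriods.KontsevichZagierPeriods.Theorems.InverseLandauTateLiftingAxialEngine
import Summits.KontsevichZagierPeriods.KontsevichZagierPeriods.Theorems.InverseLandauTateLiftingBallValue
import Summits.KontsevichZagierPeriods.KontsevichZagierPeriods.Theorems.InverseLandauTateLiftingBallEven
import Summits.KontsevichZagierPeriods.KontsevichZagierPeriods.Theorems.InverseLandauTateLiftingBallOdd
import Summits.KontsevichZagierPeriods.KontsevichZagierPeriods.Theorems.InverseLandauTateLiftingPolydiscPow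
import Summits.KontsevichZagierPeriods.KontsevichZagierPeriods.Theorems.InverseLandauTateLiftingInversionChart
import Summits.KontsevichZagierPeriods.KontsevichZagierPeriods.Theorems.InverseLandauTateLiftingArcsinBandValue
import Summits.KontsevichZagierPeriods.KontsevichZagierPeriods.Theorems.InverseLandauTateLiftingSLTwoZCovolume
import Summits.KontsevichZagierPeriods.KontsevichZagierPeriods.Theorems.InverseLandauTateLiftingLowDimAlgSector
import Summits.KontsevichZagierPeriods.KontsevichZagierPeriods.Theorems.InverseLandauTateLiftingBetaHalfPi
import Summits.KontsevichZagierPeriods.KontsevichZagierPeriods.Theorems.InverseLandauTateLiftingRealPeriodSwap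
import Summits.KontsevichZagierPeriods.KontsevichZagierPeriods.Theorems.InverseLandauTateLiftingParabolaDescends
import Summits.KontsevichZagierPeriods.KontsevichZagierPeriods.Theorems.InverseLandauTateLiftingDepolarisationSum
import Summits.KontsevichZagierPeriods.KontsevichZagierPeriods.Theorems.InverseLandauTateLiftingBeanStoneDisc
import Summits.KontsevichZagierPeriods.KontsevichZagierPeriods.Theorems.InverseLandauTateLiftingTubeIsTwist
import Summits.KontsevichZagierPeriods.KontsevichZagierPeriods.Theorems.InverseLandauTateLiftingUnitIntervalSpin
import Summits.KontsevichZagierPeriods.KontsevichZagierPeriods.Theorems.InverseLandauTateLiftingDuplicationFamily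
import Summits.KontsevichZagierPeriods.KontsevichZagierPeriods.Theorems.InverseLandauTateLiftingLowdimDuplicationOneThird
import Summits.KontsevichZagierPeriods.KontsevichZagierPeriods.Theorems.InverseLandauTateLiftingWheelBodyToAffineChart
import Summits.KontsevichZagierPeriods.KontsevichZagierPeriods.Theorems.InverseLandauTateLiftingLogTwoSpin
import Summits.KontsevichZagierPeriods.KontsevichZagierPeriods.Theorems.InverseLandauTateLiftingCoxeterChamberTiling
import Summits.KontsevichZagierPeriods.KontsevichZagierPeriods.Theorems.InverseLandauTateLiftingRationalAngleSquares
import Summits.KontsevichZagierPeriods.KontsevichZagierPeriods.Theorems.InverseLandauTateLiftingThreeSphereVolume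
import Summits.KontsevichZagierPeriods.KontsevichZagierPeriods.Theorems.InverseLandauTateLiftingKummerLogTwo
import Summits.KontsevichZagierPeriods.KontsevichZagierPeriods.Theorems.InverseLandauTateLiftingBetaGammaTruncated
import Summits.KontsevichZagierPeriods.KontsevichZagierPeriods.Theorems.InverseLandauTateLiftingEulerReflectionRational
import Summits.KontsevichZagierPeriods.KontsevichZagierPeriods.Theorems.InverseLandauTateLiftingMinkowskiBinaryAccessible
import Summits.KontsevichZagierPeriods.KontsevichZagierPeriods.Theorems.InverseLandauTateLiftingCroftonEllipse
import Summits.KontsevichZagierPeriods.KontsevichZagierPeriods.Theorems.InverseLandauTateLiftingTriplicationThirdShift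
import Literature.NumberTheory.Transcendental.SemialgebraicRpow
import Literature.NumberTheory.Transcendental.KZDominatedFamilyRelations
import Literature.NumberTheory.Transcendental.KZSemiCanonicalReductionProofs
import Literature.NumberTheory.Transcendental.KZProductIdeal
import Literature.NumberTheory.Transcendental.KZCubicalCalculus
import Literature.NumberTheory.Transcendental.KZRulesAssociator
import Literature.NumberTheory.Transcendental.LindemannWeierstrassProofs
import Literature.NumberTheory.Transcendental.KZVolumeConjectureProofs
import Literature.NumberTheory.Transcendental.GenusZeroPeriodsMZVProofs

/-! # Crux `TateLifting` (stmt-KontsevichZagierPeriods-9129) — line `Sketch`, lead's skeleton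

Crux (route `InverseLandau`, rank 0, declared GPC-strength by the route itself):
`TateLifting : ∀ c, KZ.eval c = 0 → c ∈ KZ.relations ⊔ AddSubgroup.closure T`, where `T` ("Tate
fibres") is the set of honest representations `[(0,1)ⁿ, P/Q(·,ϖ₀)]` which are the fibre at a
real-algebraic parameter `ϖ₀ ∈ (0,ε)` of a ONE-parameter … (abridged 2026-08-17 to fit the 200 kB crux-workfile cap; full text in `Lines/Sketch.md`) -/

/-! LEAD NOTES (continuations c1–c8; full per-cycle reports in `Lines/Sketch.md`). The skeleton IMPORTS every landed
`--supports` theorem `Summit.KontsevichZagierPeriods.InverseLandau.tateLifting_<stub>` and discharges the corresponding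
`stub_*` by it; the only `sorry`s are the conjecture-grade residue `stub_genLifting` (crux-equivalent,
`tateLifting_iff_genLifting`) and the stubs of the wave in flight. Sectors by … (abridged 2026-08-17 to fit the 200 kB crux-workfile cap; full text in `Lines/Sketch.md`) -/

noncomputable section

namespace Summit.KontsevichZagierPeriods.InverseLandau.TateLiftingSketch

open MeasureTheory Set
open Literature.NumberTheory.Transcendental
open Summit.KontsevichZagierPeriods.KontsevichZagierPeriods.Theses.InverseLandau (TateLifting TateFamilyKernel)
open Summit.KontsevichZagierPeriods.InverseLandau

/-! ## The two generating sets -/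

/-- The crux's generating set `T` of TATE FIBRES, verbatim from `TateLifting`: honest representations
`[(0,1)ⁿ, P/Q(·,ϖ₀)]` that are the fibre at a real-algebraic `ϖ₀ ∈ (0,ε)` of a … [folklore] -/
def tateFibres : Set KZ.FormalRep :=
  {d : KZ.FormalRep | ∃ (n : ℕ) (P Q : MvPolynomial (Fin (n + 1)) ℚ) (ε ϖ₀ : ℝ)
      (r : KZ.IntegralRep n), 0 < ε ∧
    (∃ c₀ : ℚ, c₀ ≠ 0 ∧ ∀ z : Fin n → ℝ,
      MvPolynomial.aeval (Fin.snoc z (0 : ℝ) : Fin (n + 1) → ℝ) Q = (c₀ : ℝ)) ∧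
    (∀ (z : Fin n → ℝ) (ϖ : ℝ), (∀ i, z i ∈ Set.Icc (0 : ℝ) 1) → ϖ ∈ Set.Ioo 0 ε →
      MvPolynomial.aeval (Fin.snoc z ϖ : Fin (n + 1) → ℝ) Q ≠ 0) ∧
    (∀ ϖ ∈ Set.Ioo (0 : ℝ) ε, ∫ z in Set.pi Set.univ (fun _ : Fin n => Set.Ioo (0 : ℝ) 1),
      MvPolynomial.aeval (Fin.snoc z ϖ : Fin (n + 1) → ℝ) P /
        MvPolynomial.aeval (Fin.snoc z ϖ : Fin (n + 1) → ℝ) Q = 0) ∧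
    IsAlgebraic ℚ ϖ₀ ∧ ϖ₀ ∈ Set.Ioo 0 ε ∧
    r.domain = Set.pi Set.univ (fun _ : Fin n => Set.Ioo (0 : ℝ) 1) ∧
    Set.EqOn r.integrand (fun z => MvPolynomial.aeval (Fin.snoc z ϖ₀ : Fin (n + 1) → ℝ) P /
      MvPolynomial.aeval (Fin.snoc z ϖ₀ : Fin (n + 1) → ℝ) Q) r.domain ∧
    d = KZ.of r}

/-- `TateLifting` is literally `ker eval ⊆ relations ⊔ closure tateFibres`. [folklore] -/
theorem tateLifting_iff :
    TateLifting ↔ ∀ c : KZ.FormalRep, KZ.eval c = 0 →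
      c ∈ KZ.relations ⊔ AddSubgroup.closure tateFibres :=
  Iff.rfl

/-- The set `𝒢` of GENERIC FIBRES: algebraic specialisations `[(0,1)ⁿ, P/Q(·;a)]` of a
`k`-parameter rational vanishing identity with a TATE CORNER — `Q(z;0) ≡ c₀ ≠ 0`, `Q ≠ 0` on
`[0,1]ⁿ × U` … [folklore] -/
def genFibres : Set KZ.FormalRep :=
  {d : KZ.FormalRep | ∃ (n k : ℕ) (P Q : MvPolynomial (Fin (n + k)) ℚ) (U : Set (Fin k → ℝ))
      (γ : ℝ → (Fin k → ℝ)) (a : Fin k → ℝ) (r : KZ.IntegralRep n),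
    IsOpen U ∧ ContinuousOn γ (Set.Icc 0 1) ∧ γ 0 = 0 ∧ γ 1 = a ∧ (∀ t ∈ Set.Icc (0 : ℝ) 1, γ t ∈ U) ∧
    (∃ c₀ : ℚ, c₀ ≠ 0 ∧ ∀ z : Fin n → ℝ,
      MvPolynomial.aeval (Fin.append z (0 : Fin k → ℝ)) Q = (c₀ : ℝ)) ∧
    (∀ (z : Fin n → ℝ) (u : Fin k → ℝ), (∀ i, z i ∈ Set.Icc (0 : ℝ) 1) → u ∈ U →
      MvPolynomial.aeval (Fin.append z u) Q ≠ 0) ∧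
    (∀ u ∈ U, ∫ z in Set.pi Set.univ (fun _ : Fin n => Set.Ioo (0 : ℝ) 1),
      MvPolynomial.aeval (Fin.append z u) P / MvPolynomial.aeval (Fin.append z u) Q = 0) ∧
    (∀ j, IsAlgebraic ℚ (a j)) ∧
    r.domain = Set.pi Set.univ (fun _ : Fin n => Set.Ioo (0 : ℝ) 1) ∧
    Set.EqOn r.integrand (fun z => MvPolynomial.aeval (Fin.append z a) P /
      MvPolynomial.aeval (Fin.append z a) Q) r.domain ∧
    d = KZ.of r}

/-! ## Stub statements (as `Prop`s, so that the composition is readable) -/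

/-- CORNER SHIFT (primitive element, made positive and isolated): finitely many real-algebraic
numbers `a j` are ℚ-polynomial expressions in ONE real-algebraic `θ > 0` whose minimal polynomial … [folklore] -/
def CornerShift : Prop :=
  ∀ (k : ℕ) (a : Fin k → ℝ), (∀ j, IsAlgebraic ℚ (a j)) →
    ∃ θ : ℝ, IsAlgebraic ℚ θ ∧ 0 < θ ∧
      (∀ t ∈ Set.Ioo (0 : ℝ) θ, Polynomial.aeval t (minpoly ℚ θ) ≠ 0) ∧
      ∀ j, ∃ q : Polynomial ℚ, Polynomial.aeval θ q = a j

/-- RATIONAL WEIERSTRASS WITH PINNED NODES: for real-algebraic `θ > 0` whose minimal polynomial `m`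
has no root in `(0,θ)`, the functions `t·m(t)·q(t)`, `q ∈ ℚ[X]`, are uniformly dense in … [folklore] -/
def RatPolyDense : Prop :=
  ∀ (θ : ℝ) (g : ℝ → ℝ) (ε : ℝ), IsAlgebraic ℚ θ → 0 < θ → 0 < ε →
    (∀ t ∈ Set.Ioo (0 : ℝ) θ, Polynomial.aeval t (minpoly ℚ θ) ≠ 0) →
    ContinuousOn g (Set.Icc 0 θ) → g 0 = 0 → g θ = 0 →
    ∃ q : Polynomial ℚ, ∀ t ∈ Set.Icc (0 : ℝ) θ,
      |g t - t * Polynomial.aeval t (minpoly ℚ θ) * Polynomial.aeval t q| < ε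

/-- THE POLYNOMIAL-ARC LEMMA: for real-algebraic `θ > 0` with no conjugate in `(0,θ)`, a point
`a ∈ ℚ[θ]^k`, an open `U ⊆ ℝ^k` and a continuous path `γ : [0,θ] → U` from the corner `0` to … [folklore] -/
def PolynomialArc : Prop :=
  ∀ (k : ℕ) (θ : ℝ) (a : Fin k → ℝ) (U : Set (Fin k → ℝ)) (γ : ℝ → (Fin k → ℝ)),
    IsAlgebraic ℚ θ → 0 < θ → (∀ t ∈ Set.Ioo (0 : ℝ) θ, Polynomial.aeval t (minpoly ℚ θ) ≠ 0) →
    (∀ j, ∃ q : Polynomial ℚ, Polynomial.aeval θ q = a j) → IsOpen U →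
    ContinuousOn γ (Set.Icc 0 θ) → γ 0 = 0 → γ θ = a → (∀ t ∈ Set.Icc (0 : ℝ) θ, γ t ∈ U) →
    ∃ p : Fin k → Polynomial ℚ, (∀ j, Polynomial.aeval (0 : ℝ) (p j) = 0) ∧
      (∀ j, Polynomial.aeval θ (p j) = a j) ∧
      ∀ t ∈ Set.Icc (0 : ℝ) θ, (fun j => Polynomial.aeval t (p j)) ∈ U

/-- TATE SUBSTITUTION: substituting a polynomial arc `u = p(ϖ)` for the parameters of a rational
`ℚ`-polynomial in `(z, u)` gives a `ℚ`-polynomial in `(z, ϖ)` (`MvPolynomial.bind₁` along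
`Fin.append (X ∘ castSucc) (p · (X last))`). [folklore] -/
def TateSubst : Prop :=
  ∀ (n k : ℕ) (p : Fin k → Polynomial ℚ) (R : MvPolynomial (Fin (n + k)) ℚ),
    ∃ R' : MvPolynomial (Fin (n + 1)) ℚ, ∀ (z : Fin n → ℝ) (ϖ : ℝ),
      MvPolynomial.aeval (Fin.snoc z ϖ : Fin (n + 1) → ℝ) R' =
        MvPolynomial.aeval (Fin.append z (fun j => Polynomial.aeval ϖ (p j))) R

/-- GENERATION (the GPC-strength residue of the crux, conjecture-grade): every formal combination
with vanishing evaluation lies in `relations ⊔ closure 𝒢`. Equivalent to `TateLifting` … [cite: KontsevichZagier2001, §1.2] -/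
def GenLifting : Prop :=
  ∀ c : KZ.FormalRep, KZ.eval c = 0 → c ∈ KZ.relations ⊔ AddSubgroup.closure genFibres

/-! ## Weight-one sector: statements -/

/-- LOG UNFOLDING: `∫_{(0,1)¹} (x − 1)/(1 + (x − 1) z₀) dz = log x` for `x > 0`. [folklore] -/
def LogIntegral : Prop :=
  ∀ x : ℝ, 0 < x →
    ∫ z in Set.pi Set.univ (fun _ : Fin 1 => Set.Ioo (0 : ℝ) 1),
      (x - 1) / (1 + (x - 1) * z 0) = Real.log x

/-- BAKER DECOMPOSITION: an algebraic-coefficient relation `Σ wᵢ log αᵢ = 0` among real logarithms of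
positive real algebraic numbers is an algebraic linear combination of integer … [cite: Baker1975, Thm 2.1] -/
def BakerDecomposition : Prop :=
  ∀ (s : ℕ) (α w : Fin s → ℝ), (∀ i, 0 < α i) → (∀ i, IsAlgebraic ℚ (α i)) →
    (∀ i, IsAlgebraic ℚ (w i)) → ∑ i, w i * Real.log (α i) = 0 →
    ∃ (t : ℕ) (M : Fin t → Fin s → ℤ) (c : Fin t → ℝ), (∀ q, IsAlgebraic ℚ (c q)) ∧
      (∀ q, ∏ i, α i ^ (M q i) = 1) ∧ ∀ i, w i = ∑ q, c q * (M q i : ℝ)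

/-- TORUS FIBRE: for a multiplicative relation `Π αᵢ^{vᵢ} = 1` among positive real algebraic numbers
and an algebraic scalar `λ`, the honest representation of `λ Σ vᵢ (αᵢ−1)/(1+(αᵢ−1)z₀)` over … [folklore] -/
def TorusFibre : Prop :=
  ∀ (s : ℕ) (α : Fin s → ℝ) (v : Fin s → ℤ) (lam : ℝ) (ρ : KZ.IntegralRep 1),
    (∀ i, 0 < α i) → (∀ i, IsAlgebraic ℚ (α i)) → IsAlgebraic ℚ lam →
    ∏ i, α i ^ (v i) = 1 →
    ρ.domain = Set.pi Set.univ (fun _ : Fin 1 => Set.Ioo (0 : ℝ) 1) →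
    Set.EqOn ρ.integrand
      (fun z => lam * ∑ i, (v i : ℝ) * ((α i - 1) / (1 + (α i - 1) * z 0))) ρ.domain →
    KZ.of ρ ∈ genFibres

/-- INTEGER MULTIPLES: `[r'] − m • [r]` is a relation when `r'` is `r` with integrand scaled by
`m ∈ ℤ`. [cite: KontsevichZagier2001, §1.2] -/
def ZsmulRep : Prop :=
  ∀ (n : ℕ) (m : ℤ) (r r' : KZ.IntegralRep n), r'.domain = r.domain →
    Set.EqOn r'.integrand (fun x => (m : ℝ) * r.integrand x) r.domain →
    KZ.of r' - m • KZ.of r ∈ KZ.relations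

/-- THE WEIGHT-ONE SECTOR OF GENERATION: every vanishing `ℤ`-combination of honest log representations
`[(0,1), βᵢ (αᵢ−1)/(1+(αᵢ−1)z₀)]` (`αᵢ > 0`; `αᵢ, βᵢ` real algebraic) lies in
`relations ⊔ closure 𝒢`. [cite: KontsevichZagier2001, §1.2] -/
def LogSectorGen : Prop :=
  ∀ (s : ℕ) (α β : Fin s → ℝ) (m : Fin s → ℤ) (r : Fin s → KZ.IntegralRep 1),
    (∀ i, 0 < α i) → (∀ i, IsAlgebraic ℚ (α i)) → (∀ i, IsAlgebraic ℚ (β i)) →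
    (∀ i, (r i).domain = Set.pi Set.univ (fun _ : Fin 1 => Set.Ioo (0 : ℝ) 1)) →
    (∀ i, Set.EqOn (r i).integrand
      (fun z => β i * ((α i - 1) / (1 + (α i - 1) * z 0))) (r i).domain) →
    KZ.eval (∑ i, m i • KZ.of (r i)) = 0 →
    ∑ i, m i • KZ.of (r i) ∈ KZ.relations ⊔ AddSubgroup.closure genFibres

/-- THE AFFINE WEIGHT-ONE SECTOR WITH `π` (generation form): every vanishing `ℤ`-combination of
honest representations `[(0,1), a + γ·4/(1+z₀²) + β(α−1)/(1+(α−1)z₀)]` of the numbers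
`a + γπ + β` … [cite: Baker1975, Thm 2.1] -/
def AffineLogSectorGen : Prop :=
  ∀ (s : ℕ) (α β γ a : Fin s → ℝ) (m : Fin s → ℤ) (r : Fin s → KZ.IntegralRep 1),
    (∀ i, 0 < α i) → (∀ i, IsAlgebraic ℚ (α i)) → (∀ i, IsAlgebraic ℚ (β i)) →
    (∀ i, IsAlgebraic ℚ (γ i)) → (∀ i, IsAlgebraic ℚ (a i)) →
    (∀ i, (r i).domain = Set.pi Set.univ (fun _ : Fin 1 => Set.Ioo (0 : ℝ) 1)) →
    (∀ i, Set.EqOn (r i).integrand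
      (fun z => a i + γ i * (4 / (1 + z 0 ^ 2)) + β i * ((α i - 1) / (1 + (α i - 1) * z 0)))
      (r i).domain) →
    KZ.eval (∑ i, m i • KZ.of (r i)) = 0 →
    ∑ i, m i • KZ.of (r i) ∈ KZ.relations ⊔ AddSubgroup.closure genFibres

/-! ## The converse `T ⊆ 𝒢`: statements -/

/-- ANALYTIC CONTINUATION OF VANISHING TATE PERIODS: if `Q ≠ 0` on `[0,1]ⁿ × [a,b]` and the cube
integral of `P/Q(·,ϖ)` vanishes for `ϖ` in a non-empty open subinterval `(c,d) ⊆ [a,b]`, … [folklore] -/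
def TateAnalyticContinuation : Prop :=
  ∀ (n : ℕ) (P Q : MvPolynomial (Fin (n + 1)) ℚ) (a b c d : ℝ), a ≤ c → c < d → d ≤ b →
    (∀ (z : Fin n → ℝ) (ϖ : ℝ), (∀ i, z i ∈ Set.Icc (0 : ℝ) 1) → ϖ ∈ Set.Icc a b →
      MvPolynomial.aeval (Fin.snoc z ϖ : Fin (n + 1) → ℝ) Q ≠ 0) →
    (∀ ϖ ∈ Set.Ioo c d, ∫ z in Set.pi Set.univ (fun _ : Fin n => Set.Ioo (0 : ℝ) 1),
      MvPolynomial.aeval (Fin.snoc z ϖ : Fin (n + 1) → ℝ) P /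
        MvPolynomial.aeval (Fin.snoc z ϖ : Fin (n + 1) → ℝ) Q = 0) →
    ∀ ϖ ∈ Set.Icc a b, ∫ z in Set.pi Set.univ (fun _ : Fin n => Set.Ioo (0 : ℝ) 1),
      MvPolynomial.aeval (Fin.snoc z ϖ : Fin (n + 1) → ℝ) P /
        MvPolynomial.aeval (Fin.snoc z ϖ : Fin (n + 1) → ℝ) Q = 0

/-- TATE FIBRES ARE GENERIC FIBRES: a one-parameter admissible identically-vanishing Tate family on
`(0,ε)` is admissible on an open interval `(−δ, ε) ∋ 0` (compactness at the Tate corner) and … [folklore] -/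
def TateToGen : Prop :=
  tateFibres ⊆ genFibres

/-! ## Stubs -/

/-- stub 1 — `RatPolyDense` (size M). CLOSED: p103810
`Theorems/InverseLandauTateLiftingRatPolyDense.lean`. [folklore] -/
theorem stub_ratPolyDense : RatPolyDense :=
  tateLifting_ratPolyDense

/-- stub 2 — the polynomial-arc lemma from density (size M). CLOSED: p103514
`Theorems/InverseLandauTateLiftingPolynomialArc.lean`. [folklore] -/
theorem stub_polynomialArc : RatPolyDense → PolynomialArc :=
  tateLifting_polynomialArc

/-- stub 3 — corner shift / primitive element (size M). CLOSED: p103848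
`Theorems/InverseLandauTateLiftingCornerShift.lean`. [folklore] -/
theorem stub_cornerShift : CornerShift :=
  tateLifting_cornerShift

/-- stub 4 — Tate substitution (size S). CLOSED: p103350
`Theorems/InverseLandauTateLiftingTateSubst.lean`. [folklore] -/
theorem stub_tateSubst : TateSubst :=
  tateLifting_tateSubst

/-- stub 5 — arc specialisation: every generic fibre is a Tate fibre (size M). CLOSED: p103552
`Theorems/InverseLandauTateLiftingArcSpecialisation.lean`. [folklore] -/
theorem stub_arcSpecialisation : CornerShift → PolynomialArc → TateSubst → genFibres ⊆ tateFibres :=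
  tateLifting_arcSpecialisation

/-- stub 6 — generation (conjecture-grade residue; see `GenLifting`): OPEN. It is implied by the
kernel form of Conjecture 1 (`genLifting_of_kzKernelConjecture` below, landed as p107000) and … [cite: KontsevichZagier2001, §1.2] -/
theorem stub_genLifting : GenLifting := by
  sorry

/-- The residue is implied by `KZKernelConjecture` (landed, p107000). [cite: KontsevichZagier2001, §1.2] -/
theorem genLifting_of_kzKernelConjecture (hK : KZKernelConjecture) : GenLifting :=
  tateLifting_genLifting_of_kzKernelConjecture hK

/-- stub 7 — the log unfolding (size S). CLOSED: p105923
`Theorems/InverseLandauTateLiftingLogIntegral.lean`. [folklore] -/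
theorem stub_logIntegral : LogIntegral :=
  tateLifting_logIntegral

/-- stub 8 — Baker decomposition (size M; uses `baker_holds`). CLOSED: p105988
`Theorems/InverseLandauTateLiftingBakerDecomposition.lean`. [cite: Baker1975, Thm 2.1] -/
theorem stub_bakerDecomposition : BakerDecomposition :=
  tateLifting_bakerDecomposition

/-- stub 9 — torus fibre, from the log unfolding (size L). CLOSED: p106312
`Theorems/InverseLandauTateLiftingTorusFibre.lean`. [folklore] -/
theorem stub_torusFibre : LogIntegral → TorusFibre :=
  tateLifting_torusFibre

/-- stub 10 — integer multiples (size S). CLOSED: p105905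
`Theorems/InverseLandauTateLiftingZsmulRep.lean`. [cite: KontsevichZagier2001, §1.2] -/
theorem stub_zsmulRep : ZsmulRep :=
  tateLifting_zsmulRep

/-- stub 11 — assembly of the weight-one sector (size M). CLOSED: p105883
`Theorems/InverseLandauTateLiftingLogSectorAssembly.lean`. [cite: KontsevichZagier2001, §1.2] -/
theorem stub_logSectorAssembly :
    BakerDecomposition → LogIntegral → TorusFibre → ZsmulRep → LogSectorGen :=
  tateLifting_logSectorAssembly

/-- stub 12 — analytic continuation of vanishing Tate periods (size L). CLOSED: p107979
`Theorems/InverseLandauTateLiftingTateAnalyticContinuation.lean`. [folklore] -/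
theorem stub_tateAnalyticContinuation : TateAnalyticContinuation :=
  tateLifting_tateAnalyticContinuation

/-- stub 13 — Tate fibres are generic fibres, from analytic continuation (size M). CLOSED: p107579
`Theorems/InverseLandauTateLiftingTateToGen.lean`. [folklore] -/
theorem stub_tateToGen : TateAnalyticContinuation → TateToGen :=
  tateLifting_tateToGen

/-- stub 14 — the affine weight-one sector with `π` (size M; inhomogeneous Baker with `2πi`:
`baker_sum_eq_zero`, `baker_relation_span_int`, then the landed weight-one sector). CLOSED: … [cite: Baker1975, Thm 2.1] -/
theorem stub_affineLogSector : AffineLogSectorGen :=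
  tateLifting_affineLogSector

/-! ## Composition -/

/-- Presentation lifting is free: `closure 𝒢 ≤ relations ⊔ closure T`. [folklore] -/
theorem closure_genFibres_le :
    AddSubgroup.closure genFibres ≤ KZ.relations ⊔ AddSubgroup.closure tateFibres :=
  (AddSubgroup.closure_mono
    (stub_arcSpecialisation stub_cornerShift (stub_polynomialArc stub_ratPolyDense)
      stub_tateSubst)).trans le_sup_right

/-- **The line closes the crux modulo its stubs**: `GenLifting` and `genFibres ⊆ tateFibres` give
`TateLifting` by monotonicity of `AddSubgroup.closure` and `sup_le`. [folklore] -/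
theorem TateLifting_of : TateLifting := by
  rw [tateLifting_iff]
  intro c hc
  exact sup_le le_sup_left closure_genFibres_le (stub_genLifting c hc)

/-- **The weight-one sector of the crux, modulo stubs 7–11 (all theorems on paper; Baker is proved
in the tree)**: every vanishing `ℤ`-combination of honest log representations
`[(0,1), βᵢ` … [cite: Baker1975, Thm 2.1] -/
theorem TateLifting_logSector :
    ∀ (s : ℕ) (α β : Fin s → ℝ) (m : Fin s → ℤ) (r : Fin s → KZ.IntegralRep 1),
      (∀ i, 0 < α i) → (∀ i, IsAlgebraic ℚ (α i)) → (∀ i, IsAlgebraic ℚ (β i)) →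
      (∀ i, (r i).domain = Set.pi Set.univ (fun _ : Fin 1 => Set.Ioo (0 : ℝ) 1)) →
      (∀ i, Set.EqOn (r i).integrand
        (fun z => β i * ((α i - 1) / (1 + (α i - 1) * z 0))) (r i).domain) →
      KZ.eval (∑ i, m i • KZ.of (r i)) = 0 →
      ∑ i, m i • KZ.of (r i) ∈ KZ.relations ⊔ AddSubgroup.closure tateFibres :=
  fun s α β m r hα hαalg hβalg hdom hint hev =>
    sup_le le_sup_left closure_genFibres_le
      (stub_logSectorAssembly stub_bakerDecomposition stub_logIntegral
        (stub_torusFibre stub_logIntegral) stub_zsmulRep s α β m r hα hαalg hβalg hdom hint hev)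

/-- **The affine weight-one sector of the crux, with `π`** (modulo stub 14): every vanishing
`ℤ`-combination of honest representations of numbers `a + γπ + β log α` (`α > 0`; `a, γ, β, α` real
algebraic) lies in `KZ.relations ⊔ closure T`. [cite: Baker1975, Thm 2.1] -/
theorem TateLifting_affineLogSector :
    ∀ (s : ℕ) (α β γ a : Fin s → ℝ) (m : Fin s → ℤ) (r : Fin s → KZ.IntegralRep 1),
      (∀ i, 0 < α i) → (∀ i, IsAlgebraic ℚ (α i)) → (∀ i, IsAlgebraic ℚ (β i)) →
      (∀ i, IsAlgebraic ℚ (γ i)) → (∀ i, IsAlgebraic ℚ (a i)) →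
      (∀ i, (r i).domain = Set.pi Set.univ (fun _ : Fin 1 => Set.Ioo (0 : ℝ) 1)) →
      (∀ i, Set.EqOn (r i).integrand
        (fun z => a i + γ i * (4 / (1 + z 0 ^ 2)) + β i * ((α i - 1) / (1 + (α i - 1) * z 0)))
        (r i).domain) →
      KZ.eval (∑ i, m i • KZ.of (r i)) = 0 →
      ∑ i, m i • KZ.of (r i) ∈ KZ.relations ⊔ AddSubgroup.closure tateFibres :=
  fun s α β γ a m r hα hαa hβa hγa haa hdom hint hev =>
    sup_le le_sup_left closure_genFibres_le
      (stub_affineLogSector s α β γ a m r hα hαa hβa hγa haa hdom hint hev)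

/-- The two generating sets have the same closure: `closure T = closure 𝒢` (stubs 1–5 and 12–13).
[folklore] -/
theorem closure_tateFibres_eq_closure_genFibres :
    AddSubgroup.closure tateFibres = AddSubgroup.closure genFibres :=
  le_antisymm (AddSubgroup.closure_mono (stub_tateToGen stub_tateAnalyticContinuation))
    (AddSubgroup.closure_mono
      (stub_arcSpecialisation stub_cornerShift (stub_polynomialArc stub_ratPolyDense)
        stub_tateSubst))

/-- **Normal form of the crux**: `TateLifting ↔ GenLifting` — the crux IS the generation statement
for multi-parameter corner-anchored vanishing identities (modulo stubs 1–5, landed, and 12–13).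
[folklore] -/
theorem tateLifting_iff_genLifting : TateLifting ↔ GenLifting := by
  rw [tateLifting_iff]
  unfold GenLifting
  rw [closure_tateFibres_eq_closure_genFibres]


/-! ## Dimension-one rational sector: statements (continuation lead c2) -/

/-- 1-CELLS WITH ALGEBRAIC BREAK POINTS: a one-dimensional representation on a BOUNDED domain differs by
relations from the sum of its restrictions to finitely many open intervals with … [folklore] -/
def DimOneCells : Prop :=
  ∀ r : KZ.IntegralRep 1, Bornology.IsBounded r.domain →
    ∃ (k : ℕ) (u v : Fin k → ℝ) (ρ : Fin k → KZ.IntegralRep 1),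
      (∀ j, IsAlgebraic ℚ (u j) ∧ IsAlgebraic ℚ (v j) ∧ u j < v j) ∧
      (∀ j, (ρ j).domain = {x | x 0 ∈ Set.Ioo (u j) (v j)}) ∧
      (∀ j, (ρ j).domain ⊆ r.domain) ∧
      (∀ j, (ρ j).integrand = r.integrand) ∧
      KZ.of r - ∑ j, KZ.of (ρ j) ∈ KZ.relations

/-- UNIT CHART OF AN INTERVAL PIECE: a KZ-rational representation `[(u,v), p/q]` (`u < v` real
algebraic, `p q ∈ ℚ[x]`, `q ≠ 0` on `(u,v)`, `p/q ∈ L¹(u,v)`) differs by relations from a … [cite: ViuSos2021, §2.3] -/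
def DimOneUnitChart : Prop :=
  ∀ (u v : ℝ), IsAlgebraic ℚ u → IsAlgebraic ℚ v → u < v →
    ∀ ρ : KZ.IntegralRep 1, ρ.domain = {x | x 0 ∈ Set.Ioo u v} → ρ.IsRational →
      ∃ (p q : Polynomial ℝ) (ρ' : KZ.IntegralRep 1),
        (∀ n, IsAlgebraic ℚ (p.coeff n)) ∧ (∀ n, IsAlgebraic ℚ (q.coeff n)) ∧
        (∀ t ∈ Set.Icc (0 : ℝ) 1, q.eval t ≠ 0) ∧
        ρ'.domain = {x | x 0 ∈ Set.Ioo (0 : ℝ) 1} ∧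
        Set.EqOn ρ'.integrand (fun x => p.eval (x 0) / q.eval (x 0)) ρ'.domain ∧
        KZ.of ρ - KZ.of ρ' ∈ KZ.relations

/-- UNIT-FORM KERNEL: a `ℤ`-combination of unit-form representations `[(0,1), Pⱼ/Qⱼ]` (`Pⱼ, Qⱼ ∈ ℝ[x]`
with real-algebraic coefficients, `Qⱼ ≠ 0` on `[0,1]`) with vanishing evaluation is a … [cite: Baker1975, Thm 2.1] -/
def DimOneUnitKernel : Prop :=
  ∀ (k : ℕ) (m : Fin k → ℤ) (p q : Fin k → Polynomial ℝ) (ρ : Fin k → KZ.IntegralRep 1),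
    (∀ j n, IsAlgebraic ℚ ((p j).coeff n)) → (∀ j n, IsAlgebraic ℚ ((q j).coeff n)) →
    (∀ j, ∀ t ∈ Set.Icc (0 : ℝ) 1, (q j).eval t ≠ 0) →
    (∀ j, (ρ j).domain = {x | x 0 ∈ Set.Ioo (0 : ℝ) 1}) →
    (∀ j, Set.EqOn (ρ j).integrand (fun x => (p j).eval (x 0) / (q j).eval (x 0)) (ρ j).domain) →
    KZ.eval (∑ j, m j • KZ.of (ρ j)) = 0 →
    ∑ j, m j • KZ.of (ρ j) ∈ KZ.relations

/-- DIMENSION-ZERO LIFT: a KZ-rational representation of dimension `0` (a rational constant `c` over the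
point `ℝ⁰`, or the empty domain) differs by relations from a KZ-rational representation … [cite: KontsevichZagier2001, §1.2] -/
def DimZeroLift : Prop :=
  ∀ r : KZ.IntegralRep 0, r.IsRational →
    ∃ ρ : KZ.IntegralRep 1, ρ.IsRational ∧ KZ.of r - KZ.of ρ ∈ KZ.relations

/-- THE DIMENSION-ONE RATIONAL SECTOR (kernel form): every vanishing `ℤ`-combination of KZ-rational
representations of dimension `1` is a relation. [cite: KontsevichZagier2001, §1.2] -/
def DimOneRationalSector : Prop :=
  ∀ (s : ℕ) (m : Fin s → ℤ) (r : Fin s → KZ.IntegralRep 1), (∀ i, (r i).IsRational) →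
    KZ.eval (∑ i, m i • KZ.of (r i)) = 0 → ∑ i, m i • KZ.of (r i) ∈ KZ.relations

/-! ## Dimension-one rational sector: stubs 15–18 (CLOSED, wave c2-1) -/

/-- stub 15 — 1-cells with algebraic break points (size M). CLOSED: p118390
`Theorems/InverseLandauTateLiftingDimOneCells.lean`. [folklore] -/
theorem stub_dimOneCells : DimOneCells :=
  tateLifting_dimOneCells

/-- stub 16 — unit chart of an interval piece (size L). CLOSED: p119055
`Theorems/InverseLandauTateLiftingDimOneUnitChart.lean`. [cite: ViuSos2021, §2.3] -/
theorem stub_dimOneUnitChart : DimOneUnitChart :=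
  tateLifting_dimOneUnitChart

/-- stub 17 — unit-form kernel: merge + the dimension-one transfer `algCoeffKernelDimOne` over the seven
landed `TateFamilyKernelCurves` stubs (size M). CLOSED: p119381
`Theorems/InverseLandauTateLiftingDimOneUnitKernel.lean`. [cite: Baker1975, Thm 2.1] -/
theorem stub_dimOneUnitKernel : DimOneUnitKernel :=
  tateLifting_dimOneUnitKernel

/-- stub 18 — dimension-zero lift (size S). CLOSED: p119584
`Theorems/InverseLandauTateLiftingDimZeroLift.lean`. [cite: KontsevichZagier2001, §1.2] -/
theorem stub_dimZeroLift : DimZeroLift :=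
  tateLifting_dimZeroLift

/-! ## Dimension-one rational sector: composition -/

/-- KZ-rationality passes to a representation on a subdomain with the same integrand. [folklore] -/
theorem isRational_of_subset {r ρ : KZ.IntegralRep 1} (hr : r.IsRational) (hd : ρ.domain ⊆ r.domain)
    (hi : ρ.integrand = r.integrand) : ρ.IsRational := by
  obtain ⟨p, q, hq, hpq⟩ := hr
  exact ⟨p, q, fun x hx => hq x (hd hx), fun x hx => by rw [hi]; exact hpq (hd hx)⟩

/-- **The dimension-one rational sector from stubs 15–17**: compactify every representation (Viu-Sos,
`KZ.exists_sub_sum_bounded_mem_relations`), cut the bounded pieces into 1-cells … [cite: KontsevichZagier2001, §1.2] -/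
theorem dimOneRationalSector_of (hC : DimOneCells) (hU : DimOneUnitChart) (hK : DimOneUnitKernel) :
    DimOneRationalSector := by
  intro s m r hrat hev
  classical
  -- Step 1: compactify (Viu-Sos): `[r i] ≡ Σ_T [R i T]`, `R i T` rational on a bounded domain
  choose R hR hRrel using fun i => KZ.exists_sub_sum_bounded_mem_relations (r i) (hrat i)
  -- Step 2: 1-cells of every bounded piece
  choose k u v ρ halg hρd hρsub hρi hρrel using fun i T => hC (R i T) (hR i T).2
  -- Step 3: unit chart of every cell
  have hρrat : ∀ i T j, (ρ i T j).IsRational := fun i T j =>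
    isRational_of_subset (hR i T).1 (hρsub i T j) (hρi i T j)
  choose p q ρ' hp hq hq0 hρ'd hρ'i hρ'rel using fun i T j =>
    hU (u i T j) (v i T j) (halg i T j).1 (halg i T j).2.1 (halg i T j).2.2 (ρ i T j) (hρd i T j)
      (hρrat i T j)
  -- Step 4: flatten the index set `Σ i, Σ T, Fin (k i T)` to `Fin K`
  obtain ⟨K, ⟨e⟩⟩ := Finite.exists_equiv_fin (Σ i : Fin s, Σ T : Finset (Fin 1), Fin (k i T))
  -- Step 5: the flattened combination is the nested one
  have hsum : ∑ l : Fin K, m (e.symm l).1 • KZ.of (ρ' (e.symm l).1 (e.symm l).2.1 (e.symm l).2.2) =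
      ∑ i, m i • ∑ T, ∑ j, KZ.of (ρ' i T j) := by
    have e1 : ∑ l : Fin K, m (e.symm l).1 • KZ.of (ρ' (e.symm l).1 (e.symm l).2.1 (e.symm l).2.2) =
        ∑ x : (Σ i : Fin s, Σ T : Finset (Fin 1), Fin (k i T)), m x.1 • KZ.of (ρ' x.1 x.2.1 x.2.2) :=
      Fintype.sum_equiv e.symm _ _ fun l => rfl
    rw [e1]
    simp only [Fintype.sum_sigma, Finset.smul_sum]
  -- Step 6: the difference with the original combination is a relation
  have hdiff : ∑ i, m i • KZ.of (r i) - ∑ i, m i • ∑ T, ∑ j, KZ.of (ρ' i T j) ∈ KZ.relations := by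
    rw [← Finset.sum_sub_distrib]
    refine sum_mem fun i _ => ?_
    rw [← smul_sub]
    refine KZ.relations.zsmul_mem ?_ _
    have h1 : ∀ T, KZ.of (R i T) - ∑ j, KZ.of (ρ' i T j) ∈ KZ.relations := fun T => by
      have h2 : ∑ j, KZ.of (ρ i T j) - ∑ j, KZ.of (ρ' i T j) ∈ KZ.relations := by
        rw [← Finset.sum_sub_distrib]
        exact sum_mem fun j _ => hρ'rel i T j
      have h3 := KZ.relations.add_mem (hρrel i T) h2
      rwa [sub_add_sub_cancel] at h3
    have h4 : ∑ T, KZ.of (R i T) - ∑ T, ∑ j, KZ.of (ρ' i T j) ∈ KZ.relations := by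
      rw [← Finset.sum_sub_distrib]
      exact sum_mem fun T _ => h1 T
    have h5 := KZ.relations.add_mem (hRrel i) h4
    rwa [sub_add_sub_cancel] at h5
  -- Step 7: the flattened combination has vanishing evaluation (soundness of the moves)
  have hev' : KZ.eval (∑ l : Fin K, m (e.symm l).1 •
      KZ.of (ρ' (e.symm l).1 (e.symm l).2.1 (e.symm l).2.2)) = 0 := by
    have h0 := KZ.relations_le_ker_eval_holds hdiff
    rw [AddMonoidHom.mem_ker, map_sub, hev, zero_sub, neg_eq_zero] at h0
    rw [hsum, h0]
  -- Step 8: the unit-form kernel, and reassembly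
  have hker := hK K (fun l => m (e.symm l).1)
    (fun l => p (e.symm l).1 (e.symm l).2.1 (e.symm l).2.2)
    (fun l => q (e.symm l).1 (e.symm l).2.1 (e.symm l).2.2)
    (fun l => ρ' (e.symm l).1 (e.symm l).2.1 (e.symm l).2.2)
    (fun l n => hp _ _ _ n) (fun l n => hq _ _ _ n) (fun l => hq0 _ _ _) (fun l => hρ'd _ _ _)
    (fun l => hρ'i _ _ _) hev'
  rw [hsum] at hker
  have h := KZ.relations.add_mem hdiff hker
  rwa [sub_add_cancel] at h

/-- **The dimension-one rational sector of the crux** (modulo stubs 15–17): every vanishing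
`ℤ`-combination of KZ-rational representations of dimension `1` lies in `KZ.relations ⊔ closure T` — in
fact in `KZ.relations`. [cite: Baker1975, Thm 2.1] -/
theorem TateLifting_dimOneRationalSector :
    ∀ (s : ℕ) (m : Fin s → ℤ) (r : Fin s → KZ.IntegralRep 1), (∀ i, (r i).IsRational) →
      KZ.eval (∑ i, m i • KZ.of (r i)) = 0 →
      ∑ i, m i • KZ.of (r i) ∈ KZ.relations ⊔ AddSubgroup.closure tateFibres :=
  fun s m r hrat hev =>
    AddSubgroup.mem_sup_left
      (dimOneRationalSector_of stub_dimOneCells stub_dimOneUnitChart stub_dimOneUnitKernel s m r hrat hev)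

/-- KZ-rational representations of dimension `≤ 1` lift to KZ-rational representations of dimension `1`
modulo relations (`DimZeroLift` in dimension `0`, nothing to do in dimension `1`).
[cite: KontsevichZagier2001, §1.2] -/
theorem exists_isRational_one_of_le_one (hZ : DimZeroLift) :
    ∀ ⦃n : ℕ⦄, n ≤ 1 → ∀ r : KZ.IntegralRep n, r.IsRational →
      ∃ ρ : KZ.IntegralRep 1, ρ.IsRational ∧ KZ.of r - KZ.of ρ ∈ KZ.relations := by
  intro n hn r hr
  rcases Nat.le_one_iff_eq_zero_or_eq_one.mp hn with rfl | rfl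
  · exact hZ r hr
  · exact ⟨r, hr, by rw [sub_self]; exact KZ.relations.zero_mem⟩

/-- **KZ's Conjecture 1 in dimension `≤ 1`, from the sector and the dimension-zero lift**: two
KZ-rational representations of dimensions `n, m ≤ 1` with the same value are KZ-equivalent. This … [cite: Baker1975, Thm 2.1] -/
theorem kzPeriodConjecture_dim_le_one_of (hS : DimOneRationalSector) (hZ : DimZeroLift) :
    ∀ ⦃n m : ℕ⦄, n ≤ 1 → m ≤ 1 → ∀ (r : KZ.IntegralRep n) (r' : KZ.IntegralRep m),
      r.IsRational → r'.IsRational → r.value = r'.value → KZ.Equivalent r r' := by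
  intro n m hn hm r r' hr hr' hv
  obtain ⟨ρ, hρ, h1⟩ := exists_isRational_one_of_le_one hZ hn r hr
  obtain ⟨ρ', hρ', h2⟩ := exists_isRational_one_of_le_one hZ hm r' hr'
  have hvρ : ρ.value = r.value := (KZ.Equivalent.value_eq_holds h1).symm
  have hvρ' : ρ'.value = r'.value := (KZ.Equivalent.value_eq_holds h2).symm
  have e : ∑ i : Fin 2, (![1, -1] : Fin 2 → ℤ) i • KZ.of ((![ρ, ρ'] : Fin 2 → KZ.IntegralRep 1) i) =
      KZ.of ρ - KZ.of ρ' := by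
    rw [Fin.sum_univ_two]
    simp only [Matrix.cons_val_zero, Matrix.cons_val_one, one_smul, neg_smul,
      sub_eq_add_neg]
  have hev : KZ.eval (∑ i : Fin 2, (![1, -1] : Fin 2 → ℤ) i •
      KZ.of ((![ρ, ρ'] : Fin 2 → KZ.IntegralRep 1) i)) = 0 := by
    rw [e, map_sub, KZ.eval_of, KZ.eval_of, hvρ, hvρ', hv, sub_self]
  have hmem := hS 2 ![1, -1] ![ρ, ρ'] (fun i => by fin_cases i; exacts [hρ, hρ']) hev
  rw [e] at hmem
  show KZ.of r - KZ.of r' ∈ KZ.relations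
  have e2 : KZ.of r - KZ.of r' =
      (KZ.of r - KZ.of ρ) + (KZ.of ρ - KZ.of ρ') - (KZ.of r' - KZ.of ρ') := by abel
  rw [e2]
  exact KZ.relations.sub_mem (KZ.relations.add_mem h1 hmem) h2

/-- **KZ's Conjecture 1 in dimension `≤ 1`** (modulo stubs 15–18). [cite: Baker1975, Thm 2.1] -/
theorem kzPeriodConjecture_dim_le_one :
    ∀ ⦃n m : ℕ⦄, n ≤ 1 → m ≤ 1 → ∀ (r : KZ.IntegralRep n) (r' : KZ.IntegralRep m),
      r.IsRational → r'.IsRational → r.value = r'.value → KZ.Equivalent r r' :=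
  kzPeriodConjecture_dim_le_one_of
    (dimOneRationalSector_of stub_dimOneCells stub_dimOneUnitChart stub_dimOneUnitKernel)
    stub_dimZeroLift

/-- **The kernel form of Conjecture 1 on the subgroup generated by KZ-rational representations of
dimension `≤ 1`, from the sector and the dimension-zero lift.** [cite: Baker1975, Thm 2.1] -/
theorem kzKernelConjecture_dim_le_one_of (hS : DimOneRationalSector) (hZ : DimZeroLift) :
    ∀ c ∈ AddSubgroup.closure
        {d : KZ.FormalRep | ∃ (n : ℕ) (r : KZ.IntegralRep n), n ≤ 1 ∧ r.IsRational ∧ d = KZ.of r},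
      KZ.eval c = 0 → c ∈ KZ.relations := by
  intro c hc hev
  classical
  rw [← Submodule.span_int_eq_addSubgroupClosure, Submodule.mem_toAddSubgroup,
    Submodule.mem_span_set'] at hc
  obtain ⟨k, f, g, rfl⟩ := hc
  choose n r hn hr hg using fun i => (g i).2
  choose ρ hρ hρrel using fun i => exists_isRational_one_of_le_one hZ (hn i) (r i) (hr i)
  have hdiff : ∑ i, f i • ((g i : KZ.FormalRep)) - ∑ i, f i • KZ.of (ρ i) ∈ KZ.relations := by
    rw [← Finset.sum_sub_distrib]
    refine sum_mem fun i _ => ?_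
    rw [← smul_sub, hg i]
    exact KZ.relations.zsmul_mem (hρrel i) _
  have hev' : KZ.eval (∑ i, f i • KZ.of (ρ i)) = 0 := by
    have h0 := KZ.relations_le_ker_eval_holds hdiff
    rw [AddMonoidHom.mem_ker, map_sub, hev, zero_sub, neg_eq_zero] at h0
    exact h0
  have hker := hS k f ρ hρ hev'
  have h := KZ.relations.add_mem hdiff hker
  rwa [sub_add_cancel] at h

/-- **The kernel form of Conjecture 1 on the subgroup generated by KZ-rational representations of
dimension `≤ 1`** (modulo stubs 15–18). [cite: Baker1975, Thm 2.1] -/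
theorem kzKernelConjecture_dim_le_one :
    ∀ c ∈ AddSubgroup.closure
        {d : KZ.FormalRep | ∃ (n : ℕ) (r : KZ.IntegralRep n), n ≤ 1 ∧ r.IsRational ∧ d = KZ.of r},
      KZ.eval c = 0 → c ∈ KZ.relations :=
  kzKernelConjecture_dim_le_one_of
    (dimOneRationalSector_of stub_dimOneCells stub_dimOneUnitChart stub_dimOneUnitKernel)
    stub_dimZeroLift

/-! ## Dimension ≤ 1 with ALGEBRAIC coefficients, and dimension 0 unconditionally: statements
(continuation lead c3)

The dimension-one pipeline of lead c2 is coefficient-agnostic from the unit chart on (the unit-form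
kernel `DimOneUnitKernel` already takes `P, Q ∈ ℝ[x]` with real-algebraic coefficients). Replacing the
`ℚ`-reading of a KZ-rational integrand by a `ℚ̄ ∩ ℝ`-reading everywhere gives the sector of … (abridged 2026-08-17 to fit the 200 kB crux-workfile cap; full text in `Lines/Sketch.md`) -/

/-- DIMENSION-ZERO SECTOR (unconditional, Baker-free): every vanishing `ℤ`-combination of representations
over `ℝ⁰` is a relation. A representation over `ℝ⁰` has domain `∅` (then it is a … [cite: KontsevichZagier2001, §1.2] -/
def DimZeroSector : Prop :=
  ∀ (s : ℕ) (m : Fin s → ℤ) (r : Fin s → KZ.IntegralRep 0),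
    KZ.eval (∑ i, m i • KZ.of (r i)) = 0 → ∑ i, m i • KZ.of (r i) ∈ KZ.relations

/-- COMPACTIFICATION WITH ALGEBRAIC COEFFICIENTS (Viu-Sos step (a) in dimension one): a representation
of dimension `1` whose integrand is `p/q` on its domain, `p, q ∈ ℝ[x]` with real-algebraic … [cite: ViuSos2021, Thm. 2.1 and Cor. 2.1] -/
def DimOneAlgCompactify : Prop :=
  ∀ (r : KZ.IntegralRep 1) (p q : Polynomial ℝ), (∀ i, IsAlgebraic ℚ (p.coeff i)) →
    (∀ i, IsAlgebraic ℚ (q.coeff i)) → (∀ x ∈ r.domain, q.eval (x 0) ≠ 0) →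
    Set.EqOn r.integrand (fun x => p.eval (x 0) / q.eval (x 0)) r.domain →
    ∃ (k : ℕ) (ρ : Fin k → KZ.IntegralRep 1) (P Q : Fin k → Polynomial ℝ),
      (∀ j, Bornology.IsBounded (ρ j).domain) ∧
      (∀ j i, IsAlgebraic ℚ ((P j).coeff i)) ∧ (∀ j i, IsAlgebraic ℚ ((Q j).coeff i)) ∧
      (∀ j, ∀ x ∈ (ρ j).domain, (Q j).eval (x 0) ≠ 0) ∧
      (∀ j, Set.EqOn (ρ j).integrand (fun x => (P j).eval (x 0) / (Q j).eval (x 0)) (ρ j).domain) ∧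
      KZ.of r - ∑ j, KZ.of (ρ j) ∈ KZ.relations

/-- UNIT CHART WITH ALGEBRAIC COEFFICIENTS: an interval piece `[(u,v), p/q]` (`u < v` real algebraic,
`p, q ∈ ℝ[x]` with real-algebraic coefficients, `q ≠ 0` on `(u,v)`, `p/q ∈ L¹(u,v)`) … [cite: ViuSos2021, §2.3] -/
def DimOneAlgUnitChart : Prop :=
  ∀ (u v : ℝ), IsAlgebraic ℚ u → IsAlgebraic ℚ v → u < v →
    ∀ (ρ : KZ.IntegralRep 1) (p q : Polynomial ℝ), ρ.domain = {x | x 0 ∈ Set.Ioo u v} →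
      (∀ i, IsAlgebraic ℚ (p.coeff i)) → (∀ i, IsAlgebraic ℚ (q.coeff i)) →
      (∀ x ∈ ρ.domain, q.eval (x 0) ≠ 0) →
      Set.EqOn ρ.integrand (fun x => p.eval (x 0) / q.eval (x 0)) ρ.domain →
      ∃ (P Q : Polynomial ℝ) (ρ' : KZ.IntegralRep 1),
        (∀ n, IsAlgebraic ℚ (P.coeff n)) ∧ (∀ n, IsAlgebraic ℚ (Q.coeff n)) ∧
        (∀ t ∈ Set.Icc (0 : ℝ) 1, Q.eval t ≠ 0) ∧
        ρ'.domain = {x | x 0 ∈ Set.Ioo (0 : ℝ) 1} ∧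
        Set.EqOn ρ'.integrand (fun x => P.eval (x 0) / Q.eval (x 0)) ρ'.domain ∧
        KZ.of ρ - KZ.of ρ' ∈ KZ.relations

/-- DIMENSION-ZERO LIFT, unconditionally: EVERY representation over `ℝ⁰` differs by relations from a
dimension-one representation in algebraic-coefficient form (indeed a constant algebraic … [cite: KontsevichZagier2001, §1.2] -/
def DimZeroLiftAlg : Prop :=
  ∀ r : KZ.IntegralRep 0, ∃ (ρ : KZ.IntegralRep 1) (p q : Polynomial ℝ),
    (∀ i, IsAlgebraic ℚ (p.coeff i)) ∧ (∀ i, IsAlgebraic ℚ (q.coeff i)) ∧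
    (∀ x ∈ ρ.domain, q.eval (x 0) ≠ 0) ∧
    Set.EqOn ρ.integrand (fun x => p.eval (x 0) / q.eval (x 0)) ρ.domain ∧
    KZ.of r - KZ.of ρ ∈ KZ.relations

/-- THE DIMENSION-ONE SECTOR WITH ALGEBRAIC COEFFICIENTS (kernel form): every vanishing `ℤ`-combination of
dimension-one representations with integrands `pᵢ/qᵢ`, `pᵢ, qᵢ ∈ ℝ[x]` with … [cite: Baker1975, Thm 2.1] -/
def DimOneAlgSector : Prop :=
  ∀ (s : ℕ) (m : Fin s → ℤ) (r : Fin s → KZ.IntegralRep 1) (p q : Fin s → Polynomial ℝ),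
    (∀ i n, IsAlgebraic ℚ ((p i).coeff n)) → (∀ i n, IsAlgebraic ℚ ((q i).coeff n)) →
    (∀ i, ∀ x ∈ (r i).domain, (q i).eval (x 0) ≠ 0) →
    (∀ i, Set.EqOn (r i).integrand (fun x => (p i).eval (x 0) / (q i).eval (x 0)) (r i).domain) →
    KZ.eval (∑ i, m i • KZ.of (r i)) = 0 → ∑ i, m i • KZ.of (r i) ∈ KZ.relations

/-! ## Dimension ≤ 1 with algebraic coefficients: stubs 19–22 (CLOSED, wave c3-1) -/

/-- stub 19 — the dimension-zero sector, Baker-free (size S). CLOSED: p121642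
`Theorems/InverseLandauTateLiftingDimZeroSector.lean`. [cite: KontsevichZagier2001, §1.2] -/
theorem stub_dimZeroSector : DimZeroSector :=
  tateLifting_dimZeroSector

/-- stub 20 — compactification with algebraic coefficients (size M). CLOSED: p121775
`Theorems/InverseLandauTateLiftingDimOneAlgCompactify.lean`. [cite: ViuSos2021, Thm. 2.1 and Cor. 2.1] -/
theorem stub_dimOneAlgCompactify : DimOneAlgCompactify :=
  tateLifting_dimOneAlgCompactify

/-- stub 21 — unit chart with algebraic coefficients (size S–M). CLOSED: p121666
`Theorems/InverseLandauTateLiftingDimOneAlgUnitChart.lean`. [cite: ViuSos2021, §2.3] -/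
theorem stub_dimOneAlgUnitChart : DimOneAlgUnitChart :=
  tateLifting_dimOneAlgUnitChart

/-- stub 22 — dimension-zero lift, unconditionally (size S). CLOSED: p121702
`Theorems/InverseLandauTateLiftingDimZeroLiftAlg.lean`. [cite: KontsevichZagier2001, §1.2] -/
theorem stub_dimZeroLiftAlg : DimZeroLiftAlg :=
  tateLifting_dimZeroLiftAlg

/-! ## Dimension ≤ 1 with algebraic coefficients: composition — LANDED verbatim (def-free) in
`Theorems/InverseLandauTateLiftingLowDimAlgSector.lean` (`las_exists_algReading_of_isRational`, `tateLifting_dimOneAlgSector`,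
`TateLifting_dimOneAlgSector`, `kzPeriodConjecture_dim_zero`, `kzKernelConjecture_lowDimAlg`, `kzPeriodConjecture_dim_one_algCoeff`,
`kzPeriodConjecture_dim_one_rational_algCoeff`, `kzPeriodConjecture_dim_zero_one_algCoeff`) and `…DimOneSector.lean`; the in-skeleton
copies (`exists_algReading_of_isRational`, `dimOneAlgSector_of`, `dimOneAlgSector`, `dimOneRationalSector_of_alg`, `dimZeroPair_of`,
`dimZeroPair`, `lowDimAlgKernel_of`, `algPair_of`, `algPair`) were removed by lead c10 (2026-08-17) to keep the skeleton under the
200 kB crux-workfile cap; `lowDimAlgKernel` (used by the Fubini sector below) is kept as an alias of the landed theorem. -/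

/-- **Conjecture 1 (kernel form) on the dimension-≤-1 algebraic-coefficient sector** — alias of the landed
`kzKernelConjecture_lowDimAlg` (`Theorems/InverseLandauTateLiftingLowDimAlgSector.lean`). [cite: Baker1975, Thm 2.1] -/
theorem lowDimAlgKernel :
    ∀ c ∈ AddSubgroup.closure
        {d : KZ.FormalRep | (∃ r : KZ.IntegralRep 0, d = KZ.of r) ∨
          ∃ (r : KZ.IntegralRep 1) (p q : Polynomial ℝ), (∀ i, IsAlgebraic ℚ (p.coeff i)) ∧
            (∀ i, IsAlgebraic ℚ (q.coeff i)) ∧ (∀ x ∈ r.domain, q.eval (x 0) ≠ 0) ∧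
            Set.EqOn r.integrand (fun x => p.eval (x 0) / q.eval (x 0)) r.domain ∧ d = KZ.of r},
      KZ.eval c = 0 → c ∈ KZ.relations :=
  kzKernelConjecture_lowDimAlg

/-! ## The all-dimensional cylinder / Fubini sector: statements (continuation lead c4)

Generators of every dimension. A CYLINDER REPRESENTATION is an honest representation over the open cube
`(0,1)ⁿ⁺¹` whose integrand is `P(z)/q(z₀)` with `P ∈ K[z₀,…,z_n]`, `q ∈ K[x]`, `K = ℚ̄ ∩ ℝ`
(`algebraicClosure ℚ ℝ`, the field of real algebraic numbers) and `q ≠ 0` on `[0,1]`; its value is a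
`K`-combination of the Baker periods … (abridged 2026-08-17 to fit the 200 kB crux-workfile cap; full text in `Lines/Sketch.md`) -/

/-- TAMENESS OF CYLINDER INTEGRANDS: for `P ∈ K[z₀,…,z_n]`, `q ∈ K[x]` with `q ≠ 0` on `[0,1]`
(`K = algebraicClosure ℚ ℝ`), the function `z ↦ P(z)/q(z₀)` is real-analytic near the closed cube … [folklore] -/
def CylinderTame : Prop :=
  ∀ (n : ℕ) (P : MvPolynomial (Fin (n + 1)) (algebraicClosure ℚ ℝ))
    (q : Polynomial (algebraicClosure ℚ ℝ)),
    (∀ t ∈ Set.Icc (0 : ℝ) 1, Polynomial.aeval t q ≠ 0) →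
    AnalyticOnNhd ℝ (fun z : Fin (n + 1) → ℝ => MvPolynomial.aeval z P / Polynomial.aeval (z 0) q)
        (KZ.cube (n + 1)) ∧
      IsSemialgebraicFunOn ℚ (KZ.cube (n + 1))
        (fun z : Fin (n + 1) → ℝ => MvPolynomial.aeval z P / Polynomial.aeval (z 0) q)

/-- THE CYLINDER STOKES STEP: a cylinder representation `[(0,1)ⁿ⁺², P(z)/q(z₀)]` differs by relations from a
cylinder representation `[(0,1)ⁿ⁺¹, P′(z)/q(z₀)]` in one variable less, `P′ = G(·,1)` … [cite: KontsevichZagier2001, §1.2] -/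
def CylinderStokes : Prop :=
  ∀ (n : ℕ) (P : MvPolynomial (Fin (n + 2)) (algebraicClosure ℚ ℝ))
    (q : Polynomial (algebraicClosure ℚ ℝ)) (r : KZ.IntegralRep (n + 2)),
    (∀ t ∈ Set.Icc (0 : ℝ) 1, Polynomial.aeval t q ≠ 0) →
    r.domain = Set.pi Set.univ (fun _ => Set.Ioo (0 : ℝ) 1) →
    Set.EqOn r.integrand (fun z => MvPolynomial.aeval z P / Polynomial.aeval (z 0) q) r.domain →
    ∃ (P' : MvPolynomial (Fin (n + 1)) (algebraicClosure ℚ ℝ)) (r' : KZ.IntegralRep (n + 1)),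
      r'.domain = Set.pi Set.univ (fun _ => Set.Ioo (0 : ℝ) 1) ∧
      Set.EqOn r'.integrand (fun z => MvPolynomial.aeval z P' / Polynomial.aeval (z 0) q) r'.domain ∧
      KZ.of r - KZ.of r' ∈ KZ.relations

/-- THE CYLINDER BASE READING: in dimension one, `P ∈ K[z₀]` (as an `MvPolynomial (Fin 1) K`) and `q ∈ K[x]`
read as real one-variable polynomials with real-algebraic coefficients … [folklore] -/
def CylinderBase : Prop :=
  ∀ (P : MvPolynomial (Fin 1) (algebraicClosure ℚ ℝ)) (q : Polynomial (algebraicClosure ℚ ℝ)),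
    ∃ (p q' : Polynomial ℝ), (∀ i, IsAlgebraic ℚ (p.coeff i)) ∧ (∀ i, IsAlgebraic ℚ (q'.coeff i)) ∧
      ∀ z : Fin 1 → ℝ, (MvPolynomial.aeval z P : ℝ) = p.eval (z 0) ∧
        (Polynomial.aeval (z 0) q : ℝ) = q'.eval (z 0)

/-- POLYNOMIAL INTERVAL TO A POINT: `[(0,1), P(z₀)]` (`P ∈ K[z₀]`) differs by relations from a representation
over the point `ℝ⁰` (one cubical Stokes move with the polynomial primitive `∫₀^{z₀}` … [cite: KontsevichZagier2001, §1.2] -/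
def IntervalPolyPoint : Prop :=
  ∀ (P : MvPolynomial (Fin 1) (algebraicClosure ℚ ℝ)) (ρ : KZ.IntegralRep 1),
    ρ.domain = Set.pi Set.univ (fun _ => Set.Ioo (0 : ℝ) 1) →
    Set.EqOn ρ.integrand (fun z => MvPolynomial.aeval z P) ρ.domain →
    ∃ r₀ : KZ.IntegralRep 0, r₀.domain = Set.univ ∧ KZ.of ρ - KZ.of r₀ ∈ KZ.relations

/-- MULTIPLICATION BY A POINT: the Fubini product `[pt, a] * [σ, f]` (`KZ.IntegralRep.prod`, dimension
`0 + k`) differs by relations from the scaled representation `[σ, a·f]` in dimension `k` … [cite: KontsevichZagier2001, §4.1] -/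
def PointMul : Prop :=
  ∀ (k : ℕ) (r₀ : KZ.IntegralRep 0) (r : KZ.IntegralRep k), r₀.domain = Set.univ →
    ∃ r' : KZ.IntegralRep k, r'.domain = r.domain ∧
      Set.EqOn r'.integrand (fun x => r₀.integrand default * r.integrand x) r.domain ∧
      KZ.of r₀ * KZ.of r - KZ.of r' ∈ KZ.relations

/-- FORMS OF THE CRUX: (i) `KZKernelConjecture ↔ TateFamilyKernel ∧ TateLifting` — within the route the crux
IS the summit modulo the other crux (`→`: Tate fibres evaluate to `0`; p107000; `←`: … [cite: KontsevichZagier2001, §1.2] -/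
def TateLiftingForms : Prop :=
  (KZKernelConjecture ↔ (TateFamilyKernel ∧ TateLifting)) ∧
  (TateLifting ↔ ∀ (n m : ℕ) (r : KZ.IntegralRep n) (r' : KZ.IntegralRep m), r.value = r'.value →
    KZ.of r - KZ.of r' ∈ KZ.relations ⊔ AddSubgroup.closure {d : KZ.FormalRep |
      ∃ (n : ℕ) (P Q : MvPolynomial (Fin (n + 1)) ℚ) (ε ϖ₀ : ℝ) (r : KZ.IntegralRep n), 0 < ε ∧
      (∃ c₀ : ℚ, c₀ ≠ 0 ∧ ∀ z : Fin n → ℝ,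
        MvPolynomial.aeval (Fin.snoc z (0 : ℝ) : Fin (n + 1) → ℝ) Q = (c₀ : ℝ)) ∧
      (∀ (z : Fin n → ℝ) (ϖ : ℝ), (∀ i, z i ∈ Set.Icc (0 : ℝ) 1) → ϖ ∈ Set.Ioo 0 ε →
        MvPolynomial.aeval (Fin.snoc z ϖ : Fin (n + 1) → ℝ) Q ≠ 0) ∧
      (∀ ϖ ∈ Set.Ioo (0 : ℝ) ε, ∫ z in Set.pi Set.univ (fun _ : Fin n => Set.Ioo (0 : ℝ) 1),
        MvPolynomial.aeval (Fin.snoc z ϖ : Fin (n + 1) → ℝ) P /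
          MvPolynomial.aeval (Fin.snoc z ϖ : Fin (n + 1) → ℝ) Q = 0) ∧
      IsAlgebraic ℚ ϖ₀ ∧ ϖ₀ ∈ Set.Ioo 0 ε ∧
      r.domain = Set.pi Set.univ (fun _ : Fin n => Set.Ioo (0 : ℝ) 1) ∧
      Set.EqOn r.integrand (fun z => MvPolynomial.aeval (Fin.snoc z ϖ₀ : Fin (n + 1) → ℝ) P /
        MvPolynomial.aeval (Fin.snoc z ϖ₀ : Fin (n + 1) → ℝ) Q) r.domain ∧
      d = KZ.of r}) ∧
  (TateLifting ↔ ∀ (n m : ℕ) (r : KZ.IntegralRep n) (r' : KZ.IntegralRep m),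
    r.IsRational → r'.IsRational → r.value = r'.value →
    KZ.of r - KZ.of r' ∈ KZ.relations ⊔ AddSubgroup.closure {d : KZ.FormalRep |
      ∃ (n : ℕ) (P Q : MvPolynomial (Fin (n + 1)) ℚ) (ε ϖ₀ : ℝ) (r : KZ.IntegralRep n), 0 < ε ∧
      (∃ c₀ : ℚ, c₀ ≠ 0 ∧ ∀ z : Fin n → ℝ,
        MvPolynomial.aeval (Fin.snoc z (0 : ℝ) : Fin (n + 1) → ℝ) Q = (c₀ : ℝ)) ∧
      (∀ (z : Fin n → ℝ) (ϖ : ℝ), (∀ i, z i ∈ Set.Icc (0 : ℝ) 1) → ϖ ∈ Set.Ioo 0 ε →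
        MvPolynomial.aeval (Fin.snoc z ϖ : Fin (n + 1) → ℝ) Q ≠ 0) ∧
      (∀ ϖ ∈ Set.Ioo (0 : ℝ) ε, ∫ z in Set.pi Set.univ (fun _ : Fin n => Set.Ioo (0 : ℝ) 1),
        MvPolynomial.aeval (Fin.snoc z ϖ : Fin (n + 1) → ℝ) P /
          MvPolynomial.aeval (Fin.snoc z ϖ : Fin (n + 1) → ℝ) Q = 0) ∧
      IsAlgebraic ℚ ϖ₀ ∧ ϖ₀ ∈ Set.Ioo 0 ε ∧
      r.domain = Set.pi Set.univ (fun _ : Fin n => Set.Ioo (0 : ℝ) 1) ∧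
      Set.EqOn r.integrand (fun z => MvPolynomial.aeval (Fin.snoc z ϖ₀ : Fin (n + 1) → ℝ) P /
        MvPolynomial.aeval (Fin.snoc z ϖ₀ : Fin (n + 1) → ℝ) Q) r.domain ∧
      d = KZ.of r})

/-! ## The cylinder / Fubini sector: stubs 23–28 (CLOSED, wave c4-1) -/

/-- stub 23 — tameness of cylinder integrands (size M). CLOSED: p124721
`Theorems/InverseLandauTateLiftingCylinderTame.lean` (wave c4-1). [folklore] -/
theorem stub_cylinderTame : CylinderTame :=
  tateLifting_cylinderTame

/-- stub 24 — the cylinder Stokes step (size M–L). CLOSED: p125092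
`Theorems/InverseLandauTateLiftingCylinderStokes.lean` (wave c4-1). [cite: KontsevichZagier2001, §1.2] -/
theorem stub_cylinderStokes : CylinderTame → CylinderStokes :=
  tateLifting_cylinderStokes

/-- stub 25 — the dimension-one reading of a cylinder integrand (size S). CLOSED: p124669
`Theorems/InverseLandauTateLiftingCylinderBase.lean` (wave c4-1). [folklore] -/
theorem stub_cylinderBase : CylinderBase :=
  tateLifting_cylinderBase

/-- stub 26 — polynomial interval to a point (size M). CLOSED: p124846
`Theorems/InverseLandauTateLiftingIntervalPolyPoint.lean` (wave c4-1). [cite: KontsevichZagier2001, §1.2] -/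
theorem stub_intervalPolyPoint : CylinderTame → IntervalPolyPoint :=
  tateLifting_intervalPolyPoint

/-- stub 27 — multiplication by a point (size M). CLOSED: p124791
`Theorems/InverseLandauTateLiftingPointMul.lean` (wave c4-1). [cite: KontsevichZagier2001, §4.1] -/
theorem stub_pointMul : PointMul :=
  tateLifting_pointMul

/-- stub 28 — forms of the crux (size S–M). CLOSED: p124745
`Theorems/InverseLandauTateLiftingForms.lean` (wave c4-1). [cite: KontsevichZagier2001, §1.2] -/
theorem stub_forms : TateLiftingForms :=
  tateLifting_forms

/-! ## The cylinder / Fubini sector: composition -/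

/-- **Cylinder reduction**: `n` Stokes steps bring a cylinder representation of dimension `n + 1` to a cylinder
representation of dimension `1` with the same denominator, modulo relations (induction on `n` over
`CylinderStokes`). [cite: KontsevichZagier2001, §1.2] -/
theorem cylinderReduce_of (hT : CylinderTame) (hS : CylinderTame → CylinderStokes) :
    ∀ (n : ℕ) (P : MvPolynomial (Fin (n + 1)) (algebraicClosure ℚ ℝ))
      (q : Polynomial (algebraicClosure ℚ ℝ)) (r : KZ.IntegralRep (n + 1)),
      (∀ t ∈ Set.Icc (0 : ℝ) 1, Polynomial.aeval t q ≠ 0) →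
      r.domain = Set.pi Set.univ (fun _ => Set.Ioo (0 : ℝ) 1) →
      Set.EqOn r.integrand (fun z => MvPolynomial.aeval z P / Polynomial.aeval (z 0) q) r.domain →
      ∃ (P₁ : MvPolynomial (Fin 1) (algebraicClosure ℚ ℝ)) (r₁ : KZ.IntegralRep 1),
        r₁.domain = Set.pi Set.univ (fun _ => Set.Ioo (0 : ℝ) 1) ∧
        Set.EqOn r₁.integrand (fun z => MvPolynomial.aeval z P₁ / Polynomial.aeval (z 0) q) r₁.domain ∧
        KZ.of r - KZ.of r₁ ∈ KZ.relations := by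
  intro n
  induction n with
  | zero =>
    intro P q r _ hd hi
    exact ⟨P, r, hd, hi, by rw [sub_self]; exact KZ.relations.zero_mem⟩
  | succ k ih =>
    intro P q r hq hd hi
    obtain ⟨P', r', hd', hi', hrel⟩ := hS hT k P q r hq hd hi
    obtain ⟨P₁, r₁, hd₁, hi₁, hrel₁⟩ := ih P' q r' hq hd' hi'
    refine ⟨P₁, r₁, hd₁, hi₁, ?_⟩
    have : KZ.of r - KZ.of r₁ = (KZ.of r - KZ.of r') + (KZ.of r' - KZ.of r₁) := by abel
    rw [this]
    exact KZ.relations.add_mem hrel hrel₁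


/-- **Cylinder representations land in the dimension-one algebraic sector**: after `cylinderReduce_of`, the
dimension-one reading `CylinderBase` exhibits the reduced representation as a … [cite: KontsevichZagier2001, §1.2] -/
theorem cylinder_toDimOne_of (hT : CylinderTame) (hS : CylinderTame → CylinderStokes) (hB : CylinderBase) :
    ∀ (n : ℕ) (P : MvPolynomial (Fin (n + 1)) (algebraicClosure ℚ ℝ))
      (q : Polynomial (algebraicClosure ℚ ℝ)) (r : KZ.IntegralRep (n + 1)),
      (∀ t ∈ Set.Icc (0 : ℝ) 1, Polynomial.aeval t q ≠ 0) →
      r.domain = Set.pi Set.univ (fun _ => Set.Ioo (0 : ℝ) 1) →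
      Set.EqOn r.integrand (fun z => MvPolynomial.aeval z P / Polynomial.aeval (z 0) q) r.domain →
      ∃ (ρ : KZ.IntegralRep 1) (p q' : Polynomial ℝ), (∀ i, IsAlgebraic ℚ (p.coeff i)) ∧
        (∀ i, IsAlgebraic ℚ (q'.coeff i)) ∧ (∀ x ∈ ρ.domain, q'.eval (x 0) ≠ 0) ∧
        Set.EqOn ρ.integrand (fun x => p.eval (x 0) / q'.eval (x 0)) ρ.domain ∧
        KZ.of r - KZ.of ρ ∈ KZ.relations := by
  intro n P q r hq hd hi
  obtain ⟨P₁, r₁, hd₁, hi₁, hrel⟩ := cylinderReduce_of hT hS n P q r hq hd hi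
  obtain ⟨p, q', hp, hq', hread⟩ := hB P₁ q
  refine ⟨r₁, p, q', hp, hq', fun x hx => ?_, fun x hx => ?_, hrel⟩
  · rw [← (hread x).2]
    refine hq (x 0) (Set.Ioo_subset_Icc_self ?_)
    rw [hd₁] at hx
    exact Set.mem_univ_pi.mp hx 0
  · rw [hi₁ hx]
    show MvPolynomial.aeval x P₁ / Polynomial.aeval (x 0) q = p.eval (x 0) / q'.eval (x 0)
    rw [(hread x).1, (hread x).2]

/-- The open cube `∏_{i : Fin 0} (0,1)` over the empty index type is the whole point `ℝ⁰`. [folklore] -/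
theorem pi_univ_Ioo_fin_zero :
    (Set.pi Set.univ (fun _ : Fin 0 => Set.Ioo (0 : ℝ) 1)) = Set.univ :=
  Set.eq_univ_of_forall fun _ => Set.mem_univ_pi.mpr fun i => i.elim0

/-- **Polynomial cubes go to a point**: `[(0,1)ⁿ, P]` (`P ∈ K[z]`) differs by relations from a representation
over the whole point `ℝ⁰` (nothing to do for `n = 0`; otherwise `n − 1` cylinder … [cite: KontsevichZagier2001, §1.2] -/
theorem cubePoly_toPoint_of (hT : CylinderTame) (hS : CylinderTame → CylinderStokes)
    (hI : CylinderTame → IntervalPolyPoint) :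
    ∀ (n : ℕ) (P : MvPolynomial (Fin n) (algebraicClosure ℚ ℝ)) (r : KZ.IntegralRep n),
      r.domain = Set.pi Set.univ (fun _ => Set.Ioo (0 : ℝ) 1) →
      Set.EqOn r.integrand (fun z => MvPolynomial.aeval z P) r.domain →
      ∃ r₀ : KZ.IntegralRep 0, r₀.domain = Set.univ ∧ KZ.of r - KZ.of r₀ ∈ KZ.relations := by
  intro n
  cases n with
  | zero =>
    intro P r hd _
    exact ⟨r, by rw [hd, pi_univ_Ioo_fin_zero], by rw [sub_self]; exact KZ.relations.zero_mem⟩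
  | succ k =>
    intro P r hd hi
    have hq : ∀ t ∈ Set.Icc (0 : ℝ) 1,
        Polynomial.aeval t (1 : Polynomial (algebraicClosure ℚ ℝ)) ≠ 0 := fun t _ => by
      rw [map_one]; exact one_ne_zero
    have hi' : Set.EqOn r.integrand (fun z => MvPolynomial.aeval z P /
        Polynomial.aeval (z 0) (1 : Polynomial (algebraicClosure ℚ ℝ))) r.domain := fun z hz => by
      rw [hi hz]; simp only [map_one, div_one]
    obtain ⟨P₁, r₁, hd₁, hi₁, hrel⟩ := cylinderReduce_of hT hS k P 1 r hq hd hi'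
    have hi₁' : Set.EqOn r₁.integrand (fun z => MvPolynomial.aeval z P₁) r₁.domain := fun z hz => by
      rw [hi₁ hz]; simp only [map_one, div_one]
    obtain ⟨r₀, hr₀, hrel₀⟩ := hI hT P₁ r₁ hd₁ hi₁'
    refine ⟨r₀, hr₀, ?_⟩
    have : KZ.of r - KZ.of r₀ = (KZ.of r - KZ.of r₁) + (KZ.of r₁ - KZ.of r₀) := by abel
    rw [this]
    exact KZ.relations.add_mem hrel hrel₀

/-! ### Generating sets of the Fubini sector -/

/-- The generators of the landed dimension-≤-1 algebraic sector (verbatim the set of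
`kzKernelConjecture_lowDimAlg`, p123439): all representations over `ℝ⁰`, and the dimension-one … [folklore] -/
def lowDimAlgGens : Set KZ.FormalRep :=
  {d : KZ.FormalRep | (∃ r : KZ.IntegralRep 0, d = KZ.of r) ∨
    ∃ (r : KZ.IntegralRep 1) (p q : Polynomial ℝ), (∀ i, IsAlgebraic ℚ (p.coeff i)) ∧
      (∀ i, IsAlgebraic ℚ (q.coeff i)) ∧ (∀ x ∈ r.domain, q.eval (x 0) ≠ 0) ∧
      Set.EqOn r.integrand (fun x => p.eval (x 0) / q.eval (x 0)) r.domain ∧ d = KZ.of r}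

/-- CYLINDER GENERATORS, every dimension `n + 1 ≥ 1`: `[(0,1)ⁿ⁺¹, P(z)/q(z₀)]`, `P ∈ K[z₀,…,z_n]`, `q ∈ K[x]`,
`q ≠ 0` on `[0,1]` (`K = algebraicClosure ℚ ℝ`). With `q = 1` these are the polynomial cubes. [folklore] -/
def cylinderGens : Set KZ.FormalRep :=
  {d : KZ.FormalRep | ∃ (n : ℕ) (P : MvPolynomial (Fin (n + 1)) (algebraicClosure ℚ ℝ))
      (q : Polynomial (algebraicClosure ℚ ℝ)) (r : KZ.IntegralRep (n + 1)),
    (∀ t ∈ Set.Icc (0 : ℝ) 1, Polynomial.aeval t q ≠ 0) ∧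
    r.domain = Set.pi Set.univ (fun _ => Set.Ioo (0 : ℝ) 1) ∧
    Set.EqOn r.integrand (fun z => MvPolynomial.aeval z P / Polynomial.aeval (z 0) q) r.domain ∧
    d = KZ.of r}

/-- WEIGHT-ZERO FACTORS: all representations over `ℝ⁰` and the polynomial cubes `[(0,1)ⁿ, P]`, `P ∈ K[z]`, of
every dimension (their values are real algebraic numbers). [folklore] -/
def weightZeroGens : Set KZ.FormalRep :=
  {d : KZ.FormalRep | (∃ r : KZ.IntegralRep 0, d = KZ.of r) ∨
    ∃ (n : ℕ) (P : MvPolynomial (Fin n) (algebraicClosure ℚ ℝ)) (r : KZ.IntegralRep n),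
      r.domain = Set.pi Set.univ (fun _ => Set.Ioo (0 : ℝ) 1) ∧
      Set.EqOn r.integrand (fun z => MvPolynomial.aeval z P) r.domain ∧ d = KZ.of r}

/-- THE FUBINI SECTOR's generators: the low-dimensional generators, the cylinder generators of every dimension,
and the Fubini products (in `KZ.FormalRep`, either order) of a weight-zero factor with any of these. [folklore] -/
def fubiniGens : Set KZ.FormalRep :=
  lowDimAlgGens ∪ cylinderGens ∪
    {d : KZ.FormalRep | ∃ b ∈ weightZeroGens, ∃ g ∈ lowDimAlgGens ∪ cylinderGens, d = b * g ∨ d = g * b}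

/-- THE FUBINI SECTOR (kernel form): every vanishing `ℤ`-combination of Fubini generators is a relation.
[cite: KontsevichZagier2001, §1.2] -/
def FubiniLowDimKernel : Prop :=
  ∀ c ∈ AddSubgroup.closure fubiniGens, KZ.eval c = 0 → c ∈ KZ.relations

/-! ### Reduction of the Fubini generators to the low-dimensional sector -/

/-- A representation over `ℝ⁰` is a relation (empty domain) or has full domain. [folklore] -/
theorem dimZero_cases (r : KZ.IntegralRep 0) : KZ.of r ∈ KZ.relations ∨ r.domain = Set.univ := by
  by_cases h0 : (default : Fin 0 → ℝ) ∈ r.domain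
  · exact Or.inr (Set.eq_univ_of_forall fun x => (Subsingleton.elim default x) ▸ h0)
  · left
    have hdom : r.domain = ∅ :=
      Set.ext fun x => ⟨fun hx => (h0 ((Subsingleton.elim x default) ▸ hx)).elim, fun h => h.elim⟩
    exact KZ.of_mem_relations_of_volume_eq_zero r (by rw [hdom, measure_empty])

/-- Weight-zero factors are relations or points with full domain, modulo relations. [cite: KontsevichZagier2001, §1.2] -/
theorem weightZero_toPoint_of (hT : CylinderTame) (hS : CylinderTame → CylinderStokes)
    (hI : CylinderTame → IntervalPolyPoint) :
    ∀ b ∈ weightZeroGens, b ∈ KZ.relations ∨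
      ∃ r₀ : KZ.IntegralRep 0, r₀.domain = Set.univ ∧ b - KZ.of r₀ ∈ KZ.relations := by
  rintro b (⟨r, rfl⟩ | ⟨n, P, r, hd, hi, rfl⟩)
  · rcases dimZero_cases r with h | h
    · exact Or.inl h
    · exact Or.inr ⟨r, h, by rw [sub_self]; exact KZ.relations.zero_mem⟩
  · exact Or.inr (cubePoly_toPoint_of hT hS hI n P r hd hi)

/-- Low-dimensional and cylinder generators are low-dimensional generators modulo relations.
[cite: KontsevichZagier2001, §1.2] -/
theorem lowCyl_toLow_of (hT : CylinderTame) (hS : CylinderTame → CylinderStokes) (hB : CylinderBase) :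
    ∀ g ∈ lowDimAlgGens ∪ cylinderGens, ∃ g' ∈ lowDimAlgGens, g - g' ∈ KZ.relations := by
  rintro g (hg | ⟨n, P, q, r, hq, hd, hi, rfl⟩)
  · exact ⟨g, hg, by rw [sub_self]; exact KZ.relations.zero_mem⟩
  · obtain ⟨ρ, p, q', hp, hq', hq0, hread, hrel⟩ := cylinder_toDimOne_of hT hS hB n P q r hq hd hi
    exact ⟨KZ.of ρ, Or.inr ⟨ρ, p, q', hp, hq', hq0, hread, rfl⟩, hrel⟩

/-- Multiplying a low-dimensional generator by a point `[pt, a]` gives a low-dimensional generator modulo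
relations (`PointMul`; the scaled integrand `a·p/q` has real-algebraic coefficients because `a` is algebraic).
[cite: KontsevichZagier2001, §4.1] -/
theorem pointMul_low_of (hM : PointMul) (r₀ : KZ.IntegralRep 0) (h0 : r₀.domain = Set.univ) :
    ∀ g ∈ lowDimAlgGens, ∃ g' ∈ lowDimAlgGens, KZ.of r₀ * g - g' ∈ KZ.relations := by
  rintro g (⟨s, rfl⟩ | ⟨s, p, q, hp, hq, hq0, hread, rfl⟩)
  · obtain ⟨s', _, _, hrel⟩ := hM 0 r₀ s h0
    exact ⟨KZ.of s', Or.inl ⟨s', rfl⟩, hrel⟩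
  · obtain ⟨s', hd', hi', hrel⟩ := hM 1 r₀ s h0
    have ha : IsAlgebraic ℚ (r₀.integrand default) :=
      DimOne.dzl_isAlgebraic_integrand r₀ (by rw [h0]; exact Set.mem_univ _)
    refine ⟨KZ.of s', Or.inr ⟨s', Polynomial.C (r₀.integrand default) * p, q, fun i => ?_, hq,
      fun x hx => ?_, fun x hx => ?_, rfl⟩, hrel⟩
    · rw [Polynomial.coeff_C_mul]; exact ha.mul (hp i)
    · rw [hd'] at hx; exact hq0 x hx
    · rw [hd'] at hx
      rw [hi' hx]
      show r₀.integrand default * s.integrand x = _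
      rw [hread hx]
      simp only [Polynomial.eval_mul, Polynomial.eval_C, mul_div_assoc]

/-- **Every Fubini generator is, modulo relations, in the low-dimensional sector's subgroup** (product cases through
the ideal property `KZ.mul_sub_mul_mem_relations`, the right-ideal property … [cite: KontsevichZagier2001, §4.1] -/
theorem fubiniGens_reduce_of (hT : CylinderTame) (hS : CylinderTame → CylinderStokes) (hB : CylinderBase)
    (hI : CylinderTame → IntervalPolyPoint) (hM : PointMul) :
    ∀ d ∈ fubiniGens, ∃ ℓ ∈ AddSubgroup.closure lowDimAlgGens, d - ℓ ∈ KZ.relations := by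
  rintro d ((hd | hd) | ⟨b, hb, g, hg, hdg⟩)
  · exact ⟨d, AddSubgroup.subset_closure hd, by rw [sub_self]; exact KZ.relations.zero_mem⟩
  · obtain ⟨g', hg', hrel⟩ := lowCyl_toLow_of hT hS hB d (Or.inr hd)
    exact ⟨g', AddSubgroup.subset_closure hg', hrel⟩
  · have key : ∃ ℓ ∈ AddSubgroup.closure lowDimAlgGens, b * g - ℓ ∈ KZ.relations := by
      obtain ⟨g', hg', hgg'⟩ := lowCyl_toLow_of hT hS hB g hg
      rcases weightZero_toPoint_of hT hS hI b hb with hbrel | ⟨r₀, h0, hb0⟩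
      · exact ⟨0, zero_mem _, by rw [sub_zero]; exact KZ.mul_mem_relations_right_holds _ _ hbrel⟩
      · obtain ⟨ℓ, hℓ, hrel⟩ := pointMul_low_of hM r₀ h0 g' hg'
        refine ⟨ℓ, AddSubgroup.subset_closure hℓ, ?_⟩
        have h1 : b * g - KZ.of r₀ * g' ∈ KZ.relations := KZ.mul_sub_mul_mem_relations hb0 hgg'
        have : b * g - ℓ = (b * g - KZ.of r₀ * g') + (KZ.of r₀ * g' - ℓ) := by abel
        rw [this]
        exact KZ.relations.add_mem h1 hrel
    obtain ⟨ℓ, hℓ, hrel⟩ := key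
    rcases hdg with rfl | rfl
    · exact ⟨ℓ, hℓ, hrel⟩
    · refine ⟨ℓ, hℓ, ?_⟩
      have : g * b - ℓ = (g * b - b * g) + (b * g - ℓ) := by abel
      rw [this]
      exact KZ.relations.add_mem (KZ.mul_sub_mul_comm_mem_relations g b) hrel

/-- **The Fubini sector from the reduction and the low-dimensional kernel**: flatten a `ℤ`-combination of Fubini
generators, replace every generator by its low-dimensional representative, … [cite: KontsevichZagier2001, §1.2] -/
theorem fubiniLowDimKernel_of
    (hred : ∀ d ∈ fubiniGens, ∃ ℓ ∈ AddSubgroup.closure lowDimAlgGens, d - ℓ ∈ KZ.relations)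
    (hlow : ∀ c ∈ AddSubgroup.closure lowDimAlgGens, KZ.eval c = 0 → c ∈ KZ.relations) :
    FubiniLowDimKernel := by
  intro c hc hev
  classical
  rw [← Submodule.span_int_eq_addSubgroupClosure, Submodule.mem_toAddSubgroup,
    Submodule.mem_span_set'] at hc
  obtain ⟨k, f, g, rfl⟩ := hc
  choose ℓ hℓ hrel using fun i => hred (g i) (g i).2
  have hdiff : ∑ i, f i • ((g i : KZ.FormalRep)) - ∑ i, f i • ℓ i ∈ KZ.relations := by
    rw [← Finset.sum_sub_distrib]
    refine sum_mem fun i _ => ?_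
    rw [← smul_sub]
    exact KZ.relations.zsmul_mem (hrel i) _
  have hmem : ∑ i, f i • ℓ i ∈ AddSubgroup.closure lowDimAlgGens :=
    sum_mem fun i _ => AddSubgroup.zsmul_mem _ (hℓ i) _
  have hev' : KZ.eval (∑ i, f i • ℓ i) = 0 := by
    have h0 := KZ.relations_le_ker_eval_holds hdiff
    rw [AddMonoidHom.mem_ker, map_sub, hev, zero_sub, neg_eq_zero] at h0
    exact h0
  have hker := hlow _ hmem hev'
  have h := KZ.relations.add_mem hdiff hker
  rwa [sub_add_cancel] at h

/-- **THE FUBINI SECTOR** (modulo stubs 23–27 and the landed dimension-≤-1 algebraic sector): every vanishing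
`ℤ`-combination of low-dimensional generators, cylinder representations of all … [cite: KontsevichZagier2001, §1.2] -/
theorem fubiniLowDimKernel : FubiniLowDimKernel :=
  fubiniLowDimKernel_of
    (fubiniGens_reduce_of stub_cylinderTame stub_cylinderStokes stub_cylinderBase stub_intervalPolyPoint
      stub_pointMul)
    lowDimAlgKernel

/-- **The crux on the Fubini sector**: every such vanishing combination lies in `KZ.relations ⊔ closure T`.
[cite: KontsevichZagier2001, §1.2] -/
theorem TateLifting_fubiniSector :
    ∀ c ∈ AddSubgroup.closure fubiniGens, KZ.eval c = 0 →
      c ∈ KZ.relations ⊔ AddSubgroup.closure tateFibres :=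
  fun c hc hev => AddSubgroup.mem_sup_left (fubiniLowDimKernel c hc hev)

/-! ### Two-representation corollaries -/

/-- From a kernel statement on `closure S` to pairs of generators with the same value. [folklore] -/
theorem equivalent_of_kernel {S : Set KZ.FormalRep}
    (hK : ∀ c ∈ AddSubgroup.closure S, KZ.eval c = 0 → c ∈ KZ.relations)
    {n m : ℕ} {r : KZ.IntegralRep n} {r' : KZ.IntegralRep m} (hr : KZ.of r ∈ S) (hr' : KZ.of r' ∈ S)
    (hv : r.value = r'.value) : KZ.Equivalent r r' :=
  hK _ (sub_mem (AddSubgroup.subset_closure hr) (AddSubgroup.subset_closure hr'))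
    (by rw [map_sub, KZ.eval_of, KZ.eval_of, hv, sub_self])

/-- Polynomial cubes of every dimension are Fubini generators (`n = 0`: a representation over `ℝ⁰`;
`n ≥ 1`: a cylinder generator with `q = 1`). [folklore] -/
theorem of_mem_fubiniGens_of_cubePoly {n : ℕ} (r : KZ.IntegralRep n)
    (P : MvPolynomial (Fin n) (algebraicClosure ℚ ℝ))
    (hd : r.domain = Set.pi Set.univ (fun _ => Set.Ioo (0 : ℝ) 1))
    (hi : Set.EqOn r.integrand (fun z => MvPolynomial.aeval z P) r.domain) : KZ.of r ∈ fubiniGens := by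
  cases n with
  | zero => exact Or.inl (Or.inl (Or.inl ⟨r, rfl⟩))
  | succ k =>
    refine Or.inl (Or.inr ⟨k, P, 1, r, fun t _ => by rw [map_one]; exact one_ne_zero, hd,
      fun z hz => ?_, rfl⟩)
    rw [hi hz]
    simp only [map_one, div_one]

/-- Cylinder representations are Fubini generators. [folklore] -/
theorem of_mem_fubiniGens_of_cylinder {n : ℕ} (r : KZ.IntegralRep (n + 1))
    (P : MvPolynomial (Fin (n + 1)) (algebraicClosure ℚ ℝ)) (q : Polynomial (algebraicClosure ℚ ℝ))
    (hq : ∀ t ∈ Set.Icc (0 : ℝ) 1, Polynomial.aeval t q ≠ 0)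
    (hd : r.domain = Set.pi Set.univ (fun _ => Set.Ioo (0 : ℝ) 1))
    (hi : Set.EqOn r.integrand (fun z => MvPolynomial.aeval z P / Polynomial.aeval (z 0) q) r.domain) :
    KZ.of r ∈ fubiniGens :=
  Or.inl (Or.inr ⟨n, P, q, r, hq, hd, hi, rfl⟩)

/-- **KZ's Conjecture 1 for polynomial cubes of ANY dimensions** (modulo the stubs): two honest representations
`[(0,1)ⁿ, P]`, `[(0,1)ᵐ, P′]` with `P ∈ K[z₁..z_n]`, `P′ ∈ K[z₁..z_m]` (`K` = … [cite: KontsevichZagier2001, §1.2] -/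
theorem kzPeriodConjecture_cubePoly_of (hK : FubiniLowDimKernel) :
    ∀ (n m : ℕ) (r : KZ.IntegralRep n) (r' : KZ.IntegralRep m)
      (P : MvPolynomial (Fin n) (algebraicClosure ℚ ℝ)) (P' : MvPolynomial (Fin m) (algebraicClosure ℚ ℝ)),
      r.domain = Set.pi Set.univ (fun _ => Set.Ioo (0 : ℝ) 1) →
      Set.EqOn r.integrand (fun z => MvPolynomial.aeval z P) r.domain →
      r'.domain = Set.pi Set.univ (fun _ => Set.Ioo (0 : ℝ) 1) →
      Set.EqOn r'.integrand (fun z => MvPolynomial.aeval z P') r'.domain →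
      r.value = r'.value → KZ.Equivalent r r' :=
  fun _ _ r r' P P' hd hi hd' hi' hv =>
    equivalent_of_kernel hK (of_mem_fubiniGens_of_cubePoly r P hd hi)
      (of_mem_fubiniGens_of_cubePoly r' P' hd' hi') hv

/-- **KZ's Conjecture 1 for cylinder representations of ANY dimensions** (modulo the stubs): two honest
representations `[(0,1)ⁿ⁺¹, P(z)/q(z₀)]`, `[(0,1)ᵐ⁺¹, P′(z)/q′(z₀)]` over `K` with the same value are
KZ-equivalent. [cite: KontsevichZagier2001, §1.2] -/
theorem kzPeriodConjecture_cylinder_of (hK : FubiniLowDimKernel) :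
    ∀ (n m : ℕ) (r : KZ.IntegralRep (n + 1)) (r' : KZ.IntegralRep (m + 1))
      (P : MvPolynomial (Fin (n + 1)) (algebraicClosure ℚ ℝ)) (q : Polynomial (algebraicClosure ℚ ℝ))
      (P' : MvPolynomial (Fin (m + 1)) (algebraicClosure ℚ ℝ)) (q' : Polynomial (algebraicClosure ℚ ℝ)),
      (∀ t ∈ Set.Icc (0 : ℝ) 1, Polynomial.aeval t q ≠ 0) →
      r.domain = Set.pi Set.univ (fun _ => Set.Ioo (0 : ℝ) 1) →
      Set.EqOn r.integrand (fun z => MvPolynomial.aeval z P / Polynomial.aeval (z 0) q) r.domain →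
      (∀ t ∈ Set.Icc (0 : ℝ) 1, Polynomial.aeval t q' ≠ 0) →
      r'.domain = Set.pi Set.univ (fun _ => Set.Ioo (0 : ℝ) 1) →
      Set.EqOn r'.integrand (fun z => MvPolynomial.aeval z P' / Polynomial.aeval (z 0) q') r'.domain →
      r.value = r'.value → KZ.Equivalent r r' :=
  fun _ _ r r' P q P' q' hq hd hi hq' hd' hi' hv =>
    equivalent_of_kernel hK (of_mem_fubiniGens_of_cylinder r P q hq hd hi)
      (of_mem_fubiniGens_of_cylinder r' P' q' hq' hd' hi') hv

/-- **KZ's Conjecture 1 for Fubini products** (modulo the stubs): products `[(0,1)ⁿ, P] × [σ, p/q]` of a polynomial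
cube of any dimension with a dimension-one representation with algebraic-coefficient integrand, equal values ⇒
KZ-equivalent. [cite: KontsevichZagier2001, §4.1] -/
theorem kzPeriodConjecture_cubePoly_prod_dimOneAlg_of (hK : FubiniLowDimKernel) :
    ∀ (n m : ℕ) (b : KZ.IntegralRep n) (b' : KZ.IntegralRep m)
      (P : MvPolynomial (Fin n) (algebraicClosure ℚ ℝ)) (P' : MvPolynomial (Fin m) (algebraicClosure ℚ ℝ))
      (s s' : KZ.IntegralRep 1) (p q p' q' : Polynomial ℝ),
      b.domain = Set.pi Set.univ (fun _ => Set.Ioo (0 : ℝ) 1) →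
      Set.EqOn b.integrand (fun z => MvPolynomial.aeval z P) b.domain →
      b'.domain = Set.pi Set.univ (fun _ => Set.Ioo (0 : ℝ) 1) →
      Set.EqOn b'.integrand (fun z => MvPolynomial.aeval z P') b'.domain →
      (∀ i, IsAlgebraic ℚ (p.coeff i)) → (∀ i, IsAlgebraic ℚ (q.coeff i)) →
      (∀ x ∈ s.domain, q.eval (x 0) ≠ 0) →
      Set.EqOn s.integrand (fun x => p.eval (x 0) / q.eval (x 0)) s.domain →
      (∀ i, IsAlgebraic ℚ (p'.coeff i)) → (∀ i, IsAlgebraic ℚ (q'.coeff i)) →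
      (∀ x ∈ s'.domain, q'.eval (x 0) ≠ 0) →
      Set.EqOn s'.integrand (fun x => p'.eval (x 0) / q'.eval (x 0)) s'.domain →
      (b.prod s).value = (b'.prod s').value → KZ.Equivalent (b.prod s) (b'.prod s') := by
  intro n m b b' P P' s s' p q p' q' hbd hbi hbd' hbi' hp hq hq0 hs hp' hq' hq0' hs' hv
  have hb : KZ.of b ∈ weightZeroGens := Or.inr ⟨n, P, b, hbd, hbi, rfl⟩
  have hb' : KZ.of b' ∈ weightZeroGens := Or.inr ⟨m, P', b', hbd', hbi', rfl⟩
  have hs1 : KZ.of s ∈ lowDimAlgGens ∪ cylinderGens := Or.inl (Or.inr ⟨s, p, q, hp, hq, hq0, hs, rfl⟩)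
  have hs1' : KZ.of s' ∈ lowDimAlgGens ∪ cylinderGens :=
    Or.inl (Or.inr ⟨s', p', q', hp', hq', hq0', hs', rfl⟩)
  have h1 : KZ.of (b.prod s) ∈ fubiniGens := by
    rw [← KZ.of_mul_of]
    exact Or.inr ⟨_, hb, _, hs1, Or.inl rfl⟩
  have h2 : KZ.of (b'.prod s') ∈ fubiniGens := by
    rw [← KZ.of_mul_of]
    exact Or.inr ⟨_, hb', _, hs1', Or.inl rfl⟩
  exact equivalent_of_kernel hK h1 h2 hv

/-- **KZ's Conjecture 1 for polynomial cubes of any dimensions** (modulo stubs 23–27). [cite: KontsevichZagier2001, §1.2] -/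
theorem kzPeriodConjecture_cubePoly :
    ∀ (n m : ℕ) (r : KZ.IntegralRep n) (r' : KZ.IntegralRep m)
      (P : MvPolynomial (Fin n) (algebraicClosure ℚ ℝ)) (P' : MvPolynomial (Fin m) (algebraicClosure ℚ ℝ)),
      r.domain = Set.pi Set.univ (fun _ => Set.Ioo (0 : ℝ) 1) →
      Set.EqOn r.integrand (fun z => MvPolynomial.aeval z P) r.domain →
      r'.domain = Set.pi Set.univ (fun _ => Set.Ioo (0 : ℝ) 1) →
      Set.EqOn r'.integrand (fun z => MvPolynomial.aeval z P') r'.domain →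
      r.value = r'.value → KZ.Equivalent r r' :=
  kzPeriodConjecture_cubePoly_of fubiniLowDimKernel

/-! ### Fibres of rational families with one-variable denominators (a sector of the crux `TateFamilyKernel`;
compositions REMOVED from the skeleton 2026-08-17 by lead c9 to fit the 200 kB cap — LANDED verbatim as
`exists_specLast`, `exists_specParam`, `cylinder_mem_relations_of_value_eq_zero`, `tateFamilyKernel_cylinder`,
`tateFamilyKernel_of_cylinderDenominator` in `Theorems/InverseLandauTateLiftingFubiniSector.lean`, p124745). -/

/-! ### Forms of the crux (stub 28) -/

/-- **Within the route the crux is the summit modulo the other crux**: `KZKernelConjecture ↔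
TateFamilyKernel ∧ TateLifting` (stub 28 (i)). [cite: KontsevichZagier2001, §1.2] -/
theorem kzKernelConjecture_iff_cruxes : KZKernelConjecture ↔ (TateFamilyKernel ∧ TateLifting) :=
  stub_forms.1

/-- **Pair normal form of the crux**: `TateLifting` holds iff any two representations with the same value differ by
an element of `relations ⊔ closure T` (stub 28 (ii)). [cite: KontsevichZagier2001, §1.2] -/
theorem tateLifting_iff_pairLifting :
    TateLifting ↔ ∀ (n m : ℕ) (r : KZ.IntegralRep n) (r' : KZ.IntegralRep m), r.value = r'.value →
      KZ.of r - KZ.of r' ∈ KZ.relations ⊔ AddSubgroup.closure tateFibres :=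
  stub_forms.2.1

/-! ## The transcendence sector over `ℚ̄` (continuation lead c5): statements

In the formal period ring `P = KZ.FormalPeriodRing = FormalRep ⧸ relations` (a `CommRing`, with
`KZ.toFormalPeriod : FormalRep →ₙ+* P` and the evaluation `KZ.evalP : P →+* ℝ`, `KZRulesAssociator.lean`)
the kernel form of Conjecture 1 ON A SECTOR is injectivity of `evalP` on a subring. The dimension-0 sector
of lead c3 says exactly that `evalP` … (abridged 2026-08-17 to fit the 200 kB crux-workfile cap; full text in `Lines/Sketch.md`) -/

/-- THE RING OF DIMENSION-ZERO CLASSES: the subring of the formal period ring generated by the classes of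
representations over `ℝ⁰` consists of such classes (sums / products / negatives of … [cite: KontsevichZagier2001, §1.2] -/
def DimZeroRing : Prop :=
  ∀ x ∈ Subring.closure (Set.range fun b : KZ.IntegralRep 0 => KZ.toFormalPeriod (KZ.of b)),
    (∃ b : KZ.IntegralRep 0, b.domain = Set.univ ∧ x = KZ.toFormalPeriod (KZ.of b)) ∧
      IsAlgebraic ℚ (KZ.evalP x) ∧ (KZ.evalP x = 0 → x = 0)

/-- ALGEBRAIC-INDEPENDENCE SATURATION (pure algebra in the formal period ring): if `evalP` is injective on a
subring `R₀` whose values are algebraic over `ℚ`, and the values `evalP (x i)` of a … [folklore] -/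
def AlgIndepSaturation : Prop :=
  ∀ (ι : Type) (x : ι → KZ.FormalPeriodRing) (R₀ : Subring KZ.FormalPeriodRing),
    (∀ a ∈ R₀, IsAlgebraic ℚ (KZ.evalP a)) → (∀ a ∈ R₀, KZ.evalP a = 0 → a = 0) →
    AlgebraicIndependent ℚ (fun i => KZ.evalP (x i)) →
    ∀ y ∈ Subring.closure ((R₀ : Set KZ.FormalPeriodRing) ∪ Set.range x), KZ.evalP y = 0 → y = 0

/-- PRODUCT SPLITTING: a representation whose domain is the product domain `σ × τ` of two representations and
whose integrand agrees there with `f ⊗ g` differs by relations from their Fubini … [cite: KontsevichZagier2001, §4.1] -/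
def ProdSplit : Prop :=
  ∀ (n m : ℕ) (r : KZ.IntegralRep (n + m)) (s : KZ.IntegralRep n) (t : KZ.IntegralRep m),
    r.domain = {z | (fun i => z (Fin.castAdd m i)) ∈ s.domain ∧ (fun j => z (Fin.natAdd n j)) ∈ t.domain} →
    Set.EqOn r.integrand
      (fun z => s.integrand (fun i => z (Fin.castAdd m i)) * t.integrand (fun j => z (Fin.natAdd n j)))
      r.domain →
    KZ.of r - KZ.of s * KZ.of t ∈ KZ.relations

/-- QUARTER-CIRCLE NORMALISATION: the honest representation `[(0,1), 4/(1+x²)]` of `π` is KZ-equivalent to the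
disc `KZ.piRep` (fold `[ℝ, 1/(1+x²)]` — equivalent to the disc by the landed … [cite: KontsevichZagier2001, §1.1 eq. (1)] -/
def QuarterPi : Prop :=
  ∀ r : KZ.IntegralRep 1, r.domain = Set.pi Set.univ (fun _ => Set.Ioo (0 : ℝ) 1) →
    Set.EqOn r.integrand (fun x => 4 / (1 + x 0 ^ 2)) r.domain → KZ.Equivalent r KZ.piRep

/-- SQUARE SUBSTITUTION (rule 2 with `Φ(t) = t²` on `t > 0`): a representation of dimension one whose domain
lies in `(0, ∞)` differs by relations from the representation `[{t > 0, t² ∈ σ},` … [cite: KontsevichZagier2001, §1.2  rule (2)] -/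
def SqrtSubst : Prop :=
  ∀ r : KZ.IntegralRep 1, (∀ x ∈ r.domain, 0 < x 0) →
    ∃ r' : KZ.IntegralRep 1, r'.domain = {t | 0 < t 0 ∧ (fun _ : Fin 1 => t 0 ^ 2) ∈ r.domain} ∧
      Set.EqOn r'.integrand (fun t => 2 * t 0 * r.integrand (fun _ => t 0 ^ 2)) r'.domain ∧
      KZ.of r - KZ.of r' ∈ KZ.relations

/-! ## The transcendence sector: stubs 29–33 (ALL CLOSED, wave c6-1) -/

/-- stub 29 — the ring of dimension-zero classes (size M). CLOSED: p127397
`Theorems/InverseLandauTateLiftingDimZeroRing.lean` (wave c6-1). [cite: KontsevichZagier2001, §1.2] -/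
theorem stub_dimZeroRing : DimZeroRing :=
  tateLifting_dimZeroRing

/-- stub 30 — algebraic-independence saturation (size M; held by the lead). CLOSED: p127300
`Theorems/InverseLandauTateLiftingAlgIndepSaturation.lean` (lead c6). [folklore] -/
theorem stub_algIndepSaturation : AlgIndepSaturation :=
  tateLifting_algIndepSaturation

/-- stub 31 — product splitting (size S). CLOSED: p127293
`Theorems/InverseLandauTateLiftingProdSplit.lean` (wave c6-1). [cite: KontsevichZagier2001, §4.1] -/
theorem stub_prodSplit : ProdSplit :=
  tateLifting_prodSplit

/-- stub 32 — quarter-circle normalisation (size M). CLOSED: p127307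
`Theorems/InverseLandauTateLiftingQuarterPi.lean` (wave c6-1). [cite: KontsevichZagier2001, §1.1 eq. (1)] -/
theorem stub_quarterPi : QuarterPi :=
  tateLifting_quarterPi

/-- stub 33 — square substitution (size M). CLOSED: p127400
`Theorems/InverseLandauTateLiftingSqrtSubst.lean` (wave c6-1). [cite: KontsevichZagier2001, §1.2  rule (2)] -/
theorem stub_sqrtSubst : SqrtSubst :=
  tateLifting_sqrtSubst

/-! ## The transcendence sector: composition -/

/-- **TRANSFER OF ALGEBRAIC INDEPENDENCE TO THE KERNEL CONJECTURE.** For every family `x` of formal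
combinations whose values are algebraically independent over `ℚ`, every formal combination … [cite: KontsevichZagier2001, §1.2] -/
theorem transcKernel_of (hZ : DimZeroRing) (hS : AlgIndepSaturation) {ι : Type} (x : ι → KZ.FormalRep)
    (hx : AlgebraicIndependent ℚ fun i => KZ.eval (x i)) :
    ∀ c : KZ.FormalRep, KZ.toFormalPeriod c ∈ Subring.closure
        (Set.range (fun b : KZ.IntegralRep 0 => KZ.toFormalPeriod (KZ.of b)) ∪
          Set.range (fun i => KZ.toFormalPeriod (x i))) →
      KZ.eval c = 0 → c ∈ KZ.relations := by
  intro c hc h0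
  set R₀ : Subring KZ.FormalPeriodRing :=
    Subring.closure (Set.range fun b : KZ.IntegralRep 0 => KZ.toFormalPeriod (KZ.of b)) with hR₀
  have halg : ∀ a ∈ R₀, IsAlgebraic ℚ (KZ.evalP a) := fun a ha => (hZ a ha).2.1
  have hinj : ∀ a ∈ R₀, KZ.evalP a = 0 → a = 0 := fun a ha => (hZ a ha).2.2
  have hx' : AlgebraicIndependent ℚ fun i => KZ.evalP (KZ.toFormalPeriod (x i)) := by
    simpa only [KZ.evalP_toFormalPeriod] using hx
  have hmem : KZ.toFormalPeriod c ∈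
      Subring.closure ((R₀ : Set KZ.FormalPeriodRing) ∪ Set.range fun i => KZ.toFormalPeriod (x i)) := by
    refine Subring.closure_mono ?_ hc
    exact Set.union_subset_union_left _ Subring.subset_closure
  have h := hS ι (fun i => KZ.toFormalPeriod (x i)) R₀ halg hinj hx' _ hmem
    (by rw [KZ.evalP_toFormalPeriod, h0])
  exact KZ.toFormalPeriod_eq_zero_iff.1 h

/-- **The crux on the transcendence sector**: with `T` the Tate set, every such `c` lies in
`KZ.relations ⊔ closure T`. [cite: KontsevichZagier2001, §1.2] -/
theorem TateLifting_transcSector_of (hZ : DimZeroRing) (hS : AlgIndepSaturation) {ι : Type}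
    (x : ι → KZ.FormalRep) (hx : AlgebraicIndependent ℚ fun i => KZ.eval (x i)) :
    ∀ c : KZ.FormalRep, KZ.toFormalPeriod c ∈ Subring.closure
        (Set.range (fun b : KZ.IntegralRep 0 => KZ.toFormalPeriod (KZ.of b)) ∪
          Set.range (fun i => KZ.toFormalPeriod (x i))) →
      KZ.eval c = 0 → c ∈ KZ.relations ⊔ AddSubgroup.closure tateFibres :=
  fun c hc h0 => AddSubgroup.mem_sup_left (transcKernel_of hZ hS x hx c hc h0)


/-- **THE `ℚ̄[π]` SECTOR (Lindemann read in the formal period ring, with algebraic coefficients).** Every formal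
combination whose class lies in the subring generated by all dimension-zero … [cite: KontsevichZagier2001, §1.2] -/
theorem piSectorKernel_of (hZ : DimZeroRing) (hS : AlgIndepSaturation) :
    ∀ c : KZ.FormalRep, KZ.toFormalPeriod c ∈ Subring.closure
        (Set.range (fun b : KZ.IntegralRep 0 => KZ.toFormalPeriod (KZ.of b)) ∪
          {KZ.toFormalPeriod (KZ.of KZ.piRep)}) →
      KZ.eval c = 0 → c ∈ KZ.relations := by
  intro c hc h0
  have hx : AlgebraicIndependent ℚ fun i : Fin 1 => KZ.eval ((![KZ.of KZ.piRep] : Fin 1 → KZ.FormalRep) i) := by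
    have : (fun i : Fin 1 => KZ.eval ((![KZ.of KZ.piRep] : Fin 1 → KZ.FormalRep) i)) = ![Real.pi] := by
      ext i; fin_cases i; simp [KZ.piRep_value]
    rw [this]
    exact algebraicIndependent_iff_transcendental.2 transcendental_pi_holds
  refine transcKernel_of hZ hS (![KZ.of KZ.piRep]) hx c ?_ h0
  refine Subring.closure_mono (Set.union_subset_union_right _ ?_) hc
  rintro _ rfl
  exact ⟨0, by simp⟩

/-! ## Waves c6-2 / c6-3 (lead c6): further transcendence inputs and the square-root extension — stubs 34–37 (ALL CLOSED)

Registered by `stub-add` under their landed names (not as `stub_*` of `TateLifting_of`, whose composition they do not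
enter): two more algebraic-independence inputs for `transcKernel_of` and the reduction that adjoins the first
algebraic integrands of genus zero to the dimension-≤-1 algebraic sector. Assemblies:
`Theorems/InverseLandauTateLiftingTranscSector.lean` (p127786), `…TranscSectorEntries.lean` (p128181),
`…SqrtSector.lean` (p128154), `…TranscSectorLog.lean` (p128387), `…SqrtAffineSector.lean`; helper `…Pullback.lean`. -/

/-- EQUIANHARMONIC INPUT: `B(1/3,1/3) = √3·Γ(1/3)³/(2π)` and `π` are algebraically independent over `ℚ`
(Chudnovsky's pair `(π, Γ(1/3))`). [cite: Chudnovsky1984, Ch. 7 §2 Corollary 2.3] -/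
def BetaThirdPi : Prop :=
  AlgebraicIndependent ℚ ![ProbabilityTheory.beta ((1 / 3 : ℚ) : ℝ) ((1 / 3 : ℚ) : ℝ), Real.pi]

/-- LEMNISCATIC INPUT: `B(1/4,1/4) = Γ(1/4)²/√π` and `π` are algebraically independent over `ℚ`
(Chudnovsky's pair `(π, Γ(1/4))`). [cite: Chudnovsky1984, Ch. 7 §2 Corollary 2.3] -/
def BetaQuarterPi : Prop :=
  AlgebraicIndependent ℚ ![ProbabilityTheory.beta ((1 / 4 : ℚ) : ℝ) ((1 / 4 : ℚ) : ℝ), Real.pi]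

/-- SQUARE-ROOT REDUCTION: `[σ ⊆ (0,∞), P(x,√x)/Q(x,√x)]` (`P, Q ∈ K[X,Y]`, `K = algebraicClosure ℚ ℝ`) differs by
relations from a dimension-one representation with algebraic-coefficient … [cite: KontsevichZagier2001, §1.2 rule (2)] -/
def SqrtReduce : Prop :=
  ∀ (P Q : MvPolynomial (Fin 2) (algebraicClosure ℚ ℝ)) (r : KZ.IntegralRep 1),
    (∀ x ∈ r.domain, 0 < x 0) →
    (∀ x ∈ r.domain, MvPolynomial.aeval ![x 0, Real.sqrt (x 0)] Q ≠ 0) →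
    Set.EqOn r.integrand (fun x => MvPolynomial.aeval ![x 0, Real.sqrt (x 0)] P /
      MvPolynomial.aeval ![x 0, Real.sqrt (x 0)] Q) r.domain →
    ∃ (ρ : KZ.IntegralRep 1) (p q : Polynomial ℝ), (∀ i, IsAlgebraic ℚ (p.coeff i)) ∧
      (∀ i, IsAlgebraic ℚ (q.coeff i)) ∧ (∀ x ∈ ρ.domain, q.eval (x 0) ≠ 0) ∧
      Set.EqOn ρ.integrand (fun x => p.eval (x 0) / q.eval (x 0)) ρ.domain ∧
      KZ.of r - KZ.of ρ ∈ KZ.relations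

/-- stub 34 — CLOSED: p127681 `Theorems/InverseLandauTateLiftingBetaThirdPi.lean` (wave c6-2).
[cite: Chudnovsky1984, Ch. 7 §2 Corollary 2.3] -/
theorem stub_betaThirdPi : BetaThirdPi :=
  tateLifting_betaThirdPiAlgIndependent

/-- stub 36 — CLOSED: p127783 `Theorems/InverseLandauTateLiftingBetaQuarterPi.lean` (wave c6-2).
[cite: Chudnovsky1984, Ch. 7 §2 Corollary 2.3] -/
theorem stub_betaQuarterPi : BetaQuarterPi :=
  tateLifting_betaQuarterPiAlgIndependent

/-- stub 35 — CLOSED: p127934 `Theorems/InverseLandauTateLiftingSqrtReduce.lean` (wave c6-2).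
[cite: KontsevichZagier2001, §1.2 rule (2)] -/
theorem stub_sqrtReduce : SqrtReduce :=
  tateLifting_sqrtReduce

/-- AFFINE SQUARE-ROOT REDUCTION: `[σ, P(x,√(ax+b))/Q(x,√(ax+b))]` (`a > 0`, `a, b ∈ K`) differs by relations from a
dimension-one representation with algebraic-coefficient rational integrand (affine move `u = ax + b`, then stub 35).
[cite: KontsevichZagier2001, §1.2 rule (2)] -/
def SqrtAffineReduce : Prop :=
  ∀ (a b : algebraicClosure ℚ ℝ) (P Q : MvPolynomial (Fin 2) (algebraicClosure ℚ ℝ)) (r : KZ.IntegralRep 1),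
    0 < (a : ℝ) → (∀ x ∈ r.domain, 0 < (a : ℝ) * x 0 + b) →
    (∀ x ∈ r.domain, MvPolynomial.aeval ![x 0, Real.sqrt ((a : ℝ) * x 0 + b)] Q ≠ 0) →
    Set.EqOn r.integrand (fun x => MvPolynomial.aeval ![x 0, Real.sqrt ((a : ℝ) * x 0 + b)] P /
      MvPolynomial.aeval ![x 0, Real.sqrt ((a : ℝ) * x 0 + b)] Q) r.domain →
    ∃ (ρ : KZ.IntegralRep 1) (p q : Polynomial ℝ), (∀ i, IsAlgebraic ℚ (p.coeff i)) ∧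
      (∀ i, IsAlgebraic ℚ (q.coeff i)) ∧ (∀ x ∈ ρ.domain, q.eval (x 0) ≠ 0) ∧
      Set.EqOn ρ.integrand (fun x => p.eval (x 0) / q.eval (x 0)) ρ.domain ∧
      KZ.of r - KZ.of ρ ∈ KZ.relations

/-- stub 37 — CLOSED: p128439 `Theorems/InverseLandauTateLiftingSqrtAffineReduce.lean` (wave c6-3).
[cite: KontsevichZagier2001, §1.2 rule (2)] -/
theorem stub_sqrtAffineReduce : SqrtAffineReduce :=
  tateLifting_sqrtAffineReduce

section GenusZero

open Literature.ModelTheory.ExponentialFields (IsSemialgebraic)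

/-! ## The genus-zero sector (continuation lead c7): statements

THE RATIONAL-CHART PRINCIPLE. A dimension-one representation `r = [σ, f]` is reduced to the landed
dimension-≤-1 algebraic sector (`kzKernelConjecture_lowDimAlg`, Baker inside the calculus) by ONE change of
variables (Kontsevich–Zagier's rule (2)) as soon as there is a new variable `t = ψ(x)`, `ℚ`-semialgebraic on
`σ`, an INVERSE CHART `x = X(t)` which is … (abridged 2026-08-17 to fit the 200 kB crux-workfile cap; full text in `Lines/Sketch.md`) -/

/-- RATIONAL CHART (stub 38, the master pull-back lemma of the genus-zero sector). Let `r = [σ, f]` be a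
dimension-one representation, `ψ` a new variable which is a `ℚ`-semialgebraic function … [cite: KontsevichZagier2001, §1.2 rule (2)] -/
def RatChart : Prop :=
  ∀ (r : KZ.IntegralRep 1) (ψ : ℝ → ℝ) (pX qX pG qG : Polynomial (algebraicClosure ℚ ℝ)),
    IsSemialgebraicFunOn ℚ r.domain (fun x => ψ (x 0)) →
    (∀ x ∈ r.domain, (Polynomial.aeval (ψ (x 0)) qX : ℝ) ≠ 0) →
    (∀ x ∈ r.domain, (Polynomial.aeval (ψ (x 0)) pX : ℝ) / Polynomial.aeval (ψ (x 0)) qX = x 0) →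
    (∀ x ∈ r.domain, (Polynomial.aeval (ψ (x 0)) qG : ℝ) ≠ 0) →
    (∀ x ∈ r.domain, r.integrand x =
      (Polynomial.aeval (ψ (x 0)) pG : ℝ) / Polynomial.aeval (ψ (x 0)) qG) →
    ∃ ℓ ∈ AddSubgroup.closure
        {d : KZ.FormalRep | (∃ r : KZ.IntegralRep 0, d = KZ.of r) ∨
          ∃ (r : KZ.IntegralRep 1) (p q : Polynomial ℝ), (∀ i, IsAlgebraic ℚ (p.coeff i)) ∧
            (∀ i, IsAlgebraic ℚ (q.coeff i)) ∧ (∀ x ∈ r.domain, q.eval (x 0) ≠ 0) ∧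
            Set.EqOn r.integrand (fun x => p.eval (x 0) / q.eval (x 0)) r.domain ∧ d = KZ.of r},
      KZ.of r - ℓ ∈ KZ.relations

/-- RATIONAL COMPOSITION (stub 39, pure algebra): substituting rational functions `X = p_X/q_X`,
`Y = p_Y/q_Y ∈ K(t)` into a polynomial `P ∈ K[X, Y]` gives `p(t)/(q_X q_Y)(t)^N` for some `p ∈` … [folklore] -/
def RatCompose : Prop :=
  ∀ (P : MvPolynomial (Fin 2) (algebraicClosure ℚ ℝ)) (pX qX pY qY : Polynomial (algebraicClosure ℚ ℝ)),
    ∃ (p : Polynomial (algebraicClosure ℚ ℝ)) (N : ℕ), ∀ t : ℝ,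
      (Polynomial.aeval t qX : ℝ) ≠ 0 → (Polynomial.aeval t qY : ℝ) ≠ 0 →
      (MvPolynomial.aeval ![(Polynomial.aeval t pX : ℝ) / Polynomial.aeval t qX,
          (Polynomial.aeval t pY : ℝ) / Polynomial.aeval t qY] P : ℝ) =
        (Polynomial.aeval t p : ℝ) / (Polynomial.aeval t (qX * qY) : ℝ) ^ N

/-- CONIC CHART (stub 40): Euler's secant substitution. For a conic `y² = q(x)`, `q = ax² + bx + c` over
`K` with `b² ≠ 4ac`, a point `(x₀, y₀) ∈ K²` on it, and a `ℚ`-semialgebraic `σ ⊆ {x ≠` … [cite: KontsevichZagier2001, §1.1] -/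
def ConicChart : Prop :=
  ∀ (a b c x₀ y₀ : algebraicClosure ℚ ℝ) (σ : Set (Fin 1 → ℝ)), IsSemialgebraic ℚ σ →
    (y₀ : ℝ) ^ 2 = (a : ℝ) * (x₀ : ℝ) ^ 2 + (b : ℝ) * (x₀ : ℝ) + c → (b : ℝ) ^ 2 - 4 * (a : ℝ) * c ≠ 0 →
    (∀ x ∈ σ, x 0 ≠ (x₀ : ℝ)) → (∀ x ∈ σ, 0 < (a : ℝ) * x 0 ^ 2 + (b : ℝ) * x 0 + c) →
    IsSemialgebraicFunOn ℚ σ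
        (fun x => (Real.sqrt ((a : ℝ) * x 0 ^ 2 + (b : ℝ) * x 0 + c) - y₀) / (x 0 - x₀)) ∧
      ∀ x ∈ σ,
        ((Real.sqrt ((a : ℝ) * x 0 ^ 2 + (b : ℝ) * x 0 + c) - y₀) / (x 0 - x₀)) ^ 2 - a ≠ 0 ∧
        (x₀ : ℝ) + (2 * (a : ℝ) * x₀ + b -
            2 * (y₀ : ℝ) * ((Real.sqrt ((a : ℝ) * x 0 ^ 2 + (b : ℝ) * x 0 + c) - y₀) / (x 0 - x₀))) /
          (((Real.sqrt ((a : ℝ) * x 0 ^ 2 + (b : ℝ) * x 0 + c) - y₀) / (x 0 - x₀)) ^ 2 - a) = x 0 ∧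
        (y₀ : ℝ) + ((Real.sqrt ((a : ℝ) * x 0 ^ 2 + (b : ℝ) * x 0 + c) - y₀) / (x 0 - x₀)) * (x 0 - x₀) =
          Real.sqrt ((a : ℝ) * x 0 ^ 2 + (b : ℝ) * x 0 + c)

/-- DEGENERATE CONICS (stub 41): if `b² = 4ac` then on `σ ⊆ {q > 0}` either `q` is a positive constant
`c ∈ K` (`a = b = 0`, `√c ∈ K`) or `q = a(x − ρ)²` with `a > 0`, `ρ = −b/2a ∈ K` and `√q =` … [cite: KontsevichZagier2001, §1.2 rule (1)] -/
def ConicDegenerate : Prop :=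
  ∀ (a b c : algebraicClosure ℚ ℝ) (P Q : MvPolynomial (Fin 2) (algebraicClosure ℚ ℝ))
    (r : KZ.IntegralRep 1), (b : ℝ) ^ 2 - 4 * (a : ℝ) * c = 0 →
    (∀ x ∈ r.domain, 0 < (a : ℝ) * x 0 ^ 2 + (b : ℝ) * x 0 + c) →
    (∀ x ∈ r.domain,
      (MvPolynomial.aeval ![x 0, Real.sqrt ((a : ℝ) * x 0 ^ 2 + (b : ℝ) * x 0 + c)] Q : ℝ) ≠ 0) →
    Set.EqOn r.integrand (fun x =>
      (MvPolynomial.aeval ![x 0, Real.sqrt ((a : ℝ) * x 0 ^ 2 + (b : ℝ) * x 0 + c)] P : ℝ) /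
        MvPolynomial.aeval ![x 0, Real.sqrt ((a : ℝ) * x 0 ^ 2 + (b : ℝ) * x 0 + c)] Q) r.domain →
    ∃ ℓ ∈ AddSubgroup.closure
        {d : KZ.FormalRep | (∃ r : KZ.IntegralRep 0, d = KZ.of r) ∨
          ∃ (r : KZ.IntegralRep 1) (p q : Polynomial ℝ), (∀ i, IsAlgebraic ℚ (p.coeff i)) ∧
            (∀ i, IsAlgebraic ℚ (q.coeff i)) ∧ (∀ x ∈ r.domain, q.eval (x 0) ≠ 0) ∧
            Set.EqOn r.integrand (fun x => p.eval (x 0) / q.eval (x 0)) r.domain ∧ d = KZ.of r},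
      KZ.of r - ℓ ∈ KZ.relations

/-- ROOT CHART (stub 42): for `n ≥ 1`, `a, b, c, e ∈ K` with `ae ≠ bc` and a `ℚ`-semialgebraic
`σ ⊆ {(ax + b)/(cx + e) > 0}`, the radical `t = ψ(x) = ⁿ√((ax + b)/(cx + e))` is a … [cite: KontsevichZagier2001, §1.1] -/
def RootChart : Prop :=
  ∀ (n : ℕ) (a b c e : algebraicClosure ℚ ℝ) (σ : Set (Fin 1 → ℝ)), IsSemialgebraic ℚ σ → 0 < n →
    (a : ℝ) * e - b * c ≠ 0 →
    (∀ x ∈ σ, 0 < ((a : ℝ) * x 0 + b) / ((c : ℝ) * x 0 + e)) →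
    IsSemialgebraicFunOn ℚ σ (fun x => (((a : ℝ) * x 0 + b) / ((c : ℝ) * x 0 + e)) ^ ((n : ℝ)⁻¹)) ∧
      ∀ x ∈ σ,
        (a : ℝ) - c * ((((a : ℝ) * x 0 + b) / ((c : ℝ) * x 0 + e)) ^ ((n : ℝ)⁻¹)) ^ n ≠ 0 ∧
        ((e : ℝ) * ((((a : ℝ) * x 0 + b) / ((c : ℝ) * x 0 + e)) ^ ((n : ℝ)⁻¹)) ^ n - b) /
            ((a : ℝ) - c * ((((a : ℝ) * x 0 + b) / ((c : ℝ) * x 0 + e)) ^ ((n : ℝ)⁻¹)) ^ n) = x 0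

/-- BAND AREA (stub 43, every base dimension `n`): the area representation `[B, 1]` of the band
`B = {(x, y) | x ∈ τ, α x ≤ y ≤ β x}` between two `ℚ`-semialgebraic graphs `α ≤ β` over a … [cite: KontsevichZagier2001, §1.2 rule (3)] -/
def BandArea : Prop :=
  ∀ (n : ℕ) (r : KZ.IntegralRep (n + 1)) (τ : Set (Fin n → ℝ)) (α β : (Fin n → ℝ) → ℝ),
    IsSemialgebraic ℚ τ → IsSemialgebraicFunOn ℚ τ α → IsSemialgebraicFunOn ℚ τ β →
    (∀ x ∈ τ, α x ≤ β x) →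
    r.domain = {z | (Fin.init z : Fin n → ℝ) ∈ τ ∧ α (Fin.init z) ≤ z (Fin.last n) ∧
      z (Fin.last n) ≤ β (Fin.init z)} →
    Set.EqOn r.integrand (fun _ => 1) r.domain →
    ∃ r' : KZ.IntegralRep n, r'.domain = τ ∧ (r'.integrand = fun x => β x - α x) ∧
      KZ.of r - KZ.of r' ∈ KZ.relations

/-! ## The genus-zero sector: stubs 38–43 (ALL CLOSED: 38 by the lead, 39–43 in wave c7-1) -/

/-- stub 38 — rational chart (size L; lead). CLOSED: p130350
`Theorems/InverseLandauTateLiftingRatChart.lean` (lead c7). [cite: KontsevichZagier2001, §1.2 rule (2)] -/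
theorem stub_ratChart : RatChart :=
  tateLifting_ratChart

/-- stub 39 — rational composition (size S/M, pure algebra). CLOSED: p129986
`Theorems/InverseLandauTateLiftingRatCompose.lean` (wave c7-1). [folklore] -/
theorem stub_ratCompose : RatCompose :=
  tateLifting_ratCompose

/-- stub 40 — conic chart (size M). CLOSED: p130014 `Theorems/InverseLandauTateLiftingConicChart.lean`
(wave c7-1). [folklore] -/
theorem stub_conicChart : ConicChart :=
  tateLifting_conicChart

/-- stub 41 — degenerate conics (size M). CLOSED: p130165
`Theorems/InverseLandauTateLiftingConicDegenerate.lean` (wave c7-1). [cite: KontsevichZagier2001, §1.2 rule (1)] -/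
theorem stub_conicDegenerate : ConicDegenerate :=
  tateLifting_conicDegenerate

/-- stub 42 — root chart (size S/M). CLOSED: p130024 `Theorems/InverseLandauTateLiftingRootChart.lean`
(wave c7-1). [folklore] -/
theorem stub_rootChart : RootChart :=
  tateLifting_rootChart

/-- stub 43 — band area (size M; one Newton–Leibniz move, integrability from the finite area). CLOSED: p129999
`Theorems/InverseLandauTateLiftingBandArea.lean` (wave c7-1). [cite: KontsevichZagier2001, §1.2 rule (3)] -/
theorem stub_bandArea : BandArea :=
  tateLifting_bandArea

/-! ## The genus-zero sector: composition -/

/-- The CONIC GENERATORS: `[σ, P(x, √q(x))/Q(x, √q(x))]`, `q = ax² + bx + c` with `a, b, c ∈ K`, `q > 0`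
on `σ`, `P, Q ∈ K[X, Y]`, `Q(x, √q(x)) ≠ 0` on `σ` — all integrands in the function … [folklore] -/
def conicGens : Set KZ.FormalRep :=
  {d : KZ.FormalRep | ∃ (a b c : algebraicClosure ℚ ℝ) (P Q : MvPolynomial (Fin 2) (algebraicClosure ℚ ℝ))
      (r : KZ.IntegralRep 1),
    (∀ x ∈ r.domain, 0 < (a : ℝ) * x 0 ^ 2 + (b : ℝ) * x 0 + c) ∧
    (∀ x ∈ r.domain,
      (MvPolynomial.aeval ![x 0, Real.sqrt ((a : ℝ) * x 0 ^ 2 + (b : ℝ) * x 0 + c)] Q : ℝ) ≠ 0) ∧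
    Set.EqOn r.integrand (fun x =>
      (MvPolynomial.aeval ![x 0, Real.sqrt ((a : ℝ) * x 0 ^ 2 + (b : ℝ) * x 0 + c)] P : ℝ) /
        MvPolynomial.aeval ![x 0, Real.sqrt ((a : ℝ) * x 0 ^ 2 + (b : ℝ) * x 0 + c)] Q) r.domain ∧
    d = KZ.of r}

/-- The RADICAL GENERATORS: `[σ, P(x, y)/Q(x, y)]` with `y = ⁿ√((ax + b)/(cx + e))`, `n ≥ 1`,
`a, b, c, e ∈ K`, `ae ≠ bc`, `(ax + b)/(cx + e) > 0` on `σ`, `Q(x, y) ≠ 0` on `σ` — integrands in the function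
field of the rational curve `yⁿ(cx + e) = ax + b`. [folklore] -/
def rootGens : Set KZ.FormalRep :=
  {d : KZ.FormalRep | ∃ (n : ℕ) (a b c e : algebraicClosure ℚ ℝ)
      (P Q : MvPolynomial (Fin 2) (algebraicClosure ℚ ℝ)) (r : KZ.IntegralRep 1),
    0 < n ∧ (a : ℝ) * e - b * c ≠ 0 ∧
    (∀ x ∈ r.domain, 0 < ((a : ℝ) * x 0 + b) / ((c : ℝ) * x 0 + e)) ∧
    (∀ x ∈ r.domain, (MvPolynomial.aeval
      ![x 0, (((a : ℝ) * x 0 + b) / ((c : ℝ) * x 0 + e)) ^ ((n : ℝ)⁻¹)] Q : ℝ) ≠ 0) ∧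
    Set.EqOn r.integrand (fun x =>
      (MvPolynomial.aeval ![x 0, (((a : ℝ) * x 0 + b) / ((c : ℝ) * x 0 + e)) ^ ((n : ℝ)⁻¹)] P : ℝ) /
        MvPolynomial.aeval ![x 0, (((a : ℝ) * x 0 + b) / ((c : ℝ) * x 0 + e)) ^ ((n : ℝ)⁻¹)] Q)
      r.domain ∧
    d = KZ.of r}

/-! The reductions `GenusZero.chart_reduce` / `conic_reduce_core` / `conic_reduce` / `root_reduce` (Euler's secant
substitution, degenerate conics, radical charts; proved here modulo stubs 38–42 in cycle c7) have LANDED in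
`Theorems/InverseLandauTateLiftingGenusZeroSector.lean` (p130691) and are imported from there. -/

/-- THE GENUS-ZERO SECTOR's generators: low-dimensional algebraic, conic, radical. [folklore] -/
def genusZeroGens : Set KZ.FormalRep :=
  lowDimAlgGens ∪ conicGens ∪ rootGens

/-- Every genus-zero generator reduces to the low-dimensional algebraic sector modulo relations.
[cite: KontsevichZagier2001, §1.2] -/
theorem genusZero_reduce_of (_hRC : RatChart) (_hCo : RatCompose) (_hCC : ConicChart) (_hCD : ConicDegenerate)
    (_hRt : RootChart) :
    ∀ d ∈ genusZeroGens, ∃ ℓ ∈ AddSubgroup.closure lowDimAlgGens, d - ℓ ∈ KZ.relations := by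
  rintro d ((hd | hd) | hd)
  · exact ⟨d, AddSubgroup.subset_closure hd, by rw [sub_self]; exact KZ.relations.zero_mem⟩
  · exact GenusZero.conic_reduce d hd
  · exact GenusZero.root_reduce d hd

/-- **Kernel transfer along reductions**: if every generator of `S` differs by a relation from an element of
`closure L`, and the kernel form of Conjecture 1 holds on `closure L`, then it holds on `closure S`.
[cite: KontsevichZagier2001, §1.2] -/
theorem kernel_of_reduce {S L : Set KZ.FormalRep}
    (hred : ∀ d ∈ S, ∃ ℓ ∈ AddSubgroup.closure L, d - ℓ ∈ KZ.relations)
    (hL : ∀ c ∈ AddSubgroup.closure L, KZ.eval c = 0 → c ∈ KZ.relations) :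
    ∀ c ∈ AddSubgroup.closure S, KZ.eval c = 0 → c ∈ KZ.relations := by
  intro c hc hev
  classical
  rw [← Submodule.span_int_eq_addSubgroupClosure, Submodule.mem_toAddSubgroup,
    Submodule.mem_span_set'] at hc
  obtain ⟨k, f, g, rfl⟩ := hc
  choose ℓ hℓ hrel using fun i => hred (g i) (g i).2
  have hdiff : ∑ i, f i • ((g i : KZ.FormalRep)) - ∑ i, f i • ℓ i ∈ KZ.relations := by
    rw [← Finset.sum_sub_distrib]
    refine sum_mem fun i _ => ?_
    rw [← smul_sub]
    exact KZ.relations.zsmul_mem (hrel i) _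
  have hmem : ∑ i, f i • ℓ i ∈ AddSubgroup.closure L :=
    sum_mem fun i _ => AddSubgroup.zsmul_mem _ (hℓ i) _
  have hev' : KZ.eval (∑ i, f i • ℓ i) = 0 := by
    have h0 := KZ.relations_le_ker_eval_holds hdiff
    rw [AddMonoidHom.mem_ker, map_sub, hev, zero_sub, neg_eq_zero] at h0
    exact h0
  have h := KZ.relations.add_mem hdiff (hL _ hmem hev')
  rwa [sub_add_cancel] at h

/-- **THE GENUS-ZERO SECTOR (kernel form), modulo stubs 38–42.** Every vanishing `ℤ`-combination of point
representations, algebraic-coefficient rational representations of dimension one, CONIC … [cite: KontsevichZagier2001, §1.2] -/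
theorem genusZeroLowDimKernel_of (hRC : RatChart) (hCo : RatCompose) (hCC : ConicChart)
    (hCD : ConicDegenerate) (hRt : RootChart) :
    ∀ c ∈ AddSubgroup.closure genusZeroGens, KZ.eval c = 0 → c ∈ KZ.relations :=
  kernel_of_reduce (genusZero_reduce_of hRC hCo hCC hCD hRt) kzKernelConjecture_lowDimAlg

/-- **The crux on the genus-zero sector** (modulo stubs 38–42): every vanishing combination of genus-zero
generators lies in `KZ.relations ⊔ closure T` (indeed in `KZ.relations`). [cite: KontsevichZagier2001, §1.2] -/
theorem TateLifting_genusZeroSector_of (hRC : RatChart) (hCo : RatCompose) (hCC : ConicChart)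
    (hCD : ConicDegenerate) (hRt : RootChart) (T : Set KZ.FormalRep) :
    ∀ c ∈ AddSubgroup.closure genusZeroGens, KZ.eval c = 0 → c ∈ KZ.relations ⊔ AddSubgroup.closure T :=
  fun c hc h0 => AddSubgroup.mem_sup_left (genusZeroLowDimKernel_of hRC hCo hCC hCD hRt c hc h0)

/-- **Conjecture 1 for a conic representation against a rational one** (modulo stubs 38–42): equal values
imply KZ-equivalence. [cite: KontsevichZagier2001, §1.2] -/
theorem kzPeriodConjecture_conic_of (hRC : RatChart) (hCo : RatCompose) (hCC : ConicChart)
    (hCD : ConicDegenerate) (hRt : RootChart) (a b c : algebraicClosure ℚ ℝ)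
    (P Q : MvPolynomial (Fin 2) (algebraicClosure ℚ ℝ)) (r r' : KZ.IntegralRep 1)
    (hpos : ∀ x ∈ r.domain, 0 < (a : ℝ) * x 0 ^ 2 + (b : ℝ) * x 0 + c)
    (hQ : ∀ x ∈ r.domain,
      (MvPolynomial.aeval ![x 0, Real.sqrt ((a : ℝ) * x 0 ^ 2 + (b : ℝ) * x 0 + c)] Q : ℝ) ≠ 0)
    (hint : Set.EqOn r.integrand (fun x =>
      (MvPolynomial.aeval ![x 0, Real.sqrt ((a : ℝ) * x 0 ^ 2 + (b : ℝ) * x 0 + c)] P : ℝ) /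
        MvPolynomial.aeval ![x 0, Real.sqrt ((a : ℝ) * x 0 ^ 2 + (b : ℝ) * x 0 + c)] Q) r.domain)
    (p q : Polynomial ℝ) (hp : ∀ i, IsAlgebraic ℚ (p.coeff i)) (hq : ∀ i, IsAlgebraic ℚ (q.coeff i))
    (hq0 : ∀ x ∈ r'.domain, q.eval (x 0) ≠ 0)
    (hpq : Set.EqOn r'.integrand (fun x => p.eval (x 0) / q.eval (x 0)) r'.domain)
    (hv : r.value = r'.value) : KZ.Equivalent r r' :=
  genusZeroLowDimKernel_of hRC hCo hCC hCD hRt _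
    (sub_mem (AddSubgroup.subset_closure (Or.inl (Or.inr ⟨a, b, c, P, Q, r, hpos, hQ, hint, rfl⟩)))
      (AddSubgroup.subset_closure (Or.inl (Or.inl (Or.inr ⟨r', p, q, hp, hq, hq0, hpq, rfl⟩)))))
    (by rw [map_sub, KZ.eval_of, KZ.eval_of, hv, sub_self])

/-! ### Conic bands (areas) -/

/-- `x ↦ P(x₀, g(x))` is `ℚ`-semialgebraic on `τ ⊆ ℝ¹` for `P ∈ K[X, Y]` (`K = ℚ̄ ∩ ℝ`) and `g`
`ℚ`-semialgebraic on `τ` (induction on `P`; algebraic constants are `ℚ`-definable). [cite: KontsevichZagier2001, §1.1] -/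
theorem isSemialgebraicFunOn_aeval_pair {τ : Set (Fin 1 → ℝ)} (hτ : IsSemialgebraic ℚ τ)
    {g : (Fin 1 → ℝ) → ℝ} (hg : IsSemialgebraicFunOn ℚ τ g)
    (P : MvPolynomial (Fin 2) (algebraicClosure ℚ ℝ)) :
    IsSemialgebraicFunOn ℚ τ (fun x => (MvPolynomial.aeval ![x 0, g x] P : ℝ)) := by
  induction P using MvPolynomial.induction_on with
  | C a =>
    refine (isSemialgebraicFunOn_const_of_isAlgebraic hτ (mem_algebraicClosure_iff.1 a.2)).congr
      fun z _ => ?_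
    simp
  | add p q hp hq =>
    refine (hp.fun_add hq).congr fun z _ => ?_
    simp
  | mul_X p i hp =>
    fin_cases i
    · refine (hp.fun_mul (isSemialgebraicFunOn_apply hτ 0)).congr fun z _ => ?_
      simp
    · refine (hp.fun_mul hg).congr fun z _ => ?_
      simp

/-- The CONIC BANDS: area representations `[B, 1]` of bands `B = {(x, y) | x ∈ τ, α(x) ≤ y ≤ β(x)}` between
two arcs `α = A(x, √q(x)) ≤ β = B(x, √q(x))` (`A, B ∈ K(X, Y)`, `q = ax² + bx + c >` … [folklore] -/
def conicBandGens : Set KZ.FormalRep :=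
  {d : KZ.FormalRep | ∃ (a b c : algebraicClosure ℚ ℝ)
      (Pα Qα Pβ Qβ : MvPolynomial (Fin 2) (algebraicClosure ℚ ℝ)) (τ : Set (Fin 1 → ℝ))
      (α β : (Fin 1 → ℝ) → ℝ) (r : KZ.IntegralRep 2),
    IsSemialgebraic ℚ τ ∧
    (∀ x ∈ τ, 0 < (a : ℝ) * x 0 ^ 2 + (b : ℝ) * x 0 + c) ∧
    (∀ x ∈ τ, (MvPolynomial.aeval ![x 0, Real.sqrt ((a : ℝ) * x 0 ^ 2 + (b : ℝ) * x 0 + c)] Qα : ℝ) ≠ 0) ∧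
    (∀ x ∈ τ, (MvPolynomial.aeval ![x 0, Real.sqrt ((a : ℝ) * x 0 ^ 2 + (b : ℝ) * x 0 + c)] Qβ : ℝ) ≠ 0) ∧
    (∀ x ∈ τ, α x =
      (MvPolynomial.aeval ![x 0, Real.sqrt ((a : ℝ) * x 0 ^ 2 + (b : ℝ) * x 0 + c)] Pα : ℝ) /
        MvPolynomial.aeval ![x 0, Real.sqrt ((a : ℝ) * x 0 ^ 2 + (b : ℝ) * x 0 + c)] Qα) ∧
    (∀ x ∈ τ, β x =
      (MvPolynomial.aeval ![x 0, Real.sqrt ((a : ℝ) * x 0 ^ 2 + (b : ℝ) * x 0 + c)] Pβ : ℝ) /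
        MvPolynomial.aeval ![x 0, Real.sqrt ((a : ℝ) * x 0 ^ 2 + (b : ℝ) * x 0 + c)] Qβ) ∧
    (∀ x ∈ τ, α x ≤ β x) ∧
    r.domain = {z | (Fin.init z : Fin 1 → ℝ) ∈ τ ∧ α (Fin.init z) ≤ z (Fin.last 1) ∧
      z (Fin.last 1) ≤ β (Fin.init z)} ∧
    Set.EqOn r.integrand (fun _ => 1) r.domain ∧ d = KZ.of r}

/-- **Reduction of the conic bands** (stub 43): `[B, 1] ≡ [τ, β − α]` by one Newton–Leibniz move, and
`β − α = (P_β Q_α − P_α Q_β)/(Q_α Q_β)` at `(x, √q(x))` is a conic integrand. [cite: KontsevichZagier2001, §1.2 rule (3)] -/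
theorem conicBand_reduce_of (hBA : BandArea) :
    ∀ d ∈ conicBandGens, ∃ ℓ ∈ AddSubgroup.closure genusZeroGens, d - ℓ ∈ KZ.relations := by
  rintro d ⟨a, b, c, Pα, Qα, Pβ, Qβ, τ, α, β, r, hτ, hpos, hQα, hQβ, hα, hβ, hle, hdom, hint, rfl⟩
  have hsq : IsSemialgebraicFunOn ℚ τ (fun x => Real.sqrt ((a : ℝ) * x 0 ^ 2 + (b : ℝ) * x 0 + c)) := by
    have hq : IsSemialgebraicFunOn ℚ τ (fun x => (a : ℝ) * x 0 ^ 2 + (b : ℝ) * x 0 + c) := by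
      refine (isSemialgebraicFunOn_aeval_pair hτ (isSemialgebraicFunOn_apply hτ 0)
        (MvPolynomial.C a * MvPolynomial.X 0 ^ 2 + MvPolynomial.C b * MvPolynomial.X 0 + MvPolynomial.C c)).congr
        fun x _ => ?_
      simp [IntermediateField.algebraMap_apply]
    exact IsSemialgebraicFunOn.sqrt_holds hq
  have hαs : IsSemialgebraicFunOn ℚ τ α :=
    ((isSemialgebraicFunOn_aeval_pair hτ hsq Pα).div (isSemialgebraicFunOn_aeval_pair hτ hsq Qα) hQα).congr
      fun x hx => (hα x hx).symm
  have hβs : IsSemialgebraicFunOn ℚ τ β :=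
    ((isSemialgebraicFunOn_aeval_pair hτ hsq Pβ).div (isSemialgebraicFunOn_aeval_pair hτ hsq Qβ) hQβ).congr
      fun x hx => (hβ x hx).symm
  obtain ⟨r', hdom', hint', hrel⟩ := hBA 1 r τ α β hτ hαs hβs hle hdom hint
  refine ⟨KZ.of r', AddSubgroup.subset_closure (Or.inl (Or.inr
    ⟨a, b, c, Pβ * Qα - Pα * Qβ, Qα * Qβ, r', ?_, ?_, ?_, rfl⟩)), hrel⟩
  · rw [hdom']; exact hpos
  · rw [hdom']
    intro x hx
    rw [map_mul]
    exact mul_ne_zero (hQα x hx) (hQβ x hx)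
  · rw [hdom', hint']
    intro x hx
    simp only [map_sub, map_mul]
    rw [hβ x hx, hα x hx, div_sub_div _ _ (hQβ x hx) (hQα x hx)]
    ring

/-- **THE GENUS-ZERO SECTOR WITH CONIC BANDS (kernel form), modulo stubs 38–43**: Conjecture 1 holds on the
subgroup generated by the genus-zero generators and the area representations of conic … [cite: KontsevichZagier2001, §1.2] -/
theorem conicBandKernel_of (hRC : RatChart) (hCo : RatCompose) (hCC : ConicChart) (hCD : ConicDegenerate)
    (hRt : RootChart) (hBA : BandArea) :
    ∀ c ∈ AddSubgroup.closure (genusZeroGens ∪ conicBandGens), KZ.eval c = 0 → c ∈ KZ.relations := by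
  refine kernel_of_reduce (fun d hd => ?_) (genusZeroLowDimKernel_of hRC hCo hCC hCD hRt)
  rcases hd with hd | hd
  · exact ⟨d, AddSubgroup.subset_closure hd, by rw [sub_self]; exact KZ.relations.zero_mem⟩
  · exact conicBand_reduce_of hBA d hd

/-- **Two conic bands with the same area are KZ-equivalent** (modulo stubs 38–43). [cite: KontsevichZagier2001, §1.2] -/
theorem kzPeriodConjecture_conicBand_of (hRC : RatChart) (hCo : RatCompose) (hCC : ConicChart)
    (hCD : ConicDegenerate) (hRt : RootChart) (hBA : BandArea) {r r' : KZ.IntegralRep 2}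
    (hr : KZ.of r ∈ conicBandGens) (hr' : KZ.of r' ∈ conicBandGens) (hv : r.value = r'.value) :
    KZ.Equivalent r r' :=
  conicBandKernel_of hRC hCo hCC hCD hRt hBA _
    (sub_mem (AddSubgroup.subset_closure (Or.inr hr)) (AddSubgroup.subset_closure (Or.inr hr')))
    (by rw [map_sub, KZ.eval_of, KZ.eval_of, hv, sub_self])

end GenusZero

section Rotation

open Literature.ModelTheory.ExponentialFields (IsSemialgebraic)

/-! ## The rotation sector (continuation lead c8): statements

SYMMETRY AS A MOVE. The quotient by a rotational symmetry is an all-dimensional operation under which every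
kernel sector is stable WITHOUT transcendence input. If the domain and integrand of `r = [σ, f]` (dimension
`n + 2`) are invariant under the rotations of the last two coordinates `(y, z)`, then (null half-hyperplane
`{z = 0, y ≤ 0}` excised) ONE change … (abridged 2026-08-17 to fit the 200 kB crux-workfile cap; full text in `Lines/Sketch.md`) -/

/-- Invariance of a representation of dimension `n + 2` under the rotations of its last two coordinates
`(y, z) = (x_n, x_{n+1})` (domain and integrand). [folklore] -/
def RotInvariant {n : ℕ} (r : KZ.IntegralRep (n + 2)) : Prop :=
  ∀ x ∈ r.domain, ∀ c s : ℝ, c ^ 2 + s ^ 2 = 1 →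
    (Fin.snoc (Fin.snoc (Fin.init (Fin.init x : Fin (n + 1) → ℝ) : Fin n → ℝ)
        (c * (Fin.init x : Fin (n + 1) → ℝ) (Fin.last n) - s * x (Fin.last (n + 1))) :
          Fin (n + 1) → ℝ)
        (s * (Fin.init x : Fin (n + 1) → ℝ) (Fin.last n) + c * x (Fin.last (n + 1))) :
        Fin (n + 2) → ℝ) ∈ r.domain ∧
    r.integrand (Fin.snoc (Fin.snoc (Fin.init (Fin.init x : Fin (n + 1) → ℝ) : Fin n → ℝ)
        (c * (Fin.init x : Fin (n + 1) → ℝ) (Fin.last n) - s * x (Fin.last (n + 1))) :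
          Fin (n + 1) → ℝ)
        (s * (Fin.init x : Fin (n + 1) → ℝ) (Fin.last n) + c * x (Fin.last (n + 1))) :
        Fin (n + 2) → ℝ) = r.integrand x

/-- ROTATION ENGINE (stub 44, lead). If `r = [σ, f]` (dimension `n + 2`) is invariant under the rotations of the
last two coordinates, the honest REDUCED representation `q = [{(v, ρ, u) | ρ >` … [cite: KontsevichZagier2001, §1.2 rule (2)] -/
def RotationEngine : Prop :=
  ∀ (n : ℕ) (r : KZ.IntegralRep (n + 2)), RotInvariant r →
    ∃ q : KZ.IntegralRep (n + 2),
      q.domain = {w | 0 < (Fin.init w : Fin (n + 1) → ℝ) (Fin.last n) ∧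
        (Fin.snoc (Fin.init w : Fin (n + 1) → ℝ) 0 : Fin (n + 2) → ℝ) ∈ r.domain} ∧
      (q.integrand = fun w => 2 * (Fin.init w : Fin (n + 1) → ℝ) (Fin.last n) /
          (1 + w (Fin.last (n + 1)) ^ 2) *
        r.integrand (Fin.snoc (Fin.init w : Fin (n + 1) → ℝ) 0 : Fin (n + 2) → ℝ)) ∧
      KZ.of r - KZ.of q ∈ KZ.relations

/-- ROTATION SPLITTING (stub 45). The reduced representation of the engine lives on `M × ℝ`,
`M = {(v, ρ) | ρ > 0, (v, ρ, 0) ∈ σ}`, with integrand `(2ρ·f(v,ρ,0)) ⊗ (1/(1+u²))`; the honest … [cite: KontsevichZagier2001, §4.1] -/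
def RotationSplit : Prop :=
  ∀ (n : ℕ) (r q : KZ.IntegralRep (n + 2)),
    q.domain = {w | 0 < (Fin.init w : Fin (n + 1) → ℝ) (Fin.last n) ∧
        (Fin.snoc (Fin.init w : Fin (n + 1) → ℝ) 0 : Fin (n + 2) → ℝ) ∈ r.domain} →
    (q.integrand = fun w => 2 * (Fin.init w : Fin (n + 1) → ℝ) (Fin.last n) /
          (1 + w (Fin.last (n + 1)) ^ 2) *
        r.integrand (Fin.snoc (Fin.init w : Fin (n + 1) → ℝ) 0 : Fin (n + 2) → ℝ)) →
    ∃ (m : KZ.IntegralRep (n + 1)) (c : KZ.IntegralRep 1),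
      m.domain = {p | 0 < p (Fin.last n) ∧ (Fin.snoc p 0 : Fin (n + 2) → ℝ) ∈ r.domain} ∧
      (m.integrand = fun p => 2 * p (Fin.last n) * r.integrand (Fin.snoc p 0 : Fin (n + 2) → ℝ)) ∧
      c.domain = Set.univ ∧ (c.integrand = fun u => 1 / (1 + u 0 ^ 2)) ∧
      KZ.of q - KZ.of m * KZ.of c ∈ KZ.relations

/-- REVOLUTION BAND (stub 46, every base dimension `n`): the meridian `[band ∩ {ρ > 0}, 2ρ]` of an integrand-`1`
solid of revolution of the band `{v ∈ τ, α v ≤ ρ ≤ β v}` (`0 ≤ α ≤ β` … [cite: KontsevichZagier2001, §1.2 rule (3)] -/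
def RevolutionBand : Prop :=
  ∀ (n : ℕ) (m : KZ.IntegralRep (n + 1)) (τ : Set (Fin n → ℝ)) (α β : (Fin n → ℝ) → ℝ),
    IsSemialgebraic ℚ τ → IsSemialgebraicFunOn ℚ τ α → IsSemialgebraicFunOn ℚ τ β →
    (∀ v ∈ τ, 0 ≤ α v) → (∀ v ∈ τ, α v ≤ β v) →
    m.domain = {p | (Fin.init p : Fin n → ℝ) ∈ τ ∧ 0 < p (Fin.last n) ∧
      α (Fin.init p) ≤ p (Fin.last n) ∧ p (Fin.last n) ≤ β (Fin.init p)} →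
    Set.EqOn m.integrand (fun p => 2 * p (Fin.last n)) m.domain →
    ∃ b : KZ.IntegralRep n, b.domain = τ ∧ (b.integrand = fun v => β v ^ 2 - α v ^ 2) ∧
      KZ.of m - KZ.of b ∈ KZ.relations

/-- VOLUME FORM RELATIVE TO A SUBGROUP (stub 47; Cresson–Viu-Sos over the tree's `KZ.semiCanonicalReduction_holds`).
For every subgroup `relations ≤ G ≤ ker eval`: "every formal combination of … [cite: CressonViusos2022, §1 p. 326] -/
def VolumeFormLift : Prop :=
  ∀ G : AddSubgroup KZ.FormalRep, KZ.relations ≤ G → G ≤ KZ.eval.ker →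
    ((∀ c : KZ.FormalRep, KZ.eval c = 0 → c ∈ G) ↔
      ∀ (d : ℕ) (K₁ K₂ : KZ.IntegralRep d),
        IsCompact K₁.domain → (interior K₁.domain).Nonempty →
        IsCompact K₂.domain → (interior K₂.domain).Nonempty →
        (∀ x ∈ K₁.domain, K₁.integrand x = 1) → (∀ x ∈ K₂.domain, K₂.integrand x = 1) →
        K₁.value = K₂.value → KZ.of K₁ - KZ.of K₂ ∈ G)

/-- THE PLANE ENGINE OF HARD-DISC CLUSTER INTEGRALS (stub 48; verbatim `IsotropyFactorisation2` of route
HardSphereVirial, stmt-KontsevichZagierPeriods-10458): for a `ℚ`-semialgebraic `σ ⊆` … [cite: KontsevichZagier2001, §1.2 rule (2)] -/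
def IsotropyPlane : Prop :=
  ∀ (σ : Set (Fin 6 → ℝ)), IsSemialgebraic ℚ σ →
    (∀ R : Matrix (Fin 2) (Fin 2) ℝ, R.transpose * R = 1 → ∀ x : Fin 6 → ℝ,
      x ∈ σ ↔ (![(R.mulVec ![x 0, x 1]) 0, (R.mulVec ![x 0, x 1]) 1, (R.mulVec ![x 2, x 3]) 0,
        (R.mulVec ![x 2, x 3]) 1, (R.mulVec ![x 4, x 5]) 0, (R.mulVec ![x 4, x 5]) 1] : Fin 6 → ℝ) ∈ σ) →
    ∀ (r : KZ.IntegralRep 6), r.domain = σ → (∀ x ∈ r.domain, r.integrand x = 1) →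
    ∀ (q : KZ.IntegralRep 6),
      q.domain = {w | 0 < w 1 ∧ (![w 1, 0, w 2, w 3, w 4, w 5] : Fin 6 → ℝ) ∈ σ} →
      (∀ w ∈ q.domain, q.integrand w = 2 / (1 + w 0 ^ 2) * w 1) →
      KZ.of r - KZ.of q ∈ KZ.relations

/-- RADIAL BAND (stub 49). (a) STEP: the meridian `[{ρ > 0, |v|² + ρ² ≤ 1}, 2ρ·P(|v|² + ρ²)]` of the closed unit
ball of dimension `n + 2` with radial integrand `P(|x|²)` (`P ∈ K[X]`) is ONE … [cite: KontsevichZagier2001, §1.2 rule (3)] -/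
def RadialBand : Prop :=
  (∀ (n : ℕ) (P : Polynomial (algebraicClosure ℚ ℝ)) (m : KZ.IntegralRep (n + 1)),
    m.domain = {p | 0 < p (Fin.last n) ∧
      ∑ i, (Fin.init p : Fin n → ℝ) i ^ 2 + p (Fin.last n) ^ 2 ≤ 1} →
    Set.EqOn m.integrand (fun p => 2 * p (Fin.last n) *
      (Polynomial.aeval (∑ i, (Fin.init p : Fin n → ℝ) i ^ 2 + p (Fin.last n) ^ 2) P : ℝ)) m.domain →
    ∃ (Q : Polynomial (algebraicClosure ℚ ℝ)) (b : KZ.IntegralRep n),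
      b.domain = {v | ∑ i, v i ^ 2 ≤ 1} ∧
      (b.integrand = fun v => (Polynomial.aeval (∑ i, v i ^ 2) Q : ℝ)) ∧
      KZ.of m - KZ.of b ∈ KZ.relations) ∧
  (∀ (P : Polynomial (algebraicClosure ℚ ℝ)) (r : KZ.IntegralRep 1),
    r.domain = {v | ∑ i, v i ^ 2 ≤ 1} →
    Set.EqOn r.integrand (fun v => (Polynomial.aeval (∑ i, v i ^ 2) P : ℝ)) r.domain →
    ∃ r₀ : KZ.IntegralRep 0, r₀.domain = Set.univ ∧ KZ.of r - KZ.of r₀ ∈ KZ.relations)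

/-! ## The rotation sector: stubs 44–49 -/

/-- stub 44 — the rotation engine (size L; lead). CLOSED: p135048 `Theorems/InverseLandauTateLiftingRotationEngine.lean`
(+ aux p134820 `…RotationEngineAux.lean`; lead c8). [cite: KontsevichZagier2001, §1.2 rule (2)] -/
theorem stub_rotationEngine : RotationEngine :=
  tateLifting_rotationEngine

/-- stub 45 — rotation splitting (size M). CLOSED: p132234
`Theorems/InverseLandauTateLiftingRotationSplit.lean` (wave c8-1). [cite: KontsevichZagier2001, §4.1] -/
theorem stub_rotationSplit : RotationSplit :=
  tateLifting_rotationSplit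

/-- stub 46 — revolution band (size M). CLOSED: p132555
`Theorems/InverseLandauTateLiftingRevolutionBand.lean` (wave c8-1). [cite: KontsevichZagier2001, §1.2 rule (3)] -/
theorem stub_revolutionBand : RevolutionBand :=
  tateLifting_revolutionBand

/-- stub 47 — the volume form relative to a subgroup (size M). CLOSED: p132624
`Theorems/InverseLandauTateLiftingVolumeFormLift.lean` (wave c8-1). [cite: CressonViusos2022, §1 p. 326] -/
theorem stub_volumeFormLift : VolumeFormLift :=
  tateLifting_volumeFormLift

/-- stub 48 — `IsotropyFactorisation2` verbatim (size L). CLOSED: p134411 (+ aux p133510; wave c8-1); HardSphereVirial's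
stmt-10458 is closable by `exact tateLifting_isotropyPlane`. [cite: KontsevichZagier2001, §1.2 rule (2)] -/
theorem stub_isotropyPlane : IsotropyPlane :=
  tateLifting_isotropyPlane

/-- stub 49 — radial band (size M/L). CLOSED: p134320 `Theorems/InverseLandauTateLiftingRadialBand.lean`
(wave c8-1). [cite: KontsevichZagier2001, §1.2 rule (3)] -/
theorem stub_radialBand : RadialBand :=
  tateLifting_radialBand

/-! ## The rotation sector: composition -/

/-- `[ℝ, du/(1+u²)] ∼ [disc]` — the tree's `PiNormalisation` (route CompiledSubstitutions, proved).
[cite: KontsevichZagier2001, §1.1 eq. (1)] -/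
theorem arctan_sub_piRep_mem_relations (c : KZ.IntegralRep 1) (hcd : c.domain = Set.univ)
    (hci : c.integrand = fun u => 1 / (1 + u 0 ^ 2)) :
    KZ.of c - KZ.of KZ.piRep ∈ KZ.relations :=
  (Summit.KontsevichZagierPeriods.CompiledSubstitutions.PiNormalisation.piNormalisation_proof KZ.piRep rfl
    (fun _ _ => rfl)).1 c hcd (fun x _ => by rw [hci])

/-- **Rotation reduction** (stubs 44 + 45): a rotation-invariant representation differs by relations from
`[meridian] · [disc]`, the meridian being the honest representation `[M, 2ρ·f(v,ρ,0)]`.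
[cite: KontsevichZagier2001, §1.2 rule (2)] -/
theorem rotation_reduce_of (hE : RotationEngine) (hS : RotationSplit) {n : ℕ} (r : KZ.IntegralRep (n + 2))
    (hinv : RotInvariant r) :
    ∃ m : KZ.IntegralRep (n + 1),
      m.domain = {p | 0 < p (Fin.last n) ∧ (Fin.snoc p 0 : Fin (n + 2) → ℝ) ∈ r.domain} ∧
      (m.integrand = fun p => 2 * p (Fin.last n) * r.integrand (Fin.snoc p 0 : Fin (n + 2) → ℝ)) ∧
      KZ.of r - KZ.of m * KZ.of KZ.piRep ∈ KZ.relations := by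
  obtain ⟨q, hqd, hqi, hrq⟩ := hE n r hinv
  obtain ⟨m, c, hmd, hmi, hcd, hci, hqmc⟩ := hS n r q hqd hqi
  refine ⟨m, hmd, hmi, ?_⟩
  have hc : KZ.of m * KZ.of c - KZ.of m * KZ.of KZ.piRep ∈ KZ.relations := by
    rw [← mul_sub]
    exact KZ.of_mul_mem_relations m (arctan_sub_piRep_mem_relations c hcd hci)
  have : KZ.of r - KZ.of m * KZ.of KZ.piRep =
      (KZ.of r - KZ.of q) + (KZ.of q - KZ.of m * KZ.of c) + (KZ.of m * KZ.of c - KZ.of m * KZ.of KZ.piRep) := by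
    abel
  rw [this]
  exact KZ.relations.add_mem (KZ.relations.add_mem hrq hqmc) hc

/-- **Kernel transfer along reductions with a common non-zero factor**: if every generator of `S` is
`≡ ℓ · t` modulo relations with `ℓ ∈ closure L` and a FIXED `t` of non-zero value, and the … [cite: KontsevichZagier2001, §1.2] -/
theorem kernel_of_reduce_mul {S L : Set KZ.FormalRep} (t : KZ.FormalRep) (ht : KZ.eval t ≠ 0)
    (hred : ∀ d ∈ S, ∃ ℓ ∈ AddSubgroup.closure L, d - ℓ * t ∈ KZ.relations)
    (hL : ∀ c ∈ AddSubgroup.closure L, KZ.eval c = 0 → c ∈ KZ.relations) :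
    ∀ c ∈ AddSubgroup.closure S, KZ.eval c = 0 → c ∈ KZ.relations := by
  intro c hc hev
  classical
  rw [← Submodule.span_int_eq_addSubgroupClosure, Submodule.mem_toAddSubgroup,
    Submodule.mem_span_set'] at hc
  obtain ⟨k, f, g, rfl⟩ := hc
  choose ℓ hℓ hrel using fun i => hred (g i) (g i).2
  have hdiff : ∑ i, f i • ((g i : KZ.FormalRep)) - (∑ i, f i • ℓ i) * t ∈ KZ.relations := by
    rw [Finset.sum_mul, ← Finset.sum_sub_distrib]
    refine sum_mem fun i _ => ?_
    rw [smul_mul_assoc, ← smul_sub]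
    exact KZ.relations.zsmul_mem (hrel i) _
  have hmem : ∑ i, f i • ℓ i ∈ AddSubgroup.closure L :=
    sum_mem fun i _ => AddSubgroup.zsmul_mem _ (hℓ i) _
  have hev' : KZ.eval (∑ i, f i • ℓ i) = 0 := by
    have h0 := KZ.relations_le_ker_eval_holds hdiff
    rw [AddMonoidHom.mem_ker, map_sub, hev, zero_sub, neg_eq_zero, KZ.eval_mul'] at h0
    exact (mul_eq_zero.1 h0).resolve_right ht
  have h := KZ.relations.add_mem hdiff (KZ.mul_mem_relations_right_holds _ t (hL _ hmem hev'))
  rwa [sub_add_cancel] at h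

/-- The ROTATION GENERATORS over a set `S` of base generators: rotation-invariant representations `r`
(dimension `n + 2`) together with a meridian `m` — any honest representation on
`M = {(v,` … [folklore] -/
def rotationGens (S : Set KZ.FormalRep) : Set KZ.FormalRep :=
  {d : KZ.FormalRep | ∃ (n : ℕ) (r : KZ.IntegralRep (n + 2)) (m : KZ.IntegralRep (n + 1)),
    RotInvariant r ∧
    m.domain = {p | 0 < p (Fin.last n) ∧ (Fin.snoc p 0 : Fin (n + 2) → ℝ) ∈ r.domain} ∧
    Set.EqOn m.integrand (fun p => 2 * p (Fin.last n) * r.integrand (Fin.snoc p 0 : Fin (n + 2) → ℝ))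
      m.domain ∧
    (∃ ℓ ∈ AddSubgroup.closure S, KZ.of m - ℓ ∈ KZ.relations) ∧ d = KZ.of r}

/-- Every rotation generator over `S` is `≡ ℓ · [disc]` with `ℓ ∈ closure S` (stubs 44, 45).
[cite: KontsevichZagier2001, §1.2] -/
theorem rotationGens_reduce_of (hE : RotationEngine) (hS : RotationSplit) (S : Set KZ.FormalRep) :
    ∀ d ∈ rotationGens S, ∃ ℓ ∈ AddSubgroup.closure S, d - ℓ * KZ.of KZ.piRep ∈ KZ.relations := by
  rintro d ⟨n, r, m, hinv, hmd, hmi, ⟨ℓ, hℓ, hmℓ⟩, rfl⟩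
  obtain ⟨m', hm'd, hm'i, hred⟩ := rotation_reduce_of hE hS r hinv
  refine ⟨ℓ, hℓ, ?_⟩
  have hmm' : KZ.of m' - KZ.of m ∈ KZ.relations :=
    KZ.of_sub_of_mem_relations_of_eqOn (by rw [hmd, hm'd]) fun p hp => by
      rw [hm'i]
      exact (hmi (by rw [hmd, ← hm'd]; exact hp)).symm
  have h1 : KZ.of m' * KZ.of KZ.piRep - ℓ * KZ.of KZ.piRep ∈ KZ.relations := by
    rw [← sub_mul]
    exact KZ.mul_mem_relations_right_holds _ _ (by
      have := KZ.relations.add_mem hmm' hmℓ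
      rwa [sub_add_sub_cancel] at this)
  have : KZ.of r - ℓ * KZ.of KZ.piRep =
      (KZ.of r - KZ.of m' * KZ.of KZ.piRep) + (KZ.of m' * KZ.of KZ.piRep - ℓ * KZ.of KZ.piRep) := by abel
  rw [this]
  exact KZ.relations.add_mem hred h1

/-- **ROTATION KERNEL TRANSFER** (modulo stubs 44, 45). If the kernel form of Conjecture 1 holds on the
subgroup generated by `S`, it holds on the subgroup generated by the rotation generators … [cite: KontsevichZagier2001, §1.2] -/
theorem rotationKernel_of (hE : RotationEngine) (hS : RotationSplit) {S : Set KZ.FormalRep}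
    (hK : ∀ c ∈ AddSubgroup.closure S, KZ.eval c = 0 → c ∈ KZ.relations) :
    ∀ c ∈ AddSubgroup.closure (rotationGens S), KZ.eval c = 0 → c ∈ KZ.relations :=
  kernel_of_reduce_mul (KZ.of KZ.piRep) (by rw [KZ.eval_of_piRep]; exact Real.pi_ne_zero)
    (rotationGens_reduce_of hE hS S) hK

/-- **The crux on the rotation images of a kernel sector** (modulo stubs 44, 45). [cite: KontsevichZagier2001, §1.2] -/
theorem TateLifting_rotationSector_of (hE : RotationEngine) (hS : RotationSplit) {S : Set KZ.FormalRep}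
    (hK : ∀ c ∈ AddSubgroup.closure S, KZ.eval c = 0 → c ∈ KZ.relations) (T : Set KZ.FormalRep) :
    ∀ c ∈ AddSubgroup.closure (rotationGens S), KZ.eval c = 0 →
      c ∈ KZ.relations ⊔ AddSubgroup.closure T :=
  fun c hc h0 => AddSubgroup.mem_sup_left (rotationKernel_of hE hS hK c hc h0)

/-! ### Solids of revolution; closed unit balls of every dimension (compositions REMOVED from the skeleton
2026-08-17 by lead c9 to fit the 200 kB crux-workfile cap — they are LANDED verbatim: `revolution_reduce`,
`revolutionKernel`, `conicRevolutionKernel`, `kzPeriodConjecture_conicRevolution` in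
`Theorems/InverseLandauTateLiftingRotationSector.lean` (p135379) and `ball_mem_piSubring`, `ballKernel`,
`kzPeriodConjecture_ball` in `Theorems/InverseLandauTateLiftingRotationBalls.lean` (p135525)). -/

/-! ### Hard-disc configuration integrals (the plane engine, stub 48) -/

/-- The HARD-DISC GENERATORS over `S`: integrand-`1` representations over `ℚ`-semialgebraic
`σ ⊆ (ℝ²)³` invariant under the diagonal action of `O(2)`, together with an honest reduced … [folklore] -/
def hardDiscGens (S : Set KZ.FormalRep) : Set KZ.FormalRep :=
  {d : KZ.FormalRep | ∃ (σ : Set (Fin 6 → ℝ)) (r : KZ.IntegralRep 6) (t : KZ.IntegralRep 5),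
    IsSemialgebraic ℚ σ ∧
    (∀ R : Matrix (Fin 2) (Fin 2) ℝ, R.transpose * R = 1 → ∀ x : Fin 6 → ℝ,
      x ∈ σ ↔ (![(R.mulVec ![x 0, x 1]) 0, (R.mulVec ![x 0, x 1]) 1, (R.mulVec ![x 2, x 3]) 0,
        (R.mulVec ![x 2, x 3]) 1, (R.mulVec ![x 4, x 5]) 0, (R.mulVec ![x 4, x 5]) 1] : Fin 6 → ℝ) ∈ σ) ∧
    r.domain = σ ∧ (∀ x ∈ r.domain, r.integrand x = 1) ∧
    t.domain = {p | 0 < p 0 ∧ (![p 0, 0, p 1, p 2, p 3, p 4] : Fin 6 → ℝ) ∈ σ} ∧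
    Set.EqOn t.integrand (fun p => 2 * p 0) t.domain ∧
    (∃ ℓ ∈ AddSubgroup.closure S, KZ.of t - ℓ ∈ KZ.relations) ∧ d = KZ.of r}

/-- The honest representation `[ℝ, du/(1+u²)]`. [cite: KontsevichZagier2001, §1.1 eq. (1)] -/
theorem exists_arctanRep_univ : ∃ c : KZ.IntegralRep 1, c.domain = Set.univ ∧
    (c.integrand = fun u => 1 / (1 + u 0 ^ 2)) := by
  have hsa : IsSemialgebraicFunOn ℚ (Set.univ : Set (Fin 1 → ℝ)) (fun u : Fin 1 → ℝ => 1 / (1 + u 0 ^ 2)) := by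
    refine (isSemialgebraicFunOn_aeval_div_aeval Literature.ModelTheory.ExponentialFields.isSemialgebraic_univ
      (1 : MvPolynomial (Fin 1) ℚ) (1 + MvPolynomial.X 0 ^ 2) fun x _ => ?_).congr fun x _ => ?_
    · simp only [map_add, map_one, map_pow, MvPolynomial.aeval_X]; positivity
    · simp
  have hint : IntegrableOn (fun u : Fin 1 → ℝ => 1 / (1 + u 0 ^ 2)) Set.univ := by
    rw [integrableOn_univ]
    have h := (volume_preserving_funUnique (Fin 1) ℝ).integrable_comp_of_integrable
      integrable_inv_one_add_sq
    refine h.congr (Filter.Eventually.of_forall fun u => ?_)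
    simp [MeasurableEquiv.funUnique, one_div]
  exact ⟨⟨Set.univ, _, Literature.ModelTheory.ExponentialFields.isSemialgebraic_univ, hsa, hint⟩, rfl, rfl⟩

/-- **Reduction of the hard-disc generators** (stub 48 + the product structure): `[σ, 1] ≡ ℓ · [disc]` with
`ℓ ∈ closure S`. The reduced representation of `IsotropyPlane` is realised as the honest product
`[ℝ, du/(1+u²)] × t`. [cite: KontsevichZagier2001, §4.1] -/
theorem hardDiscGens_reduce_of (hI : IsotropyPlane) (S : Set KZ.FormalRep) :
    ∀ d ∈ hardDiscGens S, ∃ ℓ ∈ AddSubgroup.closure S, d - ℓ * KZ.of KZ.piRep ∈ KZ.relations := by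
  rintro d ⟨σ, r, t, hσ, hO, hrd, hri, htd, hti, ⟨ℓ, hℓ, htℓ⟩, rfl⟩
  obtain ⟨c, hcd, hci⟩ := exists_arctanRep_univ
  refine ⟨ℓ, hℓ, ?_⟩
  -- the reduced representation as an honest product
  have hq := hI σ hσ hO r hrd hri (c.prod t) ?_ ?_
  · have h1 : KZ.of (c.prod t) - KZ.of t * KZ.of c ∈ KZ.relations := by
      rw [← KZ.of_mul_of]; exact KZ.mul_sub_mul_comm_mem_relations _ _
    have h2 : KZ.of t * KZ.of c - KZ.of t * KZ.of KZ.piRep ∈ KZ.relations := by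
      rw [← mul_sub]; exact KZ.of_mul_mem_relations t (arctan_sub_piRep_mem_relations c hcd hci)
    have h3 : KZ.of t * KZ.of KZ.piRep - ℓ * KZ.of KZ.piRep ∈ KZ.relations := by
      rw [← sub_mul]; exact KZ.mul_mem_relations_right_holds _ _ htℓ
    have : KZ.of r - ℓ * KZ.of KZ.piRep = (KZ.of r - KZ.of (c.prod t)) +
        (KZ.of (c.prod t) - KZ.of t * KZ.of c) + (KZ.of t * KZ.of c - KZ.of t * KZ.of KZ.piRep) +
        (KZ.of t * KZ.of KZ.piRep - ℓ * KZ.of KZ.piRep) := by abel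
    rw [this]
    exact KZ.relations.add_mem (KZ.relations.add_mem (KZ.relations.add_mem hq h1) h2) h3
  · rw [KZ.IntegralRep.prod_domain]
    ext w
    simp only [KZ.IntegralRep.mem_prodDomain, hcd, Set.mem_univ, true_and, htd, Set.mem_setOf_eq]
    rfl
  · intro w hw
    rw [KZ.IntegralRep.prod_integrand_eq, KZ.IntegralRep.prodFun_apply, hci]
    rw [KZ.IntegralRep.prod_domain, KZ.IntegralRep.mem_prodDomain] at hw
    rw [hti hw.2]
    show (1 : ℝ) / (1 + w 0 ^ 2) * (2 * w 1) = 2 / (1 + w 0 ^ 2) * w 1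
    ring

/-- **KERNEL FORM ON THE HARD-DISC CONFIGURATION INTEGRALS** (modulo stub 48): if Conjecture 1 (kernel
form) holds on `closure S`, it holds on the subgroup generated by the `O(2)`-invariant … [cite: KontsevichZagier2001, §1.2] -/
theorem hardDiscKernel_of (hI : IsotropyPlane) {S : Set KZ.FormalRep}
    (hK : ∀ c ∈ AddSubgroup.closure S, KZ.eval c = 0 → c ∈ KZ.relations) :
    ∀ c ∈ AddSubgroup.closure (hardDiscGens S), KZ.eval c = 0 → c ∈ KZ.relations :=
  kernel_of_reduce_mul (KZ.of KZ.piRep) (by rw [KZ.eval_of_piRep]; exact Real.pi_ne_zero)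
    (hardDiscGens_reduce_of hI S) hK

/-! ### The volume normal form of the crux (stub 47) -/

/-- Tate fibres have value `0`. [cite: KontsevichZagier2001, §1.2] -/
theorem closure_tateFibres_le_ker : AddSubgroup.closure tateFibres ≤ KZ.eval.ker := by
  refine (AddSubgroup.closure_le _).2 ?_
  rintro d ⟨n, P, Q, ε, ϖ₀, r, -, -, -, hV, -, hϖ₀, hdom, heq, rfl⟩
  rw [SetLike.mem_coe, AddMonoidHom.mem_ker, KZ.eval_of]
  show ∫ x in r.domain, r.integrand x = 0
  rw [MeasureTheory.setIntegral_congr_fun (KZ.IntegralRep.measurableSet_domain_holds r) heq, hdom]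
  exact hV ϖ₀ hϖ₀

/-- **THE VOLUME NORMAL FORM OF THE CRUX** (modulo stub 47): `TateLifting` iff any two representations of
one dimension with compact domains of non-empty interior, integrand `1` and the same volume differ by an
element of `relations ⊔ closure T`. [cite: CressonViusos2022, §1 p. 326] -/
theorem tateLifting_iff_volumeForm_of (hV : VolumeFormLift) :
    TateLifting ↔ ∀ (d : ℕ) (K₁ K₂ : KZ.IntegralRep d),
      IsCompact K₁.domain → (interior K₁.domain).Nonempty →
      IsCompact K₂.domain → (interior K₂.domain).Nonempty →
      (∀ x ∈ K₁.domain, K₁.integrand x = 1) → (∀ x ∈ K₂.domain, K₂.integrand x = 1) →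
      K₁.value = K₂.value → KZ.of K₁ - KZ.of K₂ ∈ KZ.relations ⊔ AddSubgroup.closure tateFibres := by
  rw [tateLifting_iff]
  exact hV _ le_sup_left (sup_le KZ.relations_le_ker_eval_holds closure_tateFibres_le_ker)

/-- **Conjecture 1 (kernel form) iff the Cresson–Viu-Sos volume conjecture** (modulo stub 47, the case
`G = relations`). [cite: CressonViusos2022, §1 p. 326] -/
theorem kzKernelConjecture_iff_volumeConjectureCompact_of (hV : VolumeFormLift) :
    KZKernelConjecture ↔ KZ.volumeConjectureCompact := by
  have h := hV KZ.relations le_rfl KZ.relations_le_ker_eval_holds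
  constructor
  · intro hK d K₁ K₂ h1c h1i h2c h2i h11 h21 hv
    exact h.1 hK d K₁ K₂ h1c h1i h2c h2i h11 h21 hv
  · intro hv c hc
    exact h.2 (fun d K₁ K₂ h1c h1i h2c h2i h11 h21 hval => hv K₁ K₂ h1c h1i h2c h2i h11 h21 hval) c hc

end Rotation

section AffinePolytope

open Literature.ModelTheory.ExponentialFields (IsSemialgebraic)

/-! ## The affine / polytope sector (continuation lead c9): statements

HILBERT'S THIRD PROBLEM HAS NO OBSTRUCTION IN THE KZ CALCULUS. An open simplex with real-algebraic vertices is
the image of the open ORDERED simplex `KZ.openOrderedSimplex n = {1 > x₀ > x₁ > ⋯ > x_{n−1} > 0}` under an affine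
map `x ↦ Ax + b` with real-algebraic entries (`A` invertible); one rule-(2) move along … (abridged; full text in `Lines/Sketch.md`) -/

/-- AFFINE ENGINE (stub 50): for `A ∈ GL_n` and `b` with real-algebraic entries, (i) `det A` is algebraic;
(ii) every representation `[σ, f]` differs by relations from the honest pull-back
`[{x` … [cite: KontsevichZagier2001, §1.2 rule (2)] -/
def AffineChart : Prop :=
  ∀ (n : ℕ) (A : Matrix (Fin n) (Fin n) ℝ) (b : Fin n → ℝ),
    (∀ i j, IsAlgebraic ℚ (A i j)) → (∀ i, IsAlgebraic ℚ (b i)) → A.det ≠ 0 →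
    IsAlgebraic ℚ A.det ∧
    (∀ r : KZ.IntegralRep n, ∃ r' : KZ.IntegralRep n,
      r'.domain = {x | A.mulVec x + b ∈ r.domain} ∧
      (r'.integrand = fun x => |A.det| * r.integrand (A.mulVec x + b)) ∧
      KZ.of r - KZ.of r' ∈ KZ.relations) ∧
    (∀ (c : ℝ) (P : MvPolynomial (Fin n) (algebraicClosure ℚ ℝ)), IsAlgebraic ℚ c →
      ∃ P' : MvPolynomial (Fin n) (algebraicClosure ℚ ℝ),
        ∀ x : Fin n → ℝ, (MvPolynomial.aeval x P' : ℝ) = c * MvPolynomial.aeval (A.mulVec x + b) P)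

/-- CUBICAL CHART OF THE ORDERED SIMPLEX (stub 51): (i) a representation over the open ordered simplex
`{1 > x₀ > ⋯ > x_{n−1} > 0}` differs by relations from the honest pull-back over the open … [cite: KontsevichZagier2001, §1.2 rule (2)] -/
def SimplexChart : Prop :=
  ∀ n : ℕ,
    (∀ r : KZ.IntegralRep n, r.domain = KZ.openOrderedSimplex n →
      ∃ r' : KZ.IntegralRep n, r'.domain = Set.pi Set.univ (fun _ => Set.Ioo (0 : ℝ) 1) ∧
        (r'.integrand = fun x => (∏ i : Fin n, ∏ k ∈ Finset.Iio i, x k) *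
          r.integrand (fun i => ∏ j ∈ Finset.Iic i, x j)) ∧
        KZ.of r - KZ.of r' ∈ KZ.relations) ∧
    (∀ P : MvPolynomial (Fin n) (algebraicClosure ℚ ℝ),
      ∃ P' : MvPolynomial (Fin n) (algebraicClosure ℚ ℝ),
        ∀ x : Fin n → ℝ, (MvPolynomial.aeval x P' : ℝ) =
          (∏ i : Fin n, ∏ k ∈ Finset.Iio i, x k) * MvPolynomial.aeval (fun i => ∏ j ∈ Finset.Iic i, x j) P)

/-- SIMPLEX = CONVEX HULL (stub 52): for an affinely independent family `v₀, …, v_n` in `ℝⁿ`, the matrix of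
consecutive differences `A_{ij} = v_{j+1,i} − v_{j,i}` is invertible and the INTERIOR … [folklore] -/
def SimplexHull : Prop :=
  ∀ (n : ℕ) (v : Fin (n + 1) → (Fin n → ℝ)), AffineIndependent ℝ v →
    (Matrix.of fun i j : Fin n => v j.succ i - v (Fin.castSucc j) i).det ≠ 0 ∧
    interior (convexHull ℝ (Set.range v)) =
      (fun x => (Matrix.of fun i j : Fin n => v j.succ i - v (Fin.castSucc j) i).mulVec x + v 0) ''
        KZ.openOrderedSimplex n

/-! ## The affine / polytope sector: stubs 50–52 -/

/-- stub 50 — the affine engine (size M). CLOSED: p136927 `Theorems/InverseLandauTateLiftingAffineChart.lean`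
(wave c9-1). [cite: KontsevichZagier2001, §1.2 rule (2)] -/
theorem stub_affineChart : AffineChart :=
  tateLifting_affineChart

/-- stub 51 — the cubical chart of the ordered simplex (size M). CLOSED: p136920
`Theorems/InverseLandauTateLiftingSimplexChart.lean` (wave c9-1). [cite: KontsevichZagier2001, §1.2 rule (2)] -/
theorem stub_simplexChart : SimplexChart :=
  tateLifting_simplexChart

/-- stub 52 — simplex = interior of the convex hull (size M). CLOSED: p136925
`Theorems/InverseLandauTateLiftingSimplexHull.lean` (wave c9-1). [folklore] -/
theorem stub_simplexHull : SimplexHull :=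
  tateLifting_simplexHull

/-! ## The affine / polytope sector: composition — LANDED verbatim (def-free) in `Theorems/InverseLandauTateLiftingPolytopeSector.lean`
(p137523): `Polytope.simplex_toCube`, `Polytope.simplex_toPoint` (every SIMPLEX REPRESENTATION `[A(Δ_n)+b, P]`, `A`, `b` real-algebraic,
`P ∈ K[x]`, differs by relations from a polynomial cube, hence from a point), `simplexKernel` (CONJECTURE 1, kernel form, on the span of
ALL simplex representations of ALL dimensions and the points), `polytope_reduce` / `kzPeriodConjecture_polytope` (POLYTOPES of any two
dimensions with the same volume are KZ-equivalent — volume is the only invariant, the Dehn invariant is invisible to the moves),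
`hullKernel` / `kzPeriodConjecture_hull` (convex-hull form), `kzPeriodConjecture_simplex`, `TateLifting_polytopeSector`. The block
(180 lines, checked rc 0 against stubs 50–52 before landing) was removed from this workfile for the 200 kB cap; the generating set
`simplexGens` it defined is restated where needed by the landed assemblies (`AxialSector`, `SolidGeometry`). -/

end AffinePolytope

section Space

open Literature.ModelTheory.ExponentialFields (IsSemialgebraic)

/-! ## The O(3) engine (continuation lead c9): statements

THE SPACE ENGINE OF HARD-SPHERE CLUSTER INTEGRALS. For a `ℚ`-semialgebraic `σ ⊆ (ℝ³)³` (three points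
`x₂, x₃, x₄`, the first particle at the origin) invariant under the diagonal action of `O(3)`, ONE rule-(2) move
in `ℝ⁹` along `Ψ(a, b, ρ, y₃, y₄) = (ρ·ω(a,b), M(a,b) y₃, M(a,b) y₄)` — `ω = (2a, 2b, 1 − a² − b²)/(1 + a² +` … (abridged; full text in `Lines/Sketch.md`) -/

/-- `O(3)`-invariance of `σ ⊆ (ℝ³)³` under the diagonal action (verbatim the hypothesis of
`IsotropyFactorisation3`). [folklore] -/
def O3Invariant (σ : Set (Fin 9 → ℝ)) : Prop :=
  ∀ R : Matrix (Fin 3) (Fin 3) ℝ, R.transpose * R = 1 → ∀ x : Fin 9 → ℝ,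
    x ∈ σ ↔ (![(R.mulVec ![x 0, x 1, x 2]) 0, (R.mulVec ![x 0, x 1, x 2]) 1, (R.mulVec ![x 0, x 1, x 2]) 2,
      (R.mulVec ![x 3, x 4, x 5]) 0, (R.mulVec ![x 3, x 4, x 5]) 1, (R.mulVec ![x 3, x 4, x 5]) 2,
      (R.mulVec ![x 6, x 7, x 8]) 0, (R.mulVec ![x 6, x 7, x 8]) 1, (R.mulVec ![x 6, x 7, x 8]) 2] :
        Fin 9 → ℝ) ∈ σ

/-- THE SPACE ENGINE (stub 53, lead). (i) VERBATIM `IsotropyFactorisation3` of route HardSphereVirial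
(stmt-KontsevichZagierPeriods-10457): `[σ, 1] − [q] ∈ KZ.relations` for the reduced representation `q` over
`{(a,b,ρ,y₃,y₄) | ρ >` … [cite: KontsevichZagier2001, §1.2 rule (2)] -/
def IsotropySpace : Prop :=
  (∀ (σ : Set (Fin 9 → ℝ)), Literature.ModelTheory.ExponentialFields.IsSemialgebraic ℚ σ → (∀ R : Matrix (Fin 3) (Fin 3) ℝ, R.transpose * R = 1 → ∀ x : Fin 9 → ℝ, x ∈ σ ↔ (![(R.mulVec ![x 0, x 1, x 2]) 0, (R.mulVec ![x 0, x 1, x 2]) 1, (R.mulVec ![x 0, x 1, x 2]) 2, (R.mulVec ![x 3, x 4, x 5]) 0, (R.mulVec ![x 3, x 4, x 5]) 1, (R.mulVec ![x 3, x 4, x 5]) 2, (R.mulVec ![x 6, x 7, x 8]) 0, (R.mulVec ![x 6, x 7, x 8]) 1, (R.mulVec ![x 6, x 7, x 8]) 2] : Fin 9 → ℝ) ∈ σ) → ∀ (r : Literature.NumberTheory.Transcendental.KZ.IntegralRep 9), r.domain = σ → (∀ x ∈ r.domain, r.integrand x = 1) → ∀ (q : Literature.NumberTheory.Transcendental.KZ.IntegralRep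 9), q.domain = {w | 0 < w 2 ∧ (![0, 0, w 2, w 3, w 4, w 5, w 6, w 7, w 8] : Fin 9 → ℝ) ∈ σ} → (∀ w ∈ q.domain, q.integrand w = 4 / (1 + w 0 ^ 2 + w 1 ^ 2) ^ 2 * w 2 ^ 2) → Literature.NumberTheory.Transcendental.KZ.of r - Literature.NumberTheory.Transcendental.KZ.of q ∈ Literature.NumberTheory.Transcendental.KZ.relations) ∧
  (∀ (σ : Set (Fin 9 → ℝ)), IsSemialgebraic ℚ σ → O3Invariant σ →
    ∀ (r : KZ.IntegralRep 9), r.domain = σ → (∀ x ∈ r.domain, r.integrand x = 1) →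
    ∃ m : KZ.IntegralRep 7,
      m.domain = {p | 0 < p 0 ∧ (![0, 0, p 0, p 1, p 2, p 3, p 4, p 5, p 6] : Fin 9 → ℝ) ∈ σ} ∧
      (m.integrand = fun p => p 0 ^ 2))

/-- THE AREA OF THE SPHERE INSIDE THE RULES (stub 54): the honest stereographic chart representation
`[ℝ², 4/(1+a²+b²)²]` (value `4π = area(S²)`) differs by relations from `4·[disc]` (it is invariant under the
rotations of its two … [cite: KontsevichZagier2001, §1.2] -/
def SphereArea : Prop :=
  ∀ c : KZ.IntegralRep 2, c.domain = Set.univ →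
    (c.integrand = fun u => 4 / (1 + u 0 ^ 2 + u 1 ^ 2) ^ 2) →
    KZ.of c - (4 : ℤ) • KZ.of KZ.piRep ∈ KZ.relations

/-- GRAM INVARIANCE (stub 55): a set of three-point configurations read off the Gram data
`(|x₂|², |x₃|², |x₄|², x₂·x₃, x₂·x₄, x₃·x₄)` is invariant under the diagonal action of `O(3)` (orthogonal maps
preserve dot products). All … [folklore] -/
def GramInvariant : Prop :=
  ∀ (σ : Set (Fin 9 → ℝ)) (G : Set (Fin 6 → ℝ)),
    (∀ x : Fin 9 → ℝ, x ∈ σ ↔ (![x 0 ^ 2 + x 1 ^ 2 + x 2 ^ 2, x 3 ^ 2 + x 4 ^ 2 + x 5 ^ 2,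
        x 6 ^ 2 + x 7 ^ 2 + x 8 ^ 2, x 0 * x 3 + x 1 * x 4 + x 2 * x 5,
        x 0 * x 6 + x 1 * x 7 + x 2 * x 8, x 3 * x 6 + x 4 * x 7 + x 5 * x 8] : Fin 6 → ℝ) ∈ G) →
    O3Invariant σ

/-! ## The O(3) engine: stubs 53–55 -/

/-- stub 53 — the space engine, `IsotropyFactorisation3` verbatim + the honest meridian (size L; lead). CLOSED: p138715
`Theorems/InverseLandauTateLiftingIsotropySpaceMeridian.lean` (+ `…IsotropySpace.lean` p138370: … [cite: KontsevichZagier2001, §1.2 rule (2)] -/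
theorem stub_isotropySpace : IsotropySpace :=
  tateLifting_isotropySpace

/-- stub 54 — the area of the sphere inside the rules (size M). CLOSED: p137064
`Theorems/InverseLandauTateLiftingSphereArea.lean` (wave c9-1). [cite: KontsevichZagier2001, §1.2] -/
theorem stub_sphereArea : SphereArea :=
  tateLifting_sphereArea

/-- stub 55 — Gram invariance (size S). CLOSED: p136814 `Theorems/InverseLandauTateLiftingGramInvariant.lean`
(wave c9-1). [folklore] -/
theorem stub_gramInvariant : GramInvariant :=
  tateLifting_gramInvariant

/-! ## The O(3) engine: composition — LANDED verbatim (def-free) in `Theorems/InverseLandauTateLiftingSpaceSector.lean`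
(p139196: `exists_sphereChartRep`, `reduce_of_meridian`, `space_engine`, `spaceKernel`, `kzPeriodConjecture_space`,
`TateLifting_spaceSector`) and `Theorems/InverseLandauTateLiftingAxialSector.lean` (p140657); the in-skeleton copies
(`space_reduce_of`, `space_engine_of`, `spaceGens`, `spaceKernel_of`, `TateLifting_spaceSector_of`, `kzPeriodConjecture_space_of`,
`o3Invariant_of_gram_of`) were removed by lead c10 (2026-08-17) to keep the skeleton under the 200 kB crux-workfile cap. -/

end Space

section WaveTwo

open Literature.ModelTheory.ExponentialFields (IsSemialgebraic)

/-! ## Wave c9-2 (lead c9): polytopes as sets, ellipsoids, cones — statements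

Three corollary engines of the polytope sector (landed assembly `Theorems/InverseLandauTateLiftingPolytopeSector.lean`,
p137523) and of the affine engine (stub 50): POLYTOPES AS SETS (stub 56 `PolytopeUnion`: a finite union of closed
real-algebraic simplices with null pairwise overlaps is covered, up to … (abridged; full text in `Lines/Sketch.md`) -/

/-- POLYTOPES AS SETS (stub 56): a representation whose domain is a finite union of closed simplices
`convexHull ℝ {v₀..v_N}` (affinely independent, real-algebraic vertices) with pairwise null overlaps is covered, up to a
null set, … [folklore] -/
def PolytopeUnion : Prop :=
  ∀ (N k : ℕ) (V : Fin k → Fin (N + 1) → (Fin N → ℝ)) (r : KZ.IntegralRep N),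
    (∀ i, AffineIndependent ℝ (V i)) → (∀ i a c, IsAlgebraic ℚ (V i a c)) →
    r.domain = ⋃ i, convexHull ℝ (Set.range (V i)) →
    (∀ i j, i ≠ j → volume (convexHull ℝ (Set.range (V i)) ∩ convexHull ℝ (Set.range (V j))) = 0) →
    ∃ R : Fin k → KZ.IntegralRep N,
      (∀ i, (R i).domain = interior (convexHull ℝ (Set.range (V i)))) ∧
      (∀ i, (R i).integrand = r.integrand) ∧
      volume (r.domain \ ⋃ i ∈ (Finset.univ : Finset (Fin k)), (R i).domain) = 0 ∧
      ((Finset.univ : Finset (Fin k)) : Set (Fin k)).Pairwise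
        (fun i j => volume ((R i).domain ∩ (R j).domain) = 0)

/-- ELLIPSOIDS (stub 57): Conjecture 1 (kernel form) on the subgroup generated by the integrand-`1` representations
over affine images `A(B̄_n) + b` of closed unit balls (`A`, `b` real-algebraic, `det A ≠ 0`; all dimensions `n`), the … [cite: KontsevichZagier2001, §1.2 rule (2)] -/
def EllipsoidKernel : Prop :=
  ∀ c ∈ AddSubgroup.closure
      ({d : KZ.FormalRep | ∃ (n : ℕ) (A : Matrix (Fin n) (Fin n) ℝ) (b : Fin n → ℝ) (r : KZ.IntegralRep n),
          (∀ i j, IsAlgebraic ℚ (A i j)) ∧ (∀ i, IsAlgebraic ℚ (b i)) ∧ A.det ≠ 0 ∧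
          r.domain = (fun x => A.mulVec x + b) '' {x | ∑ i, x i ^ 2 ≤ 1} ∧
          (∀ y ∈ r.domain, r.integrand y = 1) ∧ d = KZ.of r} ∪
        ({d : KZ.FormalRep | ∃ (n : ℕ) (P : Polynomial (algebraicClosure ℚ ℝ)) (r : KZ.IntegralRep n),
            r.domain = {x | ∑ i, x i ^ 2 ≤ 1} ∧
            Set.EqOn r.integrand (fun x => (Polynomial.aeval (∑ i, x i ^ 2) P : ℝ)) r.domain ∧ d = KZ.of r} ∪
          {d : KZ.FormalRep | ∃ r : KZ.IntegralRep 0, d = KZ.of r} ∪ {KZ.of KZ.piRep})),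
    KZ.eval c = 0 → c ∈ KZ.relations

/-- CONE ENGINE (stub 58): for the integrand-`1` representation over the cone
`Cone σ = {z ∈ ℝⁿ⁺¹ | 0 < z_n < 1, (z₀,…,z_{n−1})/z_n ∈ σ}` (apex `0`, base `σ × {1}`) and the integrand-`1` representation
over `σ`: `(n+1)·[Cone σ] − [σ]` … [cite: KontsevichZagier2001, §1.2] -/
def ConeEngine : Prop :=
  ∀ (n : ℕ) (r : KZ.IntegralRep (n + 1)) (s : KZ.IntegralRep n),
    r.domain = {z | z (Fin.last n) ∈ Set.Ioo (0 : ℝ) 1 ∧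
      (fun i => (Fin.init z : Fin n → ℝ) i / z (Fin.last n)) ∈ s.domain} →
    (∀ z ∈ r.domain, r.integrand z = 1) → (∀ x ∈ s.domain, s.integrand x = 1) →
    ((n + 1 : ℕ) : ℤ) • KZ.of r - KZ.of s ∈ KZ.relations

/-! ## Wave c9-2: stubs 56–58 -/

/-- stub 56 — polytopes as sets (size M). CLOSED: p138372 `Theorems/InverseLandauTateLiftingPolytopeUnion.lean`
(wave c9-2). [folklore] -/
theorem stub_polytopeUnion : PolytopeUnion :=
  tateLifting_polytopeUnion

/-- stub 57 — ellipsoids (size M). CLOSED: p138315 `Theorems/InverseLandauTateLiftingEllipsoidKernel.lean`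
(wave c9-2). [cite: KontsevichZagier2001, §1.2 rule (2)] -/
theorem stub_ellipsoidKernel : EllipsoidKernel :=
  tateLifting_ellipsoidKernel

/-- stub 58 — the cone engine (size M/L). CLOSED: p138790 `Theorems/InverseLandauTateLiftingConeEngine.lean`
(wave c9-2). [cite: KontsevichZagier2001, §1.2] -/
theorem stub_coneEngine : ConeEngine :=
  tateLifting_coneEngine

/-! ## Wave c9-2: composition — LANDED verbatim (def-free) in `Theorems/InverseLandauTateLiftingSolidGeometry.lean`
(p139388: `kzPeriodConjecture_polytopeSet`, `kzPeriodConjecture_ellipsoid`, `coneKernel`, `TateLifting_coneSector`); the skeleton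
copies (`kzPeriodConjecture_polytopeSet_of`, `kzPeriodConjecture_ellipsoid_of`, `coneGens`, `coneKernel_of`, `TateLifting_coneSector_of`)
were removed 2026-08-17 by lead c9 to respect the 200 kB crux-workfile cap. -/

end WaveTwo

section WaveThree

open Literature.ModelTheory.ExponentialFields (IsSemialgebraic)

/-! ## Wave c9-3 (lead c9): the axial engine with spectators, cube triangulation, simplex volumes — statements

THE AXIAL ENGINE completes the quotient by `SO(3)` begun by the space engine: after `x₂ = (0,0,ρ)` the residual symmetry of a
three-body configuration set is the rotation about the `z`-axis acting SIMULTANEOUSLY on `(y₃ₓ, y₃_y)` and `(y₄ₓ, y₄_y)` with the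
spectators `ρ,` … (abridged; full text in `Lines/Sketch.md`) -/

/-- Invariance of a representation over `ℝ⁷ = (ρ; a₃, b₃, c₃; a₄, b₄, c₄)` (domain and integrand) under the simultaneous rotations
of the coordinate pairs `(1, 2)` and `(4, 5)` (rotation about the `z`-axis of both points `y₃ = (p 1,` … [folklore] -/
def AxInvariant (t : KZ.IntegralRep 7) : Prop :=
  ∀ p ∈ t.domain, ∀ c s : ℝ, c ^ 2 + s ^ 2 = 1 →
    (![p 0, c * p 1 - s * p 2, s * p 1 + c * p 2, p 3, c * p 4 - s * p 5, s * p 4 + c * p 5, p 6] : Fin 7 → ℝ) ∈ t.domain ∧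
    t.integrand (![p 0, c * p 1 - s * p 2, s * p 1 + c * p 2, p 3, c * p 4 - s * p 5, s * p 4 + c * p 5, p 6] : Fin 7 → ℝ) =
      t.integrand p

/-- THE AXIAL ENGINE WITH SPECTATORS (stub 59): for `t = [τ, f]` over `ℝ⁷` invariant under the simultaneous rotations of the pairs
`(1,2)`, `(4,5)`, and every representation `q` over `{w | s := w 1 > 0, (w 2, s, 0, w 3, w 4, w 5, w` … [cite: KontsevichZagier2001, §1.2 rule (2)] -/
def AxialEngine : Prop :=
  ∀ (t : KZ.IntegralRep 7), AxInvariant t →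
    ∀ (q : KZ.IntegralRep 7),
      q.domain = {w | 0 < w 1 ∧ (![w 2, w 1, 0, w 3, w 4, w 5, w 6] : Fin 7 → ℝ) ∈ t.domain} →
      (∀ w ∈ q.domain, q.integrand w =
        2 / (1 + w 0 ^ 2) * w 1 * t.integrand (![w 2, w 1, 0, w 3, w 4, w 5, w 6] : Fin 7 → ℝ)) →
      KZ.of t - KZ.of q ∈ KZ.relations

/-- CUBE TRIANGULATION (stub 60): a representation over the open cube `(0,1)ⁿ` is covered, up to the null walls `{xᵢ = xⱼ}`, by its
honest restrictions to the `n!` permuted open ordered simplices `{x | x ∘ σ ∈ Δ_n} = P_{σ}⁻¹(Δ_n)` — … [folklore] -/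
def CubeTriangulation : Prop :=
  ∀ (n : ℕ) (r : KZ.IntegralRep n), r.domain = Set.pi Set.univ (fun _ => Set.Ioo (0 : ℝ) 1) →
    ∃ R : Equiv.Perm (Fin n) → KZ.IntegralRep n,
      (∀ σ, (R σ).domain =
        (fun x => ((Equiv.Perm.permMatrix ℝ σ : Matrix (Fin n) (Fin n) ℝ)).mulVec x + 0) '' KZ.openOrderedSimplex n) ∧
      (∀ σ, (R σ).integrand = r.integrand) ∧
      (∀ σ, (R σ).domain ⊆ r.domain) ∧
      volume (r.domain \ ⋃ σ ∈ (Finset.univ : Finset (Equiv.Perm (Fin n))), (R σ).domain) = 0 ∧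
      ((Finset.univ : Finset (Equiv.Perm (Fin n))) : Set (Equiv.Perm (Fin n))).Pairwise
        (fun σ σ' => volume ((R σ).domain ∩ (R σ').domain) = 0)

/-- SIMPLEX VOLUMES (stub 61): the integrand-`1` representation over the affine image `A(Δ_n) + b` of the open ordered simplex has
value `|det A| / n!` (`vol Δ_n = 1/n!`, `Measure.addHaar_image_linearMap`, translation invariance). [folklore] -/
def SimplexValue : Prop :=
  ∀ (n : ℕ) (A : Matrix (Fin n) (Fin n) ℝ) (b : Fin n → ℝ) (r : KZ.IntegralRep n),
    r.domain = (fun x => A.mulVec x + b) '' KZ.openOrderedSimplex n → (∀ y ∈ r.domain, r.integrand y = 1) →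
    r.value = |A.det| / n.factorial

/-! ## Wave c9-3: stubs 59–61 -/

/-- stub 59 — the axial engine with spectators (size L). CLOSED: p140394 `Theorems/InverseLandauTateLiftingAxialEngine.lean`
(wave c9-3). [cite: KontsevichZagier2001, §1.2 rule (2)] -/
theorem stub_axialEngine : AxialEngine :=
  tateLifting_axialEngine

/-- stub 60 — cube triangulation (size M). CLOSED: p140171 `Theorems/InverseLandauTateLiftingCubeTriangulation.lean`
(wave c9-3). [folklore] -/
theorem stub_cubeTriangulation : CubeTriangulation :=
  tateLifting_cubeTriangulation

/-- stub 61 — simplex volumes (size M). CLOSED: p140200 `Theorems/InverseLandauTateLiftingSimplexValue.lean` (wave c9-3). [folklore] -/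
theorem stub_simplexValue : SimplexValue :=
  tateLifting_simplexValue

/-! ## Wave c9-3: composition — LANDED verbatim (def-free) in `Theorems/InverseLandauTateLiftingAxialSector.lean` (p140657):
`axialKernel` / `TateLifting_axialSector` (AXIAL KERNEL TRANSFER: `SO(2)` on the pairs `(1,2)`, `(4,5)` of `ℝ⁷` with spectator,
`tateLifting_axialEngine` on the honest product `[ℝ, du/(1+u²)] × m`, `PiNormalisation`, `RotationSector.kernel_of_reduce_mul`),
`cube_mem_simplexSpan` (CUBES ARE POLYTOPES: `(0,1)ⁿ` with a `K`-polynomial integrand lies in the simplex span, stub 60),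
`kzPeriodConjecture_cube_simplex` (the unit `n`-cube and every real-algebraic `m`-simplex of volume `1` are KZ-equivalent),
`kzPeriodConjecture_simplex_det` (two integrand-`1` simplices with `|det A|/n! = |det A′|/m!` are KZ-equivalent, stub 61).
The block (87 lines, checked rc 0 against stubs 59–61 before landing) was removed from this workfile for the 200 kB cap. -/

end WaveThree

/-! ## Wave c9-4 (lead c9, session 4): THE VOLUMES OF THE BALLS OF ALL DIMENSIONS AGAINST THE POWERS OF THE DISC

`k! · vol B̄₂ₖ = πᵏ` and `(2k+1)‼ · vol B̄₂ₖ₊₁ = 2ᵏ⁺¹ πᵏ` INSIDE THE RULES — identities in the formal period ring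
`P = FormalRep ⧸ relations` (stubs 62–64; Lindemann read in `P` through the landed `ball_mem_piSubring` and
`transcRingKernel`) — and the closed polydisc `D̄ᵏ ⊂ ℝ²ᵏ` has the class `⟦π⟧ᵏ` (stub 65, Fubini splitting, no transcendence).
Instances: route EulerFormChain's `BallCalibration` (`2·[B̄₄] − [D̄²] ∈ relations`, stmt-3819) and `BallCalibrationSix`
(`6·[B̄₆] − [D̄³]`, stmt-11797) become corollaries (`ballCalibration_of` below); Archimedes' `3·⟦B̄₃⟧ = 4·⟦π⟧`; the polydisc
classes are the `[π]ᵏ` of the product-free typings of routes HardSphereVirial and EulerFormChain. -/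
section WaveFour

/-- VALUE OF THE EVEN BALL (stub 62, first half): the integrand-`1` representation over the closed unit ball of `ℝ²ᵏ` has value
`πᵏ / k!` (`InnerProductSpace.volume_closedBall_of_dim_even` transported along `EuclideanSpace ℝ (Fin n) ≃ᵐ (Fin n → ℝ)`). [folklore] -/
def BallValueEven : Prop :=
  ∀ (k : ℕ) (b : KZ.IntegralRep (2 * k)), b.domain = {v | ∑ j, v j ^ 2 ≤ 1} →
    (∀ v ∈ b.domain, b.integrand v = 1) → b.value = Real.pi ^ k / (Nat.factorial k : ℝ)

/-- VALUE OF THE ODD BALL (stub 62, second half): the integrand-`1` representation over the closed unit ball of `ℝ²ᵏ⁺¹` has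
value `πᵏ 2ᵏ⁺¹ / (2k+1)‼` (`InnerProductSpace.volume_closedBall_of_dim_odd`). [folklore] -/
def BallValueOdd : Prop :=
  ∀ (k : ℕ) (b : KZ.IntegralRep (2 * k + 1)), b.domain = {v | ∑ j, v j ^ 2 ≤ 1} →
    (∀ v ∈ b.domain, b.integrand v = 1) →
    b.value = Real.pi ^ k * 2 ^ (k + 1) / (Nat.doubleFactorial (2 * k + 1) : ℝ)

/-- EVEN BALLS INSIDE THE RULES (stub 63): `k! · ⟦B̄₂ₖ⟧ = ⟦π⟧ᵏ` in the formal period ring (`ball_mem_piSubring` puts `⟦B̄₂ₖ⟧` in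
`K₀[⟦π⟧]`, `transcRingKernel` — Lindemann in `P` — makes `evalP` injective there, and the values agree by stub 62).
[cite: KontsevichZagier2001, §1.2] -/
def BallEven : Prop :=
  ∀ (k : ℕ) (b : KZ.IntegralRep (2 * k)), b.domain = {v | ∑ j, v j ^ 2 ≤ 1} →
    (∀ v ∈ b.domain, b.integrand v = 1) →
    (Nat.factorial k : KZ.FormalPeriodRing) * KZ.toFormalPeriod (KZ.of b) = KZ.toFormalPeriod (KZ.of KZ.piRep) ^ k

/-- ODD BALLS INSIDE THE RULES (stub 64): `(2k+1)‼ · ⟦B̄₂ₖ₊₁⟧ = 2ᵏ⁺¹ · ⟦π⟧ᵏ` in the formal period ring (Archimedes `3·⟦B̄₃⟧ = 4·⟦π⟧`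
at `k = 1`). [cite: KontsevichZagier2001, §1.2] -/
def BallOdd : Prop :=
  ∀ (k : ℕ) (b : KZ.IntegralRep (2 * k + 1)), b.domain = {v | ∑ j, v j ^ 2 ≤ 1} →
    (∀ v ∈ b.domain, b.integrand v = 1) →
    (Nat.doubleFactorial (2 * k + 1) : KZ.FormalPeriodRing) * KZ.toFormalPeriod (KZ.of b) =
      2 ^ (k + 1) * KZ.toFormalPeriod (KZ.of KZ.piRep) ^ k

/-- THE POLYDISC HAS THE CLASS `⟦π⟧ᵏ` (stub 65): an integrand-`1` representation over the closed polydisc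
`{v ∈ ℝ²ᵏ | v₂ᵢ² + v₂ᵢ₊₁² ≤ 1 (i < k)}` has class `⟦π⟧ᵏ` (induction on `k`: Fubini splitting `toFormalPeriod_of_prodSplit` off the
last disc, `piRep` = `[D̄, 1]`). [cite: KontsevichZagier2001, §4.1] -/
def PolydiscPow : Prop :=
  ∀ (k : ℕ) (p : KZ.IntegralRep (2 * k)),
    p.domain = {v | ∀ i : Fin k, v ⟨2 * (i : ℕ), by omega⟩ ^ 2 + v ⟨2 * (i : ℕ) + 1, by omega⟩ ^ 2 ≤ 1} →
    (∀ v ∈ p.domain, p.integrand v = 1) →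
    KZ.toFormalPeriod (KZ.of p) = KZ.toFormalPeriod (KZ.of KZ.piRep) ^ k

/-- stub 62 — values of the unit balls of all dimensions (size M). CLOSED: p141420
`Theorems/InverseLandauTateLiftingBallValue.lean` (wave c9-4). [folklore] -/
theorem stub_ballValue : BallValueEven ∧ BallValueOdd :=
  tateLifting_ballValue

/-- stub 63 — even balls inside the rules (size S/M). CLOSED: p141347 `Theorems/InverseLandauTateLiftingBallEven.lean`
(wave c9-4). [cite: KontsevichZagier2001, §1.2] -/
theorem stub_ballEven : BallValueEven → BallEven :=
  tateLifting_ballEven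

/-- stub 64 — odd balls inside the rules (size S/M). CLOSED: p142149 `Theorems/InverseLandauTateLiftingBallOdd.lean`
(wave c9-4). [cite: KontsevichZagier2001, §1.2] -/
theorem stub_ballOdd : BallValueOdd → BallOdd :=
  tateLifting_ballOdd

/-- stub 65 — the polydisc has the class `⟦π⟧ᵏ` (size M). CLOSED: p142143 `Theorems/InverseLandauTateLiftingPolydiscPow.lean`
(wave c9-4). [cite: KontsevichZagier2001, §4.1] -/
theorem stub_polydiscPow : PolydiscPow :=
  tateLifting_polydiscPow

/-! ## Wave c9-4: composition -/

/-- **`k! · [B̄₂ₖ] − [D̄ᵏ] ∈ relations`** (modulo stubs 62, 63, 65): the even ball against the polydisc, every `k` — route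
EulerFormChain's `BallCalibration` (`k = 2`) and `BallCalibrationSix` (`k = 3`) in one statement. [cite: KontsevichZagier2001, §1.2] -/
theorem ballPolydisc_of (hV : BallValueEven ∧ BallValueOdd) (hE : BallValueEven → BallEven) (hP : PolydiscPow)
    (k : ℕ) (b : KZ.IntegralRep (2 * k)) (hb : b.domain = {v | ∑ j, v j ^ 2 ≤ 1})
    (hbi : ∀ v ∈ b.domain, b.integrand v = 1) (p : KZ.IntegralRep (2 * k))
    (hp : p.domain = {v | ∀ i : Fin k, v ⟨2 * (i : ℕ), by omega⟩ ^ 2 + v ⟨2 * (i : ℕ) + 1, by omega⟩ ^ 2 ≤ 1})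
    (hpi : ∀ v ∈ p.domain, p.integrand v = 1) :
    (Nat.factorial k) • KZ.of b - KZ.of p ∈ KZ.relations := by
  rw [← KZ.toFormalPeriod_eq_zero_iff, map_sub, map_nsmul, hP k p hp hpi, ← hE hV.1 k b hb hbi, nsmul_eq_mul, sub_self]

/-- **`BallCalibration` of route EulerFormChain (stmt-3819), modulo stubs 62, 63, 65**: `2·[B̄₄] − [D̄ × D̄] ∈ relations`
(`vol B̄₄ = π²/2`). [cite: KontsevichZagier2001, §1.2] -/
theorem ballCalibration_of (hV : BallValueEven ∧ BallValueOdd) (hE : BallValueEven → BallEven) (hP : PolydiscPow)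
    (b : KZ.IntegralRep 4) (hb : b.domain = {v | ∑ j, v j ^ 2 ≤ 1}) (hbi : ∀ v ∈ b.domain, b.integrand v = 1)
    (p : KZ.IntegralRep 4) (hp : p.domain = {v | v 0 ^ 2 + v 1 ^ 2 ≤ 1 ∧ v 2 ^ 2 + v 3 ^ 2 ≤ 1})
    (hpi : ∀ v ∈ p.domain, p.integrand v = 1) :
    (2 : ℕ) • KZ.of b - KZ.of p ∈ KZ.relations := by
  have h := ballPolydisc_of hV hE hP 2 b hb hbi p ?_ hpi
  · simpa [Nat.factorial] using h
  · rw [hp]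
    ext v
    simp only [Set.mem_setOf_eq, Fin.forall_fin_two, Fin.isValue, Fin.val_zero, Fin.val_one, mul_zero, mul_one, zero_add]
    exact Iff.rfl

/-- **Archimedes inside the rules, modulo stubs 62, 64**: `3·⟦B̄₃⟧ = 4·⟦π⟧` in the formal period ring. [cite: KontsevichZagier2001, §1.2] -/
theorem archimedes_of (hV : BallValueEven ∧ BallValueOdd) (hO : BallValueOdd → BallOdd)
    (b : KZ.IntegralRep 3) (hb : b.domain = {v | ∑ j, v j ^ 2 ≤ 1}) (hbi : ∀ v ∈ b.domain, b.integrand v = 1) :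
    (3 : KZ.FormalPeriodRing) * KZ.toFormalPeriod (KZ.of b) = 4 * KZ.toFormalPeriod (KZ.of KZ.piRep) := by
  have h := hO hV.2 1 b hb hbi
  norm_num [Nat.doubleFactorial] at h
  exact h

end WaveFour

/-! ## Wave c9-4b (lead c9, session 4): THE INVERSION ENGINE AND THE COVOLUME OF THE MODULAR GROUP

Unbounded fibres and cusps enter the calculus through ONE rule-(2) move, the inversion `t ↦ 1/t` of the last coordinate over
`{t > 0}` (Jacobian `1/t²`, stub 66): `[σ, f] ≡ [{(x, t) | t > 0, (x, 1/t) ∈ σ}, f(x, 1/t)/t²]`. First instance: the standard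
fundamental domain `F₁ = {|x| ≤ ½, x² + y² ≥ 1, y > 0}` of `SL₂(ℤ)` with the hyperbolic area form `dx dy/y²` becomes the bounded conic
band `{|x| ≤ ½, 0 ≤ t ≤ 1/√(1−x²)}` with integrand `1` (area `2 arcsin ½ = π/3`, stub 67), which the landed conic-band kernel
(`conicBandKernel`, Baker-free here: Lindemann suffices) compares with the disc: **`[F₁, y⁻²] ∼ [D̄, 1/3]`** (stub 68) — route
EulerFormChain's `SLTwoZCovolume` (stmt-12917) VERBATIM, the `d = 2` cusp calibration `vol(ℍ/PSL₂(ℤ)) = π/3` inside the rules. -/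
section WaveFourB

/-- THE INVERSION ENGINE (stub 66): for a representation whose domain lies in `{x_last > 0}`, the pull-back along the inversion of the
last coordinate is an honest representation and differs from it by ONE rule-(2) move (`Φ(z) = update z last (z last)⁻¹`, injective and
smooth on `{z last > 0}`, `|det Φ'| = 1/(z last)²`; integrability of the pull-back by
`MeasureTheory.integrableOn_image_iff_integrableOn_abs_det_fderiv_smul`). [cite: KontsevichZagier2001, §1.2 rule (2)] -/
def InversionChart : Prop :=
  ∀ (n : ℕ) (r : KZ.IntegralRep (n + 1)), (∀ x ∈ r.domain, 0 < x (Fin.last n)) →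
    ∃ r' : KZ.IntegralRep (n + 1),
      r'.domain = {z | 0 < z (Fin.last n) ∧ Function.update z (Fin.last n) (z (Fin.last n))⁻¹ ∈ r.domain} ∧
      Set.EqOn r'.integrand
        (fun z => r.integrand (Function.update z (Fin.last n) (z (Fin.last n))⁻¹) / z (Fin.last n) ^ 2) r'.domain ∧
      KZ.of r - KZ.of r' ∈ KZ.relations

/-- THE ARCSINE BAND (stub 67): the integrand-`1` representation over the closed conic band
`{(x, t) | x² ≤ ¼, 0 ≤ t, t²(1 − x²) ≤ 1}` (= `{|x| ≤ ½, 0 ≤ t ≤ 1/√(1−x²)}`) has value `2 arcsin ½ = π/3`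
(`Real.hasDerivAt_arcsin`, FTC over `[−½, ½]`, area of the region under a graph). [folklore] -/
def ArcsinBandValue : Prop :=
  ∀ (g : KZ.IntegralRep 2), g.domain = {z | z 0 ^ 2 ≤ 1 / 4 ∧ 0 ≤ z 1 ∧ z 1 ^ 2 * (1 - z 0 ^ 2) ≤ 1} →
    (∀ z ∈ g.domain, g.integrand z = 1) → g.value = Real.pi / 3

/-- THE COVOLUME OF THE MODULAR GROUP INSIDE THE RULES (stub 68 = route EulerFormChain's `SLTwoZCovolume`, stmt-12917, modulo stubs
66, 67): `[F₁, y⁻²] ∼ [D̄, 1/3]` — inversion move, a null segment, the conic-band kernel on `3·[band] − [disc°]`, `3·[D̄, 1/3] ≡ [D̄, 1]`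
(`tateLifting_zsmulRep`), torsion-freeness of `FormalRep ⧸ relations`. [cite: KontsevichZagier2001, §1.2] -/
def SLTwoZCovolumeOf : Prop :=
  InversionChart → ArcsinBandValue →
    ∀ (r r' : KZ.IntegralRep 2), r.domain = {x | |x 0| ≤ 1 / 2 ∧ 1 ≤ x 0 ^ 2 + x 1 ^ 2 ∧ 0 < x 1} →
      Set.EqOn r.integrand (fun x => 1 / x 1 ^ 2) r.domain → r'.domain = {x | x 0 ^ 2 + x 1 ^ 2 ≤ 1} →
      Set.EqOn r'.integrand (fun _ => 1 / 3) r'.domain → KZ.Equivalent r r'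

/-- stub 66 — the inversion engine (size M). CLOSED: p142246 `Theorems/InverseLandauTateLiftingInversionChart.lean`
(wave c9-4b). [cite: KontsevichZagier2001, §1.2 rule (2)] -/
theorem stub_inversionChart : InversionChart :=
  tateLifting_inversionChart

/-- stub 67 — the arcsine band has area `π/3` (size M). CLOSED: p142635 `Theorems/InverseLandauTateLiftingArcsinBandValue.lean`
(wave c9-4b). [folklore] -/
theorem stub_arcsinBandValue : ArcsinBandValue :=
  tateLifting_arcsinBandValue

/-- stub 68 — the covolume of `SL₂(ℤ)` inside the rules, modulo 66–67 (size M/L). CLOSED: p142503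
`Theorems/InverseLandauTateLiftingSLTwoZCovolume.lean` (wave c9-4b). [cite: KontsevichZagier2001, §1.2] -/
theorem stub_slTwoZCovolume : SLTwoZCovolumeOf :=
  tateLifting_slTwoZCovolume

/-! ## Wave c9-4b: composition -/

/-- **Route EulerFormChain's `SLTwoZCovolume` (stmt-KontsevichZagierPeriods-12917), modulo stubs 66–68**: the standard fundamental
domain of `SL₂(ℤ)` with the hyperbolic area form is KZ-equivalent to `[D̄, 1/3]` (`vol(ℍ/PSL₂(ℤ)) = π/3` inside the rules).
[cite: KontsevichZagier2001, §1.2] -/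
theorem slTwoZCovolume_of (hI : InversionChart) (hA : ArcsinBandValue) (hS : SLTwoZCovolumeOf) :
    ∀ (r r' : KZ.IntegralRep 2), r.domain = {x | |x 0| ≤ 1 / 2 ∧ 1 ≤ x 0 ^ 2 + x 1 ^ 2 ∧ 0 < x 1} →
      Set.EqOn r.integrand (fun x => 1 / x 1 ^ 2) r.domain → r'.domain = {x | x 0 ^ 2 + x 1 ^ 2 ≤ 1} →
      Set.EqOn r'.integrand (fun _ => 1 / 3) r'.domain → KZ.Equivalent r r' :=
  hS hI hA

end WaveFourB

section CycleTen

/-! ## Cycle c10 (lead c10) — THE BETA / ELEMENTARY-MOVES SECTOR: nine open items of other KZ routes, VERBATIM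

Each `SectorXxx` below is the statement of an open item of another honest route of the summit, copied verbatim from its
route file (a certified element of `ker KZ.eval` to be shown to lie in `KZ.relations` by an explicit chain of the four
moves — a special case of the crux); the stub `stub_xxx` is discharged by the worker theorem
`InverseLandau.tateLifting_xxx` (file `Theorems/InverseLandauTateLifting<Xxx>.lean`, `--supports` this crux) and the
item is then closed in the tree by a one-line `Theorems/<Route><Decl>.lean --workitem <id>`. -/

/-- Stub 69 `SectorDuplicationFamily` = item stmt-KontsevichZagierPeriods-3727 `DuplicationFamily` of route CubicTransport (support, rank 9), verbatim. [folklore] -/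
def SectorDuplicationFamily : Prop :=
  ∀ a : ℚ, 0 < a → ∀ (r r' : KZ.IntegralRep 1), r.domain = {x | x 0 ∈ Set.Ioo (0:ℝ) 1} → Set.EqOn r.integrand (fun x => (x 0 * (1 - x 0)) ^ ((a:ℝ) - 1)) r.domain → r'.domain = {x | x 0 ∈ Set.Ioo (0:ℝ) 1} → Set.EqOn r'.integrand (fun x => (2:ℝ) ^ (1 - 2 * (a:ℝ)) * (x 0) ^ (-(1:ℝ)/2) * (1 - x 0) ^ ((a:ℝ) - 1)) r'.domain → KZ.Equivalent r r'

/-- Stub 69: `SectorDuplicationFamily` — CLOSED: p153214 `Theorems/InverseLandauTateLiftingDuplicationFamily.lean` (wave c10-2 (lead-briefed worker)). [folklore] -/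
theorem stub_duplicationFamily : SectorDuplicationFamily :=
  tateLifting_duplicationFamily

/-- Stub 70 `SectorLowdimDuplicationOneThird` = item stmt-KontsevichZagierPeriods-0118 `LowdimDuplicationOneThird` of route LowDimension (support, rank 4), verbatim. [folklore] -/
def SectorLowdimDuplicationOneThird : Prop :=
  ∀ (r r' : KZ.IntegralRep 1), r.domain = {x | x 0 ∈ Set.Ioo (0:ℝ) 1} → Set.EqOn r.integrand (fun x => (x 0 * (1 - x 0)) ^ (-(2:ℝ)/3)) r.domain → r'.domain = {x | x 0 ∈ Set.Ioo (0:ℝ) 1} → Set.EqOn r'.integrand (fun x => (2:ℝ) ^ ((1:ℝ)/3) * (x 0) ^ (-(1:ℝ)/2) * (1 - x 0) ^ (-(2:ℝ)/3)) r'.domain → KZ.Equivalent r r'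

/-- Stub 70: `SectorLowdimDuplicationOneThird` — CLOSED: p154181 `Theorems/InverseLandauTateLiftingLowdimDuplicationOneThird.lean` (wave c10-2 (lead-briefed worker)). [folklore] -/
theorem stub_lowdimDuplicationOneThird : SectorLowdimDuplicationOneThird :=
  tateLifting_lowdimDuplicationOneThird

/-- Stub 71 `SectorBetaHalfPi` = item stmt-KontsevichZagierPeriods-11053 `BetaHalfPi` of route KatzTower (support, rank 9), verbatim. [folklore] -/
def SectorBetaHalfPi : Prop :=
  ∀ (β : KZ.IntegralRep 1) (δ : KZ.IntegralRep 2), β.domain = {v : Fin 1 → ℝ | v 0 ∈ Set.Ioo (0:ℝ) 1} → Set.EqOn β.integrand (fun v => (v 0) ^ (-(1:ℝ)/2) * (1 - v 0) ^ (-(1:ℝ)/2)) β.domain → δ.domain = {x : Fin 2 → ℝ | x 0 ^ 2 + x 1 ^ 2 ≤ 1} → Set.EqOn δ.integrand (fun _ => (1:ℝ)) δ.domain → KZ.Equivalent β δ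

/-- Stub 71: `SectorBetaHalfPi` — CLOSED: p149931 `Theorems/InverseLandauTateLiftingBetaHalfPi.lean` (wave c10-1). [folklore] -/
theorem stub_betaHalfPi : SectorBetaHalfPi :=
  tateLifting_betaHalfPi

/-- Stub 72 `SectorLowdimRealPeriodSwap` = item stmt-KontsevichZagierPeriods-8773 `LowdimRealPeriodSwap` of route LowDimension (support, rank 9), verbatim. [folklore] -/
def SectorLowdimRealPeriodSwap : Prop :=
  ∀ (r r' : KZ.IntegralRep 1), r.domain = {x | 2 < x 0} → Set.EqOn r.integrand (fun x => (4 * (x 0) ^ 3 - 28 * x 0 + 24) ^ (-(1:ℝ)/2)) r.domain → r'.domain = {x | x 0 ∈ Set.Ioo (-3:ℝ) 1} → Set.EqOn r'.integrand (fun x => (4 * (x 0) ^ 3 - 28 * x 0 + 24) ^ (-(1:ℝ)/2)) r'.domain → KZ.Equivalent r r'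

/-- Stub 72: `SectorLowdimRealPeriodSwap` — CLOSED: p150087 `Theorems/InverseLandauTateLiftingRealPeriodSwap.lean` (wave c10-1). [folklore] -/
theorem stub_realPeriodSwap : SectorLowdimRealPeriodSwap :=
  tateLifting_realPeriodSwap

/-- Stub 73 `SectorParabolaDescends` = item stmt-KontsevichZagierPeriods-4431 `ParabolaDescends` of route GenericPointClass (support, rank 9), verbatim. [folklore] -/
def SectorParabolaDescends : Prop :=
  ∀ (r : KZ.IntegralRep 2) (s₀ s₁ : KZ.IntegralRep 1), r.domain = {z | ∀ i, z i ∈ Set.Ioo (0:ℝ) 1} → Set.EqOn r.integrand (fun z => 1 / (z 1 - z 0 ^ 2 - 5)) r.domain → s₀.domain = {y | ∀ i, y i ∈ Set.Ioo (0:ℝ) 1} → Set.EqOn s₀.integrand (fun y => 1 / (y 0 - 6)) s₀.domain → s₁.domain = {y | ∀ i, y i ∈ Set.Ioo (0:ℝ) 1} → Set.EqOn s₁.integrand (fun y => 2 * y 0 ^ 2 * (1 / (y 0 ^ 2 + 5) - 1 / (y 0 ^ 2 + 4))) s₁.domain → KZ.of r - KZ.of s₀ - KZ.of s₁ ∈ 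KZ.relations

/-- Stub 73: `SectorParabolaDescends` — CLOSED: p150884 `Theorems/InverseLandauTateLiftingParabolaDescends.lean` (wave c10-1). [folklore] -/
theorem stub_parabolaDescends : SectorParabolaDescends :=
  tateLifting_parabolaDescends

/-- Stub 74 `SectorDepolarisationSum` = item stmt-KontsevichZagierPeriods-5153 `DepolarisationSum` of route VietaFibre (support, rank 9), verbatim. [folklore] -/
def SectorDepolarisationSum : Prop :=
  ∀ (a b c : ℚ) (r : KZ.IntegralRep 1) (r' : KZ.IntegralRep 0), 0 < a → 0 < b → 0 < c → r.domain = {x | x 0 ∈ Set.Ioo (0 : ℝ) 1} → Set.EqOn r.integrand (fun x => (a * b * c : ℝ) * Real.sqrt (1 - x 0) / Real.sqrt ((a ^ 2 * (1 - x 0) + x 0) * (b ^ 2 * (1 - x 0) + x 0) * (c ^ 2 * (1 - x 0) + x 0)) * (1 / (a ^ 2 * (1 - x 0) + x 0) + 1 / (b ^ 2 * (1 - x 0) + x 0) + 1 / (c ^ 2 * (1 - x 0) + x 0))) r.domain → r'.domain = Set.univ → Set.EqOn r'.integrand (fun _ => 2) r'.domain → KZ.Equivalent r r'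

/-- Stub 74: `SectorDepolarisationSum` — CLOSED: p150679 `Theorems/InverseLandauTateLiftingDepolarisationSum.lean` (wave c10-1). [folklore] -/
theorem stub_depolarisationSum : SectorDepolarisationSum :=
  tateLifting_depolarisationSum

/-- Stub 75 `SectorBeanStoneDisc` = item stmt-KontsevichZagierPeriods-12252 `BeanStoneDisc` of route WeightFloor (support, rank 9), verbatim. [folklore] -/
def SectorBeanStoneDisc : Prop :=
  ∀ (r r' : KZ.IntegralRep 2), r.domain = {v : Fin 2 → ℝ | 4 * v 1 ^ 2 ≤ (1 - v 0 ^ 2) * (2 + v 0) ^ 2 ∧ -1 ≤ v 0} → (∀ x ∈ r.domain, r.integrand x = 1) → r'.domain = {v : Fin 2 → ℝ | v 0 ^ 2 + v 1 ^ 2 ≤ 1} → (∀ x ∈ r'.domain, r'.integrand x = 1) → KZ.Equivalent r r'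

/-- Stub 75: `SectorBeanStoneDisc` — CLOSED: p150691 `Theorems/InverseLandauTateLiftingBeanStoneDisc.lean` (wave c10-1). [folklore] -/
theorem stub_beanStoneDisc : SectorBeanStoneDisc :=
  tateLifting_beanStoneDisc

/-- Stub 76 `SectorTubeIsTwist` = item stmt-KontsevichZagierPeriods-14422 `TubeIsTwist` of route AttractorUnfolding (support, rank 9), verbatim. [folklore] -/
def SectorTubeIsTwist : Prop :=
  ∀ (P : ∀ n : ℕ, KZ.IntegralRep n → KZ.IntegralRep (n + 2)), (∀ (n : ℕ) (r : KZ.IntegralRep n), (P n r).domain = {z : Fin (n + 2) → ℝ | z 0 ^ 2 + z 1 ^ 2 ≤ 1 ∧ (fun i : Fin n => z i.succ.succ) ∈ r.domain} ∧ (P n r).integrand = fun z => r.integrand (fun i : Fin n => z i.succ.succ)) → ∀ (n : ℕ) (ρ : KZ.IntegralRep n) (r' : KZ.IntegralRep (n + 1)), r'.domain = {z | (Fin.init z : Fin n → ℝ) ∈ ρ.domain} → Set.EqOn r'.integrand (fun z => ρ.integrand (Fin.init z) / (1 + z (Fin.last n) ^ 2)) r'.domain → KZ.of r' - KZ.of (P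 n ρ) ∈ KZ.relations

/-- Stub 76: `SectorTubeIsTwist` — CLOSED: p150042 `Theorems/InverseLandauTateLiftingTubeIsTwist.lean` (wave c10-1). [folklore] -/
theorem stub_tubeIsTwist : SectorTubeIsTwist :=
  tateLifting_tubeIsTwist

/-- Stub 77 `SectorUnitIntervalSpin` = item stmt-KontsevichZagierPeriods-16460 `UnitIntervalSpin` of route SpheresForWalls (support, rank 9), verbatim. [folklore] -/
def SectorUnitIntervalSpin : Prop :=
  ∀ (ρ : KZ.IntegralRep 3) (R : KZ.IntegralRep 2), ρ.domain = {z | z 0 ^ 2 + z 1 ^ 2 ≤ 1 ∧ 0 < z 2 ∧ z 2 < 1} → (∀ z ∈ ρ.domain, ρ.integrand z = 1) → R.domain = Set.univ → (R.integrand = fun w => ((1 + (w 0 ^ 2 + w 1 ^ 2)) ^ 2)⁻¹) → KZ.of ρ - KZ.of R ∈ KZ.relations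

/-- Stub 77: `SectorUnitIntervalSpin` — CLOSED: p150584 `Theorems/InverseLandauTateLiftingUnitIntervalSpin.lean` (wave c10-1). [folklore] -/
theorem stub_unitIntervalSpin : SectorUnitIntervalSpin :=
  tateLifting_unitIntervalSpin

/-! ## Cycle c10, wave 2 — six more open items of other KZ routes, VERBATIM (cone chart, rotation/log, Coxeter chamber, rational
angles, the 3-sphere, Kummer's log 2) -/

/-- Stub 78 `SectorWheelBodyToAffineChart` = item stmt-KontsevichZagierPeriods-4418 `WheelBodyToAffineChart` of route SiegelTamagawa (support, rank 9), verbatim. [folklore] -/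
def SectorWheelBodyToAffineChart : Prop :=
  ∀ (r : KZ.IntegralRep 6) (r' : KZ.IntegralRep 5), r.domain = {x : Fin 6 → ℝ | (∀ i, 0 < x i) ∧ x 0 * x 1 * x 3 + x 0 * x 1 * x 4 + x 0 * x 1 * x 5 + x 0 * x 2 * x 3 + x 0 * x 2 * x 4 + x 0 * x 2 * x 5 + x 0 * x 3 * x 5 + x 0 * x 4 * x 5 + x 1 * x 2 * x 3 + x 1 * x 2 * x 4 + x 1 * x 2 * x 5 + x 1 * x 3 * x 4 + x 1 * x 4 * x 5 + x 2 * x 3 * x 4 + x 2 * x 3 * x 5 + x 3 * x 4 * x 5 < 1} → Set.EqOn r.integrand (fun _ => 6) r.domain → r'.domain = {x | ∀ i, 0 < x i} → Set.EqOn r'.integrand (fun x => 1 / (x 0 * x 1 * x 3 + x 0 * x 1 * x 4 + x 0 * x 1 + x 0 * x 2 * x 3 + x 0 * x 2 * x 4 + x 0 * x 2 + x 0 * x 3 + x 0 * x 4 + x 1 * x 2 * x 3 + x 1 * x 2 * x 4 + x 1 * x 2 + x 1 * x 3 * x 4 + x 1 * x 4 + x 2 * x 3 * x 4 + x 2 *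 x 3 + x 3 * x 4) ^ 2) r'.domain → KZ.Equivalent r r'

/-- Stub 78: `SectorWheelBodyToAffineChart` — CLOSED: p153525 `Theorems/InverseLandauTateLiftingWheelBodyToAffineChart.lean` (wave c10-2). [folklore] -/
theorem stub_wheelBodyToAffineChart : SectorWheelBodyToAffineChart :=
  tateLifting_wheelBodyToAffineChart

/-- Stub 79 `SectorLogTwoSpin` = item stmt-KontsevichZagierPeriods-16461 `LogTwoSpin` of route SpheresForWalls (support, rank 9), verbatim. [folklore] -/
def SectorLogTwoSpin : Prop :=
  ∀ (ρ : KZ.IntegralRep 3) (R : KZ.IntegralRep 2), ρ.domain = {z | z 0 ^ 2 + z 1 ^ 2 ≤ 1 ∧ 1 < z 2 ∧ z 2 < 2} → (∀ z ∈ ρ.domain, ρ.integrand z = (z 2)⁻¹) → R.domain = Set.univ → (R.integrand = fun w => ((1 + 2 * (w 0 ^ 2 + w 1 ^ 2)) * (1 + (w 0 ^ 2 + w 1 ^ 2)))⁻¹) → KZ.of ρ - KZ.of R ∈ KZ.relations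

/-- Stub 79: `SectorLogTwoSpin` — CLOSED: p153212 `Theorems/InverseLandauTateLiftingLogTwoSpin.lean` (wave c10-2). [folklore] -/
theorem stub_logTwoSpin : SectorLogTwoSpin :=
  tateLifting_logTwoSpin

/-- Stub 80 `SectorCoxeterChamberTiling` = item stmt-KontsevichZagierPeriods-3818 `CoxeterChamberTiling` of route SphericalSchlafli (support, rank 9), verbatim. [folklore] -/
def SectorCoxeterChamberTiling : Prop :=
  ∀ (r b : KZ.IntegralRep 4), r.domain = {v | 0 ≤ v 1 ∧ 0 ≤ Real.sin (Real.pi / 9) * v 0 - Real.cos (Real.pi / 9) * v 1 ∧ 0 ≤ v 3 ∧ 0 ≤ Real.sin (Real.pi / 9) * v 2 - Real.cos (Real.pi / 9) * v 3 ∧ ∑ j, v j ^ 2 ≤ 1} → (∀ v ∈ r.domain, r.integrand v = 1) → b.domain = {v | ∑ j, v j ^ 2 ≤ 1} → (∀ v ∈ b.domain, b.integrand v = 1) → (324 : ℕ) • KZ.of r - KZ.of b ∈ KZ.relations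

/-- Stub 80: `SectorCoxeterChamberTiling` — CLOSED: p153844 `Theorems/InverseLandauTateLiftingCoxeterChamberTiling.lean` (wave c10-2). [folklore] -/
theorem stub_coxeterChamberTiling : SectorCoxeterChamberTiling :=
  tateLifting_coxeterChamberTiling

/-- Stub 81 `SectorRationalAngleSquares` = item stmt-KontsevichZagierPeriods-3820 `RationalAngleSquares` of route SphericalSchlafli (support, rank 9), verbatim. [folklore] -/
def SectorRationalAngleSquares : Prop :=
  ∀ (m n : ℕ), 0 < m → m < n → ∀ (a : KZ.IntegralRep 2), a.domain = {x | 0 ≤ x 0 ∧ x 0 ≤ Real.tan (m * Real.pi / (2 * n)) ∧ 0 ≤ x 1 ∧ x 1 ≤ Real.tan (m * Real.pi / (2 * n))} → (∀ x ∈ a.domain, a.integrand x = 4 / ((1 + x 0 ^ 2) * (1 + x 1 ^ 2))) → ∀ (p : KZ.IntegralRep 4), p.domain = {v | v 0 ^ 2 + v 1 ^ 2 ≤ 1 ∧ v 2 ^ 2 + v 3 ^ 2 ≤ 1} → (∀ v ∈ p.domain, p.integrand v = 1) → (n ^ 2) • KZ.of a - (m ^ 2) • KZ.of p ∈ KZ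.relations

/-- Stub 81: `SectorRationalAngleSquares` — CLOSED: p153052 `Theorems/InverseLandauTateLiftingRationalAngleSquares.lean` (wave c10-2). [folklore] -/
theorem stub_rationalAngleSquares : SectorRationalAngleSquares :=
  tateLifting_rationalAngleSquares

/-- Stub 82 `SectorThreeSphereVolume` = item stmt-KontsevichZagierPeriods-4308 `ThreeSphereVolume` of route LinkTwistWrithe (support, rank 9), verbatim. [folklore] -/
def SectorThreeSphereVolume : Prop :=
  ∀ (r : KZ.IntegralRep 3) (r' : KZ.IntegralRep 4), r.domain = Set.univ → Set.EqOn r.integrand (fun x : Fin 3 → ℝ => 8 / (1 + x 0 ^ 2 + x 1 ^ 2 + x 2 ^ 2) ^ 3) r.domain → r'.domain = {w : Fin 4 → ℝ | w 0 ^ 2 + w 1 ^ 2 < 1 ∧ w 2 ^ 2 + w 3 ^ 2 < 1} → Set.EqOn r'.integrand (fun _ => (1 : ℝ)) r'.domain → KZ.of r - 2 • KZ.of r' ∈ KZ.relations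

/-- Stub 82: `SectorThreeSphereVolume` — CLOSED: p154474 `Theorems/InverseLandauTateLiftingThreeSphereVolume.lean` (wave c10-2). [folklore] -/
theorem stub_threeSphereVolume : SectorThreeSphereVolume :=
  tateLifting_threeSphereVolume

/-- Stub 83 `SectorKummerLogTwo` = item stmt-KontsevichZagierPeriods-6778 `KummerLogTwo` of route GenusOneIterated (crux, rank 4), verbatim. [folklore] -/
def SectorKummerLogTwo : Prop :=
  ∀ (r : KZ.IntegralRep 2) (r' : KZ.IntegralRep 1), r.domain = {x | -1 < x 0 ∧ x 0 < x 1 ∧ x 1 < 0} → Set.EqOn r.integrand (fun x => (x 1 - x 0) / (Real.sqrt (4 * x 0 ^ 3 - 4 * x 0) * Real.sqrt (4 * x 1 ^ 3 - 4 * x 1))) r.domain → r'.domain = {x | 1 < x 0 ∧ x 0 < 2} → Set.EqOn r'.integrand (fun x => 1 / (2 * x 0)) r'.domain → KZ.Equivalent r r'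

/-- Stub 83: `SectorKummerLogTwo` — CLOSED: p152859 `Theorems/InverseLandauTateLiftingKummerLogTwo.lean` (wave c10-2). [folklore] -/
theorem stub_kummerLogTwo : SectorKummerLogTwo :=
  tateLifting_kummerLogTwo

/-! ## Cycle c10, wave 3 — three more calculus items of other KZ routes, VERBATIM (Dirichlet chart on a truncated simplex, Euler's
reflection formula for rational arguments, Minkowski's reduced binary forms) -/

/-- Stub 84 `SectorBetaGammaTruncated` = item stmt-KontsevichZagierPeriods-7183 `BetaGammaTruncated` of route WeightLine (support, rank 9), verbatim. [folklore] -/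
def SectorBetaGammaTruncated : Prop :=
  ∀ (t : ℚ) (r₁ r₂ : KZ.IntegralRep 2), r₁.domain = {x | 0 < x 0 ∧ 0 < x 1 ∧ x 0 + x 1 < (t : ℝ)} → Set.EqOn r₁.integrand (fun x => (x 0) ^ (-(2:ℝ)/3) * (x 1) ^ (-(2:ℝ)/3)) r₁.domain → r₂.domain = {x | 0 < x 0 ∧ x 0 < (t : ℝ) ∧ x 1 ∈ Set.Ioo (0:ℝ) 1} → Set.EqOn r₂.integrand (fun x => (x 0) ^ (-(1:ℝ)/3) * (x 1 * (1 - x 1)) ^ (-(2:ℝ)/3)) r₂.domain → KZ.Equivalent r₁ r₂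

/-- Stub 84: `SectorBetaGammaTruncated` — CLOSED: p155512 `Theorems/InverseLandauTateLiftingBetaGammaTruncated.lean` (wave c10-3). [folklore] -/
theorem stub_betaGammaTruncated : SectorBetaGammaTruncated :=
  tateLifting_betaGammaTruncated

/-- Stub 85 `SectorEulerReflectionRational` = item stmt-KontsevichZagierPeriods-3383 `EulerReflectionRational` of route CompiledSubstitutions (crux, rank 5), verbatim. [folklore] -/
def SectorEulerReflectionRational : Prop :=
  ∀ a : ℚ, 0 < a → a < 1 → ∀ (r : KZ.IntegralRep 1) (p : KZ.IntegralRep 2), r.domain = {x | x 0 ∈ Set.Ioo (0:ℝ) 1} → Set.EqOn r.integrand (fun x => Real.sin (Real.pi * a) * (x 0) ^ ((a : ℝ) - 1) * (1 - x 0) ^ (-(a : ℝ))) r.domain → p.domain = {z | z 0 ^ 2 + z 1 ^ 2 ≤ 1} → Set.EqOn p.integrand (fun _ => 1) p.domain → KZ.Equivalent r p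

/-- Stub 85: `SectorEulerReflectionRational` — CLOSED: p155921 `Theorems/InverseLandauTateLiftingEulerReflectionRational.lean` (wave c10-3). [folklore] -/
theorem stub_eulerReflectionRational : SectorEulerReflectionRational :=
  tateLifting_eulerReflectionRational

/-- Stub 86 `SectorMinkowskiBinaryAccessible` = item stmt-KontsevichZagierPeriods-4419 `MinkowskiBinaryAccessible` of route SiegelTamagawa (support, rank 9), verbatim. [folklore] -/
def SectorMinkowskiBinaryAccessible : Prop :=
  ∀ (r : KZ.IntegralRep 3) (r' : KZ.IntegralRep 2), r.domain = {y : Fin 3 → ℝ | 2 * |y 2| ≤ y 0 ∧ y 0 ≤ y 1 ∧ 0 < y 0 * y 1 - y 2 ^ 2 ∧ y 0 * y 1 - y 2 ^ 2 < 1} → Set.EqOn r.integrand (fun _ => 1) r.domain → r'.domain = {x : Fin 2 → ℝ | x 0 ^ 2 + x 1 ^ 2 < 2 / 9} → Set.EqOn r'.integrand (fun _ => 1) r'.domain → KZ.Equivalent r r'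

/-- Stub 86: `SectorMinkowskiBinaryAccessible` — CLOSED: p156886 `Theorems/InverseLandauTateLiftingMinkowskiBinaryAccessible.lean` (wave c10-3). [folklore] -/
theorem stub_minkowskiBinaryAccessible : SectorMinkowskiBinaryAccessible :=
  tateLifting_minkowskiBinaryAccessible

/-! ## Cycle c10, wave 4 — two more calculus items VERBATIM (Cauchy–Crofton perimeter of the ellipse as one Newton–Leibniz descent;
the WZ coset-wall triplication shift as Dirichlet re-association of Beta products) -/

/-- Stub 87 `SectorCroftonEllipse` = item stmt-KontsevichZagierPeriods-5397 `CroftonEllipse` of route KinematicFormulas (support, rank 9), verbatim. [folklore] -/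
def SectorCroftonEllipse : Prop :=
  ∀ a b : ℚ, 0 < a → 0 < b → ∀ (r : KZ.IntegralRep 2) (r' : KZ.IntegralRep 1), r.domain = {y : Fin 2 → ℝ | 0 ≤ y 1 ∧ ∃ q : Fin 2 → ℝ, (b : ℝ) ^ 2 * q 0 ^ 2 + (a : ℝ) ^ 2 * q 1 ^ 2 ≤ (a : ℝ) ^ 2 * (b : ℝ) ^ 2 ∧ (1 - y 0 ^ 2) * q 0 + 2 * y 0 * q 1 = (1 + y 0 ^ 2) * y 1} → Set.EqOn r.integrand (fun y => 2 / (1 + y 0 ^ 2)) r.domain → r'.domain = Set.univ → Set.EqOn r'.integrand (fun s => 2 * Real.sqrt (4 * (a : ℝ) ^ 2 * s 0 ^ 2 + (b : ℝ) ^ 2 * (1 - s 0 ^ 2) ^ 2) / (1 + s 0 ^ 2) ^ 2) r'.domain → KZ.of r - KZ.of r' ∈ KZ.relations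

/-- Stub 87: `SectorCroftonEllipse` — CLOSED: p159200 `Theorems/InverseLandauTateLiftingCroftonEllipse.lean` (wave c10-4). [folklore] -/
theorem stub_croftonEllipse : SectorCroftonEllipse :=
  tateLifting_croftonEllipse

/-- Stub 88 `SectorTriplicationThirdShift` = item stmt-KontsevichZagierPeriods-6875 `TriplicationThirdShift` of route WZCosetWall (crux, rank 4), verbatim. [folklore] -/
def SectorTriplicationThirdShift : Prop :=
  ∀ x : ℚ, 0 < x → ∀ (r r' : KZ.IntegralRep 2), r.domain = {z | ∀ i, z i ∈ Set.Ioo (0:ℝ) 1} → Set.EqOn r.integrand (fun z => (3 * (x : ℝ) + 1) * (z 0) ^ ((x : ℝ) - 2/3) * (1 - z 0) ^ ((x : ℝ) - 1/3) * (z 1) ^ (2 * (x : ℝ)) * (1 - z 1) ^ (x : ℝ)) r.domain → r'.domain = {z | ∀ i, z i ∈ Set.Ioo (0:ℝ) 1} → Set.EqOn r'.integrand (fun z => (x : ℝ) * (z 0) ^ ((x : ℝ) - 1) * (1 - z 0) ^ ((x : ℝ) - 2/3) * (z 1) ^ (2 * (x : ℝ) - 2/3) * (1 - z 1) ^ ((x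 : ℝ) - 1/3)) r'.domain → KZ.Equivalent r r'

/-- Stub 88: `SectorTriplicationThirdShift` — CLOSED: p158655 `Theorems/InverseLandauTateLiftingTriplicationThirdShift.lean` (wave c10-4). [folklore] -/
theorem stub_triplicationThirdShift : SectorTriplicationThirdShift :=
  tateLifting_triplicationThirdShift

end CycleTen

end Summit.KontsevichZagierPeriods.InverseLandau.TateLiftingSketch

end
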